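import Literature.Geometry.Hyperkaehler.IsotropyGroupInvariance
import Literature.Geometry.Hyperkaehler.ComplexTorusHyperkaehler
import Mathlib.Algebra.QuaternionBasis
import Mathlib.Algebra.Quaternion
import Mathlib.RingTheory.AlgebraTower
import Mathlib.LinearAlgebra.Complex.Module
import Mathlib.LinearAlgebra.Projection
import Literature.LinearAlgebra.Matrix.ClassicalLieAlgebrasDimension
import Mathlib.LinearAlgebra.Matrix.BilinearForm
import Mathlib.LinearAlgebra.Multilinear.Basis
import Mathlib.Algebra.Lie.Classical
import Mathlib.Analysis.InnerProductSpace.EuclideanDist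
import Mathlib.Topology.Algebra.Module.FiniteDimension
import Mathlib.Tactic.Module
import HarnessLib

/-!
# `dim Hdg_S` along the generalized twistor lines of a `2n`-dimensional complex torus: `2n² + n` and "no Kähler
# classes" on a compact line (`ℍ(−1)`), `2n² + n` and two open Kähler cones on a line of type `ℍ(1)`,
# `k(k+1) + (2n−k)²` and no Kähler classes on a line of type `ℍ(0)` (Buskin 2018, Thm. 1.2, all three clauses),
# following the printed proof: `V_ℝ` is a free `ℍ`-module, one antisymmetric and three symmetric `n × n` blocks,
# `n(n−1)/2 + 3·n(n+1)/2 = 2n² + n`; one symmetric `2n × 2n` block; the normal form `V_ℝ = Im N ⊕ W ⊕ U` and its blocks;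
# §7 (gen 14): the Kähler locus of `Hdg_S` on a line of type `ℍ(1)` IS the union of the two (convex) cones, one per sheet,
# and the `GL(V_ℝ)`-orbits of lines of type `ℍ(0)` are EXACTLY `n`, classified by `k = dim Im N / 2 ∈ {1, …, n}`

Topic `Literature/Geometry/Hyperkaehler`, namespace `Literature.Geometry.Hyperkaehler.TwistorLine`. Written by the literature
seat `lit-w-verbitsky` (gen 13; §7 appended by gen 14) of the cell `pub-hsemireg` (HodgeConjecture venture), 2026-08-25, as the kernel leg of row V-V13
(«(1,1)-classes along torus twistor lines») of that cell's Verbitsky table. THEOREMS ONLY (no definition, no named fact, no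
`sorry`). Nothing in this file is a statement about the Hodge conjecture.

## Source, verbatim

N. Buskin, *A generalization of twistor lines for complex tori*, arXiv:1806.08390 (2018; PREPRINT — no journal version known
to zbMATH/Crossref in 2026-08), arXiv numbering; "chunk pNNNN Lm" = the corpus TeX text `paper:arxiv-1806.08390` (18 chunks):

* §1.2, chunk p0005 L1–4 (the object): "Let `Hdg_S = {Ω ∈ Hom(∧²V_ℝ, ℝ) | λᵗΩλ = Ω, λ ∈ S}` be the subspace of the
  alternating forms `Ω` on `V_ℝ` (where `λ` and `Ω` are written in a fixed basis of `V_ℝ`), and determining cohomology classes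
  in `H^{1,1}((V_ℝ/Γ, λ), ℝ)` for all `λ ∈ S`." Here (§1.1) `V_ℝ` is a real vector space of dimension `4n`, the tori
  `V_ℝ/Γ` have complex dimension `2n`, and a twistor line "of the type `ℍ(−1)`" is a compact one: the image
  `S = S(I, J) = {aI + bJ + cK | a² + b² + c² = 1}` of the unit imaginary quaternions under a representation
  `ℍ = ℍ(−1) → End V_ℝ`, i.e. `I² = J² = −1`, `IJ = −JI`, `K = IJ`; §1.1, chunk p0004 L32–49: for the split quaternions
  `ℍ(1) ↪ End V_ℝ`, "Denote the images of `i` and `j` under the embedding as `I` and `R` […] Then `I² = −Id, R² = Id,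
  IR + RI = 0`. […] The combination `xI + yR + zIR` is a complex structure operator if and only if
  `(xI+yR+zIR)² = (−x²+y²+z²)Id = −Id`, that is, `x² − y² − z² = 1`. Then the set `S(I,R) = {xI+yR+zIR | x²−y²−z² = 1}`
  which is a two-sheeted hyperboloid consisting of complex structures, is a generalized twistor line of the type `ℍ(1)`."
* **Theorem 1.2**, chunk p0005 L24–33: "For any twistor line `S` of the type `ℍ(−1)` we have `dim Hdg_S = 2n² + n` and
  `Hdg_S` does not contain any Kähler classes. All representations `ℍ(−1) → End V_ℝ` are equivalent, or, which is the same,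
  the adjoint action of `GL(V_ℝ)` on the set of compact twistor lines in `Compl` is transitive. For any twistor line `S` of
  type `ℍ(1)` we have `dim Hdg_S = 2n² + n`. The subspace `Hdg_S` contains two disjoint open cones of Kähler classes,
  corresponding to each of the connected components of `S`."
* Proof, §3 "Case of a compact `S`", chunk p0010 L43–50: "All representations `ℍ(−1) = ℍ → End V_ℝ` are equivalent and are
  direct sums of the unique irreducible 4-representations of `ℍ`. […] the transitivity of the action on twistor lines […]
  reduce the problem of counting the dimension of `Hdg_S` and proving the absence of Kähler classes in `Hdg_S` to doing so
  just for some (arbitrary) particular twistor line `S ⊂ Compl`."; L52–L87 (the convenient basis, `λᵗ = λ⁻¹ = −λ`): "The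
  matrices `Q` corresponding to the classes in `Hdg_S ⊂ H^{1,1}(V_ℝ/Γ, ℝ)` must satisfy `λᵗ Q λ = Q` for all `λ ∈ S`, or,
  what is the same, they must satisfy `QI = IQ, QJ = JQ`."; L90–L105: "Let `Q = (A B; −Bᵗ D)`, where `A, D` are
  skew-symmetric `2n × 2n`-matrices and `B` an arbitrary `2n × 2n`-matrix. Then the commutation relation `QI = IQ` means
  that `D = A` and `Bᵗ = B`. The commutation relation `QJ = JQ` means that if we write `A = (A₁ A₂; −A₂ᵗ A₄)`, where
  `A₁ᵗ = −A₁, A₄ᵗ = −A₄`, `B = (B₁ B₂; B₂ᵗ B₄)`, where `B₁ᵗ = B₁, B₄ᵗ = B₄`, then […]"; chunk p0011 L1–8: "The dimension of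
  the space of matrices `Q` satisfying the first bilinear relation is the sum of the dimensions of spaces of skew-symmetric
  `n × n`-matrices `A₁`, of symmetric `n × n`-matrices `A₂, B₁, B₂`, that is `n(n−1)/2 + 3·n(n+1)/2 = 2n² + n`. This is
  the dimension of the subspace `Hdg_{S(I,J)}` of classes in `H^{1,1}(V_ℝ/Γ, ℝ)` which stay of type `(1,1)` along
  `S(I, J)`."; chunk p0011 L106–110 (second clause): "For every `λ = aI + bJ + cK ∈ S(I, J)` we have that
  `−λ = −aI − bJ − cK ∈ S`, and the matrices `bA₂ + aB₁ + cB₂` and `−bA₂ − aB₁ − cB₂` cannot be both positively (or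
  negatively) definite. This means that among classes in `Hdg_{S(I,J)}` there are no Kähler classes."; §3 "Case of
  `S = S(I,R)`", chunk p0011 L120–127: "The anticommutation `IR = −RI` tells us that `I` establishes an isomorphism between
  the eigenspaces `Ker(R − Id)` and `Ker(R + Id)` of the operator `R`. We have the decomposition
  `V_ℝ = Ker(R − Id) ⊕ Ker(R + Id)`. Let `v₁, …, v_{2n}` be a basis of `Ker(R − Id)`, then `Iv₁, …, Iv_{2n}` is a basis of
  `Ker(R + Id)`."
* Thm. 1.2, `ℍ(0)` clause, chunk p0005 L40–49: "There are `n` non-equivalent faithful representations `ℍ(0) → End V_ℝ`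
  parametrized by integers `1 ≤ k ≤ n`, equivalently, there are `n` distinct `GL(V_ℝ)`-orbits of lines of the type `ℍ(0)` in
  `Compl`. For any non-compact twistor line `S` of the type `ℍ(0)` we have `dim Hdg_S = k(k+1) + (2n−k)²`, for the
  respective parameter `k`, and `Hdg_S` does not contain any Kähler classes for either of the two connected components of
  `S`." (§1.1: `ℍ(0) = ⟨i, n | i² = −1, n² = 0, in + ni = 0⟩`, the line `S(I, N) ∋ ±(I + aN + bIN)`.) Proof, §3 "Case of
  `S(I,N)`", chunk p0013 L1–7: "As `IN = −NI`, we have that both the kernel and the image of `N`, `Im N ⊂ Ker N ⊂ V_ℝ` are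
  `I`-invariant subspaces. Next, choosing an `I`-invariant complement `U` for `Ker N` in `V_ℝ`, `V_ℝ = Ker N ⊕ U`, a basis
  `u_1, …, u_k, Iu_1, …, Iu_k` of `U`, and an `I`-invariant complement `W` for `Im N` in `Ker N` together with its basis of
  the form `w_1, …, w_l, Iw_1, …, Iw_l`, we get … the basis `Nu_1, …, Nu_k, NIu_1, …, NIu_k, w_1, …, w_l, Iw_1, …, Iw_l,
  u_1, …, u_k, Iu_1, …, Iu_k` of `V_ℝ = Im N ⊕ W ⊕ U`, where `4k + 2l = dim V_ℝ = 4n`."; L37–41: "All non-equivalent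
  `4n`-representations are parametrized by the values of nonnegative integers `k, l` satisfying `4k + 2l = 4n`"; L43–55
  (the bilinear relations: "`IᵗQI = Q` … `NᵗQ + QN = 0` … `NᵗQN = 0` … holds automatically"); L57–159 (the blocks:
  "`QN = −NᵗQ` holds precisely when `A = 0, B = 0, C = Cᵗ` … `C` is a symmetric `2k × 2k`-matrix anticommuting with `I₁`,
  `D` is a skew-symmetric `2l × 2l`-matrix commuting with `I₂`, `F` is a skew-symmetric `2k × 2k`-matrix commuting with
  `I₁` and `E` is a `2l × 2k`-matrix satisfying `I₂E = −EI₁`. The vector spaces of such `C, D` and `F` have the respective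
  dimensions `k² + k, l²` and `k²` … the dimension of such `E`'s is equal `2kl` … the total dimension … is
  `k² + k + (k² + l² + 2kl) = k² + k + (k + l)² = k² + k + (2n − k)²`").

## What is formalised (`F` = `V_ℝ`, a finite-dimensional real normed space; `L, J : F →L[ℝ] F` with `L² = J² = −1`,
## `JL = −LJ` = the paper's `I, J`; a "`2`-covector" is `Ω : F [⋀^Fin 2]→L[ℝ] ℝ`, i.e. an element of `Hom(∧²V_ℝ, ℝ)`)

* §1 `apply₂_map_left`, `apply₂_map_right_comm`, `apply₂_map_map_right_comm` — for `Ω` of type `(1,1)` for `L` (and `J`):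
  `Ω(Lx, y) = −Ω(x, Ly)`, and the blocks `Ω(x, Ly)`, `Ω(x, Jy)`, `Ω(x, LJy)` are SYMMETRIC in `(x, y)` ("`Bᵗ = B`", the
  three symmetric blocks) while `Ω(x, y)` is antisymmetric; **`apply₂_twistor_eq_smul`**: `Ω(λx, λy) = (a²+b²+c²)·Ω(x, y)` for
  `λ = aL + bJ + cLJ`; hence **`forall_sphere_apply₂_eq_iff`**: `Ω ∈ Hdg_S` (type `(1,1)` for EVERY `λ ∈ S`) iff `Ω` is of
  type `(1,1)` for `L` and for `J` ("`λᵗQλ = Q` for all `λ ∈ S`, or, what is the same, `QI = IQ, QJ = JQ`");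
  `mem_ker_inf_ker_iff`: the same space as the concrete submodule `ker(L^* − 1) ⊓ ker(J^* − 1)` of `Hom(∧²V_ℝ, ℝ)`.
* §1 (second clause of Thm. 1.2) **`not_forall_apply₂_twistor_pos`**: such an `Ω` is `λ`-positive (`Ω(v, λv) > 0` for
  `v ≠ 0`, i.e. a Kähler form of `(V_ℝ/Γ, λ)`) for NO `λ ∈ S` — via `not_forall_apply₂_pos_of_anticommute` (an injective `μ`
  scaling `Ω` and anticommuting with `λ` gives `Ω(μv, λμv) = −|μ|²Ω(v, λv)`; `μ = −bL + aJ`, or `μ = L` when `λ = ±LJ`) and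
  the case `λ = L`, `not_forall_apply₂_map_pos`. DEVIATION from print, said plainly: Buskin verifies the second Riemann
  bilinear relation on the period matrices of the points of `S` (§3.1–3.2, p0011 L10–105) and concludes from `λ, −λ ∈ S`;
  the anticommuting partner `μ ∈ ℝ·S` is the shorter road to the same printed conclusion and needs no period matrices. (The
  tree's `IsLinearHyperkaehler.not_forall_quaternion_invariant_of_pos`, `KaehlerFormSquareNotInvariant.lean`, is the case
  `λ = I` on the complex carrier.)
* §2 **`exists_linearEquiv_blocks`** (the printed mechanism): in an adapted block basis `(e_a, Le_a, Je_a, LJe_a)_{a<m}` of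
  `V_ℝ` (Buskin–Izadi's `⟨v, Iv, Jv, IJv⟩`-basis; its existence with `dim_ℝ V_ℝ = 4m` is §3's
  **`exists_pairAdapted_basis_finrank`**, obtained as printed — "all representations `ℍ(−1) = ℍ → End V_ℝ` are equivalent
  and are direct sums of the unique irreducible 4-representations of `ℍ`" (p0010 L43–44): `V_ℝ` is a module over the skew
  field `ℍ` through `i ↦ L, j ↦ J, k ↦ LJ` (Mathlib's `QuaternionAlgebra.Basis.liftHom`), hence free, and an `ℍ`-basis times
  the real basis `1, i, j, k` of `ℍ` (`Basis.smulTower`) is the block basis; this replaces the paper's "convenient twistor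
  line + transitivity of `GL(V_ℝ)`", which the tree has as `ComplexStructure.exists_conj_of_pair`, and is independent of the
  tree's `ComplexStructure.exists_pairAdapted_basis`, `ComplexStructureAdaptedBasis.lean`, which grows a maximal independent
  block family), the four blocks `(Ω(e_a, e_b))`, `(Ω(e_a, Le_b))`, `(Ω(e_a, Je_b))`,
  `(Ω(e_a, LJe_b))` give a LINEAR ISOMORPHISM `Hdg_S ≅ so(m) × Sym_m × Sym_m × Sym_m` (= the paper's `A₁; A₂, B₁, B₂` up to
  the dictionary `I ↦ L` and signs): injective because every entry `Ω(q e_a, q' e_b)`, `q, q' ∈ {1, L, J, LJ}`, is `±` one of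
  these (the relations "`D = A`", "`A₄ = A₁`", "`B₄ = −B₁`", … of the display on p0010–p0011); surjective by writing down the
  `4m × 4m` Gram matrix with entries `ε(β, γ)·P_{β⁻¹γ}(a, b)` (`ε(β, γ)·q_{β⁻¹γ} = q̄_β q_γ` in the quaternion group) for
  given blocks `P_1 ∈ so(m)`, `P_L, P_J, P_{LJ} ∈ Sym_m`, and checking `L`- and `J`-invariance on the basis.
* §3 **`finrank_eq_choose_of_pairAdapted_basis`**: `dim Hdg_S = C(m, 2) + 3·C(m+1, 2)` ("`n(n−1)/2 + 3·n(n+1)/2`", with the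
  tree's counts `finrank_so`, `finrank_selfAdjointMatricesSubmodule_one` of `Literature/LinearAlgebra/Matrix/
  ClassicalLieAlgebrasDimension.lean`); `choose_two_add_three_mul_choose_two`: `= 2m² + m`;
  **`exists_pairAdapted_basis_finrank`** (the block basis, `dim_ℝ V_ℝ = 4m`); **`finrank_eq_of_forall_mem_iff`** /
  **`finrank_eq_of_forall_mem_iff_sphere`** / **`finrank_ker_inf_ker`**: THEOREM 1.2 (`ℍ(−1)`) — for every anticommuting
  pair of complex structures on a real space of dimension `4n`, `dim_ℝ Hdg_S = 2n² + n`, with `Hdg_S` given by the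
  `L, J`-condition, by the printed sphere condition, or as the concrete submodule.

* §4 (the `ℍ(1)` clause; `I² = −1`, `R² = 1`, `RI = −IR`): `apply₂_splitTwistor_eq_smul` (`Ω(λv, λw) = (x²−y²−z²)·Ω(v, w)`
  for `λ = xI + yR + zIR` once `Ω` is of type `(1,1)` for `I` and ANTI-invariant under `R`), **`forall_hyperboloid_apply₂_eq_iff`**
  (`Hdg_{S(I,R)}` = the forms of type `(1,1)` for `I` with `Ω(Rv, Rw) = −Ω(v, w)`), `exists_splitAdapted_basis` (the printed basis
  `(v_i, Iv_i)` with `Rv_i = v_i`), **`exists_linearEquiv_symm_of_split`** (the single block `(Ω(v_i, Iv_j))` is a linear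
  isomorphism onto `Sym_{2n}`; the diagonal blocks vanish), **`finrank_eq_of_forall_mem_iff_split`** /
  **`finrank_eq_of_forall_mem_iff_hyperboloid`** (`dim Hdg_S = C(2n+1, 2) = 2n² + n` on a `4n`-dimensional `V_ℝ`), and
  **`exists_anti_invariant_pos`**: an `I`-POSITIVE member of `Hdg_{S(I,R)}` exists (`Ω(v, w) = g(Iv, w)` for an `I`- and
  `R`-invariant inner product `g`), so Kähler classes of `(V_ℝ/Γ, ±I)` survive along the two sheets — in contrast with §1;
  **`two_open_kaehlerCones_of_split`** (with `isOpen_setOf_apply₂_pos`: positivity `Ω(v, Iv) > 0` is an OPEN condition on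
  `Ω`, by minimising over the unit sphere): inside `Hdg_{S(I,R)}` the `I`-positive and the `(−I)`-positive members are two
  open, non-empty, disjoint subsets ("two disjoint open cones of Kähler classes, corresponding to each of the connected
  components of `S`"); **`apply₂_splitTwistor_pos`**: an `I`-positive member of `Hdg_{S(I,R)}` is `λ`-positive for
  EVERY `λ = xI + yR + zIR` with `x² − y² − z² = 1`, `x > 0` (the identity `Ω(w, Iw) = 2x·Ω(v, λv) − Ω(v, Iv)` for
  `w = xv − yIRv + zRv`), so `K⁺` consists of classes Kähler along the whole sheet `S(I,R)⁺` (and `K⁻`, via `−Ω`, along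
  `S(I,R)⁻`); **`exists_conj_of_splitPair`**: "all faithful representations `ℍ(1) → End V_ℝ` are equivalent" — two
  pairs `(I₁, R₁)`, `(I₂, R₂)` on the same space are conjugate by a linear automorphism (their adapted bases have the same
  size `dim_ℝ V_ℝ / 2` and the same matrices).
* §5 (the `ℍ(0)` clause; `I² = −1`, `N² = 0`, `NI = −IN`): `apply₂_nilTwistor_eq_smul` (`Ω(λv, λw) = x²·Ω(v, w)` for
  `λ = xI + aN + bIN` once `Ω` is of type `(1,1)` for `I` and `N` is `Ω`-skew), **`forall_nilLine_apply₂_eq_iff`** (`Hdg_{S(I,N)}`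
  = the forms of type `(1,1)` for `I` with `Ω(Nv, w) = −Ω(v, Nw)`: "`IᵗQI = Q`, `NᵗQ + QN = 0`", the other relations
  automatic), **`not_forall_apply₂_nilTwistor_pos`** (no Kähler classes on either component: `Ω(Nu, λNu) = 0`),
  **`exists_nilAdapted_basis`** (the printed normal form `V_ℝ = Im N ⊕ W ⊕ U` with basis `(Nu_i, INu_i | w_j, Iw_j | u_i,
  Iu_i)`, `dim V_ℝ = 4k + 2l`, `dim Im N = 2k` — via the complex structure that `I` induces on `Ker N`, a complex complement
  `W` of `Im N` in `Ker N`, preimages `u_i` of a complex basis of `Im N`), **`finrank_eq_of_nilAdapted_basis`** (the eight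
  free blocks `C ↦ Sym_k × Sym_k`, `D ↦ so_l × Sym_l`, `F ↦ so_k × Sym_k`, `E ↦ Mat_{l×k} × Mat_{l×k}`: a linear isomorphism,
  `dim = k(k+1) + (k+l)²`), **`finrank_eq_of_forall_mem_iff_nil`** / **`finrank_eq_of_forall_mem_iff_nilLine`**
  (`dim Hdg_S = k(k+1) + (2n−k)²` on a `4n`-dimensional `V_ℝ` with `dim Im N = 2k`, basis-free), and
  **`exists_conj_of_nilPair`** (two pairs `(I, N)` with the same `dim Im N` are conjugate: "`n` non-equivalent faithful
  representations … parametrized by `k`").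
* §7 (gen 14; the two "immediate" leftovers of Thm. 1.2 and the exact orbit count). `ℍ(1)`: `splitTwistor_apply_apply`
  (`(aI + bR + cIR)² = (−a² + b² + c²)Id`; its polar form, the anticommutator `2(−aa' + bb' + cc')` of two points of the span,
  is the tree's `TwistorLine.anticommutator_splitTwistor`, recomputed inline where used), **`exists_splitPartner`** (through every point `λ = xI + yR + zIR` of the hyperboloid
  passes a split partner `μ = (yI + xR)/√(1+z²)`, `μ² = 1`, `μλ = −λμ`, and `I = xλ + y'μ + z'λμ` with
  `x² − y'² − z'² = 1`: the SAME first coordinate `x`), hence **`apply₂_splitTwistor_pos_iff`** / **`…_of_neg`** /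
  **`…_sheets`** / **`apply₂_splitTwistor_pos_of_sameSheet`**: a member of `Hdg_{S(I,R)}` is a Kähler form at a point of the
  upper sheet (`x > 0`) iff it is one at `I`, at a point of the lower sheet (`x < 0`) iff it is one at `−I` — being Kähler is
  a property of the SHEET; **`kaehlerLocus_eq_union_of_split`**: inside any carrier of `Hdg_S` the classes Kähler SOMEWHERE on
  the line are exactly `K⁺ ∪ K⁻` (with §4: two disjoint, non-empty, open cones — and nothing else on `S` is Kähler);
  **`convex_setOf_apply₂_pos`** / **`convex_setOf_coe_apply₂_pos`**: each cone is CONVEX, closed under sums and positive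
  multiples. `ℍ(0)`: **`finrank_range_eq_of_conj`** (conjugate pairs have the same `dim Im N`), **`exists_conj_iff_finrank_range_eq`**
  (the orbits are classified by `dim Im N`), **`exists_finrank_range_eq_two_mul`** (`dim Im N = 2k`, `1 ≤ k ≤ n`, for `N ≠ 0`
  on a `4n`-dimensional `V_ℝ`), **`exists_nilPair_finrank_range_eq`** (every `1 ≤ k ≤ n` occurs: the printed tables on a
  basis of the normal-form shape) — together: EXACTLY `n` orbits of lines of type `ℍ(0)` ("`n` non-equivalent faithful
  representations `ℍ(0) → End V_ℝ` parametrized by integers `1 ≤ k ≤ n`").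
* §6 (the tree's hyperkähler carrier): **`IsLinearHyperkaehler.finrank_eq_of_forall_mem_iff_apply₂`** /
  **`IsLinearHyperkaehler.finrank_eq_of_forall_mem_iff_quaternion`** — for a linear hyperkähler structure `(g₀; I = i•, J)`
  on a complex space of dimension `2n` (`ComplexTorusHyperkaehler.lean`) the real `2`-forms of type `(1,1)` for `I` and `J`,
  equivalently (Verbitsky's Prop. 1.2, the tree's `IsotropyGroupInvariance.lean`) the real `2`-forms invariant under every
  unit quaternion `a + bI + cJ + dK`, have dimension `2n² + n`.

Design: `Hdg_S` enters either as ANY submodule `S` with a membership hypothesis `hS` (so that importers may use their own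
carrier) or concretely as `LinearMap.ker (compContinuousLinearMapₗ L − id) ⊓ LinearMap.ker (compContinuousLinearMapₗ J − id)`.
The identification of `H²(V_ℝ/Γ, ℝ)` with the constant forms `Hom(∧²V_ℝ, ℝ)` and of `H^{1,1}((V_ℝ/Γ, λ), ℝ)` with the
`λ`-invariant ones is the tree's (`Literature/Geometry/Kaehler/ComplexTorus*.lean`) and is not restated: everything here is the
linear algebra of `V_ℝ`, which is the whole content of the printed proof.

## What is NOT here

Of Thm. 1.2: nothing of its linear algebra (since §7; the transitivity clause for `ℍ(−1)` is the tree's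
`ComplexStructure.exists_conj_of_pair`, `ComplexStructureAdaptedBasis.lean`, and is only cross-referenced). That the two
sheets `x > 0`, `x < 0` of the hyperboloid ARE the connected components of `S(I,R)` (topology of `S`) is used only as the
printed DICTIONARY "component ↔ sign of `x`" and is not itself formalised. Not here at all: Thm. 1.1 (the curves `S(I,R)`,
`S(I,N)` and their closures), Thm. 1.3 (`ℍ(ε)`-connectivity of `Compl`, `ε = ±1`), Rem. 1.4 (nothing is implied about the
locus of polarized tori); the period-matrix computation of §3.1–3.2.

## References

* [Buskin2018GeneralizedTwistorLines] N. Buskin, *A generalization of twistor lines for complex tori*, arXiv:1806.08390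
  (2018; v2 2019, PREPRINT), §1.1–§1.2 (Thm. 1.2), §3 (proof of Thm. 1.2, "Case of a compact S", "Case of S = S(I,R)",
  "Case of S(I,N)") — read in the corpus TeX text, chunks p0004–p0005, p0010–p0013; PDF page map (arXiv v2, by eye, cell
  seat lit-3): Thm. 1.2 = p.5, the `S(I,R)` sentences + Rem. 3.1 = p.16 top, the `ℍ(0)` basis / matrices / count = p.16
  bottom, `dim Hdg_{S(I,N)} = k² + k + (2n − k)²` = p.17.
* [BuskinIzadi2020TwistorLinesTori] N. Buskin, E. Izadi, *Twistor lines in the period domain of complex tori*, Geom. Dedicata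
  213 (2021) = arXiv:1806.07831v2, §1.2 (the block basis `⟨v, Iv, Jv, IJv⟩`; the tree's `ComplexStructureAdaptedBasis.lean`)
  and §5 "A toy example" (`n = 1`: `dim Hdg_S = 3`, quoted by Buskin p0005 L11–15).
* [BrockerTomDieck1985] Th. Bröcker, T. tom Dieck, *Representations of Compact Lie Groups*, I (2.15), (2.19) (the counts
  `dim so(n) = n(n−1)/2`, `dim Sym_n = n(n+1)/2`; the tree's `ClassicalLieAlgebrasDimension.lean`).
* [Verbitsky1996Hyperholomorphic] M. Verbitsky, *Hyperholomorphic bundles over a hyperkähler manifold*, J. Alg. Geom. 5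
  (1996) 633–669 = alg-geom/9307008, §1 Prop. 1.2 ("`G_M`-invariant iff of Hodge type `(p,p)` with respect to all induced
  complex structures"; the tree's `IsotropyGroupInvariance.lean`) — used only through that file, in §6.
-/

noncomputable section

open Module Matrix

namespace Literature.Geometry.Hyperkaehler.TwistorLine

variable {F : Type*} [NormedAddCommGroup F] [NormedSpace ℝ F]
  {W : Type*} [NormedAddCommGroup W] [NormedSpace ℝ W]

/-! ### §1 Two-forms of type `(1,1)` along the line: moving `L` and `J` across the form -/

/-- If `Ω(Lx, Ly) = Ω(x, y)` for a complex structure `L` (`L² = −1`), then `Ω(Lx, y) = −Ω(x, Ly)` ("for such a choice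
of basis we clearly have `λᵗ = λ⁻¹ = −λ`", so `λᵗQλ = Q` is `Qλ = λQ`). [cite: Buskin2018GeneralizedTwistorLines, §3 (chunk
p0010 L83–87)] -/
theorem apply₂_map_left {L : F →L[ℝ] F} (hL : ∀ v, L (L v) = -v) (Ω : F [⋀^Fin 2]→L[ℝ] W)
    (hΩ : ∀ v w, Ω ![L v, L w] = Ω ![v, w]) (x y : F) : Ω ![L x, y] = -Ω ![x, L y] := by
  have h := hΩ x (L y)
  rw [hL, apply₂_neg_right] at h
  rw [← h, neg_neg]

/-- If `Ω(Lx, Ly) = Ω(x, y)` for a complex structure `L`, then `(x, y) ↦ Ω(x, Ly)` is SYMMETRIC: `Ω(x, Ly) = Ω(y, Lx)`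
(Buskin: "`Bᵗ = B`", the symmetric blocks). [cite: Buskin2018GeneralizedTwistorLines, §3 (chunk p0010: "the commutation relation
QI = IQ means that D = A and Bᵗ = B")] -/
theorem apply₂_map_right_comm {L : F →L[ℝ] F} (hL : ∀ v, L (L v) = -v) (Ω : F [⋀^Fin 2]→L[ℝ] W)
    (hΩ : ∀ v w, Ω ![L v, L w] = Ω ![v, w]) (x y : F) : Ω ![x, L y] = Ω ![y, L x] := by
  rw [apply₂_swap Ω (L x) y, apply₂_map_left hL Ω hΩ, neg_neg]

/-- For an anticommuting pair `L, J` of complex structures and `Ω` of type `(1,1)` for both, the block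
`(x, y) ↦ Ω(x, LJy)` is symmetric as well. [cite: Buskin2018GeneralizedTwistorLines, §3 (chunks p0010–p0011: the blocks
`A₂, B₁, B₂` are symmetric)] -/
theorem apply₂_map_map_right_comm {L J : F →L[ℝ] F} (hL : ∀ v, L (L v) = -v) (hJ : ∀ v, J (J v) = -v)
    (hLJ : ∀ v, J (L v) = -L (J v)) (Ω : F [⋀^Fin 2]→L[ℝ] W) (hΩL : ∀ v w, Ω ![L v, L w] = Ω ![v, w])
    (hΩJ : ∀ v w, Ω ![J v, J w] = Ω ![v, w]) (x y : F) : Ω ![x, L (J y)] = Ω ![y, L (J x)] := by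
  have h1 : Ω ![x, L (J y)] = -Ω ![L x, J y] := by
    rw [apply₂_map_left hL Ω hΩL, neg_neg]
  have h2 : Ω ![L x, J y] = Ω ![L (J x), y] := by
    have h := apply₂_map_left hJ Ω hΩJ (L x) y
    rw [hLJ, apply₂_neg_left, neg_inj] at h
    exact h.symm
  rw [h1, h2, apply₂_swap Ω (L (J x)) y]

/-- **Scaling along the twistor family.** If `Ω` is of type `(1,1)` for the anticommuting complex structures `L` and
`J`, then for EVERY `λ = aL + bJ + cLJ` (`a, b, c ∈ ℝ`, not necessarily on the sphere)
`Ω(λv, λw) = (a² + b² + c²) · Ω(v, w)` — the cross terms cancel. [cite: Buskin2018GeneralizedTwistorLines, §3 (chunk p0010: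
"must satisfy `λᵗQλ = Q` for all `λ ∈ S`, or, what is the same, … `QI = IQ, QJ = JQ`")] -/
theorem apply₂_twistor_eq_smul {L J : F →L[ℝ] F} (hL : ∀ v, L (L v) = -v) (hJ : ∀ v, J (J v) = -v)
    (hLJ : ∀ v, J (L v) = -L (J v)) (Ω : F [⋀^Fin 2]→L[ℝ] W) (hΩL : ∀ v w, Ω ![L v, L w] = Ω ![v, w])
    (hΩJ : ∀ v w, Ω ![J v, J w] = Ω ![v, w]) (a b c : ℝ) (v w : F) :
    Ω ![(a • L + b • J + c • L.comp J) v, (a • L + b • J + c • L.comp J) w] = (a ^ 2 + b ^ 2 + c ^ 2) • Ω ![v, w] := by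
  -- move `L`, `J` from the left slot to the right slot and normalise the words in `L`, `J`
  have mvL := apply₂_map_left hL Ω hΩL
  have mvJ := apply₂_map_left hJ Ω hΩJ
  simp only [_root_.add_apply, _root_.smul_apply, ContinuousLinearMap.coe_comp, Function.comp_apply, apply₂_add_left,
    apply₂_add_right, apply₂_smul_left, apply₂_smul_right, mvL, mvJ, hL, hJ, hLJ, map_neg, apply₂_neg_right, smul_neg,
    neg_neg, smul_smul, smul_add]
  module

/-- **`Hdg_S` for the compact line.** For an anticommuting pair `L, J` of complex structures (a twistor line
`S = S(L, J) = {aL + bJ + cLJ | a² + b² + c² = 1}` of type `ℍ(−1)`), a `2`-covector is of type `(1,1)` for EVERY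
`λ ∈ S` — "`λᵗ Ω λ = Ω, λ ∈ S`" — iff it is so for `L` and for `J` ("they must satisfy `QI = IQ, QJ = JQ`").
[cite: Buskin2018GeneralizedTwistorLines, §1.2 (chunk p0005 L1–4: definition of `Hdg_S`) and §3 (chunk p0010: "must satisfy
`λᵗQλ = Q` for all `λ ∈ S`, or, what is the same, they must satisfy `QI = IQ, QJ = JQ`")] -/
theorem forall_sphere_apply₂_eq_iff {L J : F →L[ℝ] F} (hL : ∀ v, L (L v) = -v) (hJ : ∀ v, J (J v) = -v)
    (hLJ : ∀ v, J (L v) = -L (J v)) (Ω : F [⋀^Fin 2]→L[ℝ] W) :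
    (∀ a b c : ℝ, a ^ 2 + b ^ 2 + c ^ 2 = 1 →
        ∀ v w, Ω ![(a • L + b • J + c • L.comp J) v, (a • L + b • J + c • L.comp J) w] = Ω ![v, w]) ↔
      (∀ v w, Ω ![L v, L w] = Ω ![v, w]) ∧ ∀ v w, Ω ![J v, J w] = Ω ![v, w] := by
  constructor
  · intro h
    refine ⟨fun v w ↦ ?_, fun v w ↦ ?_⟩
    · simpa using h 1 0 0 (by norm_num) v w
    · simpa using h 0 1 0 (by norm_num) v w
  · rintro ⟨hΩL, hΩJ⟩ a b c habc v w
    rw [apply₂_twistor_eq_smul hL hJ hLJ Ω hΩL hΩJ, habc, one_smul]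

/-- The mechanism behind "no Kähler classes on a compact line": if `μ` is injective, scales `Ω` by a positive
factor (`Ω(μx, μy) = t·Ω(x, y)`, `t > 0`) and ANTICOMMUTES with `Λ`, then `Ω` is not `Λ`-positive:
`Ω(μv, Λμv) = −t·Ω(v, Λv)`. [cite: Buskin2018GeneralizedTwistorLines, §3 (chunk p0011: "for every λ ∈ S(I,J) we have that
−λ ∈ S … cannot be both positively (or negatively) definite")] -/
theorem not_forall_apply₂_pos_of_anticommute [Nontrivial F] {Λ μ : F →L[ℝ] F} (Ω : F [⋀^Fin 2]→L[ℝ] ℝ) {t : ℝ}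
    (ht : 0 < t) (hμ : ∀ x y, Ω ![μ x, μ y] = t * Ω ![x, y]) (hμ0 : ∀ v, μ v = 0 → v = 0)
    (hanti : ∀ v, Λ (μ v) = -μ (Λ v)) : ¬ ∀ v, v ≠ 0 → 0 < Ω ![v, Λ v] := by
  intro h
  obtain ⟨v, hv⟩ := exists_ne (0 : F)
  have h1 := h v hv
  have h2 := h (μ v) fun h0 ↦ hv (hμ0 v h0)
  rw [hanti, apply₂_neg_right, hμ] at h2
  nlinarith [mul_pos ht h1]

/-- **No Kähler class survives the compact line**, the case `λ = L`: a real `2`-form of type `(1,1)` for `L` and for an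
anticommuting `J` is never `L`-positive (`Ω(Jv, LJv) = −Ω(v, Lv)`). The tree's
`IsLinearHyperkaehler.not_forall_quaternion_invariant_of_pos` is the same statement on the complex carrier.
[cite: Buskin2018GeneralizedTwistorLines, Thm. 1.2 (chunk p0005 L26–27: "and Hdg_S does not contain any Kähler classes")] -/
theorem not_forall_apply₂_map_pos [Nontrivial F] {L J : F →L[ℝ] F} (hJ : ∀ v, J (J v) = -v)
    (hLJ : ∀ v, J (L v) = -L (J v)) (Ω : F [⋀^Fin 2]→L[ℝ] ℝ) (hΩJ : ∀ v w, Ω ![J v, J w] = Ω ![v, w]) :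
    ¬ ∀ v, v ≠ 0 → 0 < Ω ![v, L v] :=
  not_forall_apply₂_pos_of_anticommute Ω one_pos (μ := J) (fun x y ↦ by rw [hΩJ, one_mul])
    (fun v hv ↦ by simpa [hv] using (hJ v).symm) fun v ↦ by rw [hLJ, neg_neg]

/-- **Theorem 1.2 (`ℍ(−1)`), second clause: "`Hdg_S` does not contain any Kähler classes."** A real `2`-form of type
`(1,1)` for the anticommuting complex structures `L, J` (equivalently, by `forall_sphere_apply₂_eq_iff`, for every point of
the compact line `S = S(L, J)`) is `λ`-positive — `Ω(v, λv) > 0` for `v ≠ 0`, i.e. a Kähler form for `(V_ℝ/Γ, λ)` — for NO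
`λ = aL + bJ + cLJ ∈ S`: the point `μ = −bL + aJ ∈ ℝ·S` (or `μ = L` when `λ = ±LJ`) anticommutes with `λ`, and
`Ω(μv, λμv) = −|μ|²·Ω(v, λv)`. [cite: Buskin2018GeneralizedTwistorLines, Thm. 1.2 (chunk p0005 L26–27) with proof §3 (chunk p0011:
"for every λ = aI+bJ+cK ∈ S(I,J) we have that −λ = −aI−bJ−cK ∈ S … This means that among classes in Hdg_{S(I,J)} there
are no Kähler classes")] -/
theorem not_forall_apply₂_twistor_pos [Nontrivial F] {L J : F →L[ℝ] F} (hL : ∀ v, L (L v) = -v)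
    (hJ : ∀ v, J (J v) = -v) (hLJ : ∀ v, J (L v) = -L (J v)) (Ω : F [⋀^Fin 2]→L[ℝ] ℝ)
    (hΩL : ∀ v w, Ω ![L v, L w] = Ω ![v, w]) (hΩJ : ∀ v w, Ω ![J v, J w] = Ω ![v, w]) {a b c : ℝ}
    (habc : a ^ 2 + b ^ 2 + c ^ 2 = 1) :
    ¬ ∀ v, v ≠ 0 → 0 < Ω ![v, (a • L + b • J + c • L.comp J) v] := by
  by_cases hab : a = 0 ∧ b = 0
  · -- `λ = ±LJ`: the partner is `μ = L`
    obtain ⟨rfl, rfl⟩ := hab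
    refine not_forall_apply₂_pos_of_anticommute Ω one_pos (μ := L) (fun x y ↦ by rw [hΩL, one_mul])
      (fun v hv ↦ by simpa [hv] using (hL v).symm) fun v ↦ ?_
    simp only [zero_smul, zero_add, _root_.smul_apply, ContinuousLinearMap.coe_comp, Function.comp_apply, hLJ, hL,
      map_neg, map_smul, smul_neg, neg_neg]
  · -- generic `λ`: the partner is `μ = −bL + aJ`, `|μ|² = a² + b² > 0`
    have ht : 0 < a ^ 2 + b ^ 2 := by
      rcases not_and_or.mp hab with ha | hb
      · have := sq_pos_iff.mpr ha
        nlinarith [sq_nonneg b]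
      · have := sq_pos_iff.mpr hb
        nlinarith [sq_nonneg a]
    refine not_forall_apply₂_pos_of_anticommute Ω ht (μ := (-b) • L + a • J + (0 : ℝ) • L.comp J)
      (fun x y ↦ ?_) (fun v hv ↦ ?_) fun v ↦ ?_
    · rw [apply₂_twistor_eq_smul hL hJ hLJ Ω hΩL hΩJ, smul_eq_mul]
      ring
    · -- `μ² = −(a² + b²)`, so `μ` is injective
      have hμμ : ((-b) • L + a • J + (0 : ℝ) • L.comp J) (((-b) • L + a • J + (0 : ℝ) • L.comp J) v) =
          -((a ^ 2 + b ^ 2) • v) := by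
        simp only [_root_.add_apply, _root_.smul_apply, map_add, map_smul, hL, hJ, hLJ, smul_neg, zero_smul,
          add_zero, smul_add, smul_smul]
        module
      rw [hv, map_zero] at hμμ
      have h0 : (a ^ 2 + b ^ 2) • v = 0 := neg_eq_zero.mp hμμ.symm
      exact (smul_eq_zero.mp h0).resolve_left ht.ne'
    · simp only [_root_.add_apply, _root_.smul_apply, ContinuousLinearMap.coe_comp, Function.comp_apply, map_add,
        map_smul, hL, hJ, hLJ, map_neg, smul_neg, neg_neg, zero_smul, add_zero, smul_add, neg_add, smul_smul]
      module

/-- Membership in the concrete carrier `ker(L^* − 1) ⊓ ker(J^* − 1)` of `Hdg_S` (pull-back `L^*Ω = Ω ∘ (L × L)` as the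
bundled linear map `ContinuousAlternatingMap.compContinuousLinearMapₗ L`). [cite: Buskin2018GeneralizedTwistorLines, §1.2
(chunk p0005 L1–4: `Hdg_S = {Ω ∈ Hom(∧²V_ℝ, ℝ) | λᵗΩλ = Ω, λ ∈ S}`)] -/
theorem mem_ker_inf_ker_iff (L J : F →L[ℝ] F) (Ω : F [⋀^Fin 2]→L[ℝ] ℝ) :
    Ω ∈ LinearMap.ker ((ContinuousAlternatingMap.compContinuousLinearMapₗ L :
          (F [⋀^Fin 2]→L[ℝ] ℝ) →ₗ[ℝ] (F [⋀^Fin 2]→L[ℝ] ℝ)) - LinearMap.id) ⊓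
        LinearMap.ker ((ContinuousAlternatingMap.compContinuousLinearMapₗ J :
          (F [⋀^Fin 2]→L[ℝ] ℝ) →ₗ[ℝ] (F [⋀^Fin 2]→L[ℝ] ℝ)) - LinearMap.id) ↔
      (∀ v w, Ω ![L v, L w] = Ω ![v, w]) ∧ ∀ v w, Ω ![J v, J w] = Ω ![v, w] := by
  have key : ∀ T : F →L[ℝ] F, Ω ∈ LinearMap.ker ((ContinuousAlternatingMap.compContinuousLinearMapₗ T :
      (F [⋀^Fin 2]→L[ℝ] ℝ) →ₗ[ℝ] (F [⋀^Fin 2]→L[ℝ] ℝ)) - LinearMap.id) ↔ ∀ v w, Ω ![T v, T w] = Ω ![v, w] := by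
    intro T
    rw [LinearMap.mem_ker, LinearMap.sub_apply, LinearMap.id_apply, sub_eq_zero,
      ContinuousAlternatingMap.compContinuousLinearMapₗ_apply]
    constructor
    · intro h v w
      rw [← compContinuousLinearMap_apply₂, h]
    · intro h
      ext x
      have hx : x = ![x 0, x 1] := by funext i; fin_cases i <;> rfl
      rw [hx, compContinuousLinearMap_apply₂, h]
  rw [Submodule.mem_inf, key, key]

/-! ### §2 The four blocks of an invariant form in an adapted basis, and the inverse construction -/

section Count

/-- A `2`-covector vanishing on all pairs of vectors of a basis is zero. [folklore] -/
private theorem eq_zero_of_apply₂_basis {ι : Type*} (r : Basis ι ℝ F) (η : F [⋀^Fin 2]→L[ℝ] W)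
    (h : ∀ a b, η ![r a, r b] = 0) : η = 0 := by
  have hcoef : ∀ s : Fin 2 → ι, η (fun t ↦ r (s t)) = 0 := by
    intro s
    have : (fun t ↦ r (s t)) = ![r (s 0), r (s 1)] := by
      funext t; fin_cases t <;> rfl
    rw [this]
    exact h _ _
  have h0 : η.toContinuousMultilinearMap.toMultilinearMap =
      (0 : F [⋀^Fin 2]→L[ℝ] W).toContinuousMultilinearMap.toMultilinearMap :=
    Basis.ext_multilinear (fun _ ↦ r) fun s ↦ by simpa using hcoef s
  ext v
  have := congrArg (fun g : MultilinearMap ℝ (fun _ : Fin 2 ↦ F) W ↦ g v) h0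
  simpa using this

/-- Entries of `Matrix.toBilin` on the basis. [folklore] -/
private theorem toBilin_apply_basis {ι : Type*} [Fintype ι] [DecidableEq ι] (r : Basis ι ℝ F)
    (M : Matrix ι ι ℝ) (i j : ι) : Matrix.toBilin r M (r i) (r j) = M i j := by
  have h := congrFun (congrFun (LinearMap.BilinForm.toMatrix_toBilin r M) i) j
  rwa [LinearMap.BilinForm.toMatrix_apply] at h

/-- The evaluation map `Ω ↦ (Ω(x_a, y_b))_{ab}` is linear. [folklore] -/
private theorem exists_evalMap {m : ℕ} (x y : Fin m → F) :
    ∃ θ : (F [⋀^Fin 2]→L[ℝ] ℝ) →ₗ[ℝ] Matrix (Fin m) (Fin m) ℝ, ∀ Ω a b, θ Ω a b = Ω ![x a, y b] :=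
  ⟨{ toFun := fun Ω ↦ of fun a b ↦ Ω ![x a, y b],
     map_add' := fun Ω Ω' ↦ by ext a b; simp,
     map_smul' := fun c Ω ↦ by ext a b; simp }, fun _ _ _ ↦ rfl⟩

/-- Membership in `so(m) = skewAdjointMatricesSubmodule 1`: `Aᵀ = −A`. [folklore] -/
private theorem mem_skewAdjointMatricesSubmodule_one_iff' {m : ℕ} {A : Matrix (Fin m) (Fin m) ℝ} :
    A ∈ skewAdjointMatricesSubmodule (1 : Matrix (Fin m) (Fin m) ℝ) ↔ Aᵀ = -A := by
  rw [mem_skewAdjointMatricesSubmodule, Matrix.IsSkewAdjoint, Matrix.IsAdjointPair, Matrix.mul_one, Matrix.one_mul]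

/-- `dim so(m) = C(m, 2)` on the carrier `skewAdjointMatricesSubmodule 1` (the submodule underlying Mathlib's
`LieAlgebra.Orthogonal.so`; the count is the tree's `Literature.LinearAlgebra.Matrix.finrank_so`). [folklore] -/
private theorem finrank_skewAdjointMatricesSubmodule_one (m : ℕ) :
    finrank ℝ (skewAdjointMatricesSubmodule (1 : Matrix (Fin m) (Fin m) ℝ)) = m.choose 2 := by
  have h := Literature.LinearAlgebra.Matrix.finrank_so (K := ℝ) (m := Fin m)
  rw [Fintype.card_fin] at h
  exact h

variable [FiniteDimensional ℝ F]

/-- A bilinear form on a finite-dimensional space has a (continuous, alternating) antisymmetrisation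
`Ω(v, w) = ½ (B(v, w) − B(w, v))`. [folklore] -/
private theorem exists_twoCovector_of_bilin (B : LinearMap.BilinForm ℝ F) :
    ∃ Ω : F [⋀^Fin 2]→L[ℝ] ℝ, ∀ v w, Ω ![v, w] = 2⁻¹ * (B v w - B w v) := by
  let B₁ : F →ₗ[ℝ] (F →L[ℝ] ℝ) :=
    (LinearMap.toContinuousLinearMap : (F →ₗ[ℝ] ℝ) ≃ₗ[ℝ] (F →L[ℝ] ℝ)).toLinearMap ∘ₗ B
  let Bc : F →L[ℝ] F →L[ℝ] ℝ := LinearMap.toContinuousLinearMap B₁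
  have hBc : ∀ v w, Bc v w = B v w := fun v w ↦ rfl
  let Ω : F [⋀^Fin 2]→L[ℝ] ℝ := (2⁻¹ : ℝ) • ContinuousMultilinearMap.alternatization
    (ContinuousLinearMap.uncurryLeft
      (((continuousMultilinearCurryFin1 ℝ F ℝ).symm : (F →L[ℝ] ℝ) →L[ℝ] _).comp Bc))
  refine ⟨Ω, fun v w ↦ ?_⟩
  change (((2⁻¹ : ℝ) • ContinuousMultilinearMap.alternatization _ : F [⋀^Fin 2]→L[ℝ] ℝ))
    (show Fin 2 → F from ![v, w]) = _
  rw [ContinuousAlternatingMap.smul_apply, ContinuousMultilinearMap.alternatization_apply_apply]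
  have huniv : (Finset.univ : Finset (Equiv.Perm (Fin 2))) = {1, Equiv.swap 0 1} := by decide
  rw [huniv, Finset.sum_pair (by decide)]
  simp [Equiv.Perm.sign_swap', Units.smul_def, sub_eq_add_neg, hBc]

open Literature.LinearAlgebra.Matrix in
/-- **Buskin's count, the linear-algebra core (Thm. 1.2, `ℍ(−1)`, proof §3).** Let `L, J` be anticommuting complex
structures on a finite-dimensional real space `F` and `(e_a, L e_a, J e_a, LJ e_a)_{a < m}` an adapted block basis
(`ComplexStructure.exists_pairAdapted_basis`). On the space `S` of real `2`-covectors of type `(1,1)` for `L` and for `J`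
("`QI = IQ, QJ = JQ`") the four blocks `Ω ↦ ((Ω(e_a, e_b))_{ab}, (Ω(e_a, L e_b))_{ab}, (Ω(e_a, J e_b))_{ab},
(Ω(e_a, LJ e_b))_{ab})` form a LINEAR ISOMORPHISM onto `so(m) × Sym_m × Sym_m × Sym_m` — one antisymmetric and three
symmetric `m × m` blocks ("`A₁ᵗ = −A₁`", "`A₂, B₁, B₂` symmetric"), all other blocks of the Gram matrix in the adapted
basis being `±` these ("`D = A`", "`Bᵗ = B`", …). [cite: Buskin2018GeneralizedTwistorLines, Thm. 1.2 (chunk p0005 L24–29) with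
proof §3 "Case of a compact S" (chunk p0010 L43–L97, chunk p0011 L1–8)] -/
theorem exists_linearEquiv_blocks {L J : F →L[ℝ] F} (hL : ∀ v, L (L v) = -v) (hJ : ∀ v, J (J v) = -v)
    (hLJ : ∀ v, J (L v) = -L (J v)) {m : ℕ} {e : Fin m → F} (r : Basis ((Bool × Bool) × Fin m) ℝ F)
    (hr : ∀ s, r s = bif s.1.1 then L (bif s.1.2 then J (e s.2) else e s.2) else (bif s.1.2 then J (e s.2) else e s.2))
    (S : Submodule ℝ (F [⋀^Fin 2]→L[ℝ] ℝ))
    (hS : ∀ Ω, Ω ∈ S ↔ (∀ v w, Ω ![L v, L w] = Ω ![v, w]) ∧ ∀ v w, Ω ![J v, J w] = Ω ![v, w]) :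
    ∃ Φ : S ≃ₗ[ℝ] (skewAdjointMatricesSubmodule (1 : Matrix (Fin m) (Fin m) ℝ) × selfAdjointMatricesSubmodule (1 : Matrix (Fin m) (Fin m) ℝ) ×
        selfAdjointMatricesSubmodule (1 : Matrix (Fin m) (Fin m) ℝ) ×
          selfAdjointMatricesSubmodule (1 : Matrix (Fin m) (Fin m) ℝ)),
      ∀ Ω : S, ((Φ Ω).1 : Matrix (Fin m) (Fin m) ℝ) = of (fun a b ↦ (Ω : F [⋀^Fin 2]→L[ℝ] ℝ) ![e a, e b]) ∧
        ((Φ Ω).2.1 : Matrix (Fin m) (Fin m) ℝ) = of (fun a b ↦ (Ω : F [⋀^Fin 2]→L[ℝ] ℝ) ![e a, L (e b)]) ∧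
        ((Φ Ω).2.2.1 : Matrix (Fin m) (Fin m) ℝ) = of (fun a b ↦ (Ω : F [⋀^Fin 2]→L[ℝ] ℝ) ![e a, J (e b)]) ∧
        ((Φ Ω).2.2.2 : Matrix (Fin m) (Fin m) ℝ) = of (fun a b ↦ (Ω : F [⋀^Fin 2]→L[ℝ] ℝ) ![e a, L (J (e b))]) := by
  classical
  -- the basis vectors, spelled out
  have r00 : ∀ a, r ((false, false), a) = e a := fun a ↦ by simp [hr]
  have r10 : ∀ a, r ((true, false), a) = L (e a) := fun a ↦ by simp [hr]
  have r01 : ∀ a, r ((false, true), a) = J (e a) := fun a ↦ by simp [hr]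
  have r11 : ∀ a, r ((true, true), a) = L (J (e a)) := fun a ↦ by simp [hr]
  -- the four evaluation maps `Ω ↦ (Ω(e_a, T e_b))_{ab}`, `T = 1, L, J, LJ`
  obtain ⟨θ0, hθ0⟩ := exists_evalMap (F := F) e e
  obtain ⟨θL, hθL⟩ := exists_evalMap (F := F) e (fun b ↦ L (e b))
  obtain ⟨θJ, hθJ⟩ := exists_evalMap (F := F) e (fun b ↦ J (e b))
  obtain ⟨θK, hθK⟩ := exists_evalMap (F := F) e (fun b ↦ L (J (e b)))
  -- memberships of the four blocks: one antisymmetric, three symmetric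
  have mem0 : ∀ Ω : S, θ0 (Ω : F [⋀^Fin 2]→L[ℝ] ℝ) ∈ skewAdjointMatricesSubmodule (1 : Matrix (Fin m) (Fin m) ℝ) := by
    intro Ω
    rw [mem_skewAdjointMatricesSubmodule_one_iff']
    ext a b
    rw [transpose_apply, neg_apply, hθ0, hθ0]
    exact apply₂_swap _ _ _
  have memL : ∀ Ω : S, θL (Ω : F [⋀^Fin 2]→L[ℝ] ℝ) ∈ selfAdjointMatricesSubmodule (1 : Matrix (Fin m) (Fin m) ℝ) := by
    intro Ω
    rw [mem_selfAdjointMatricesSubmodule_one_iff]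
    ext a b
    rw [transpose_apply, hθL, hθL]
    exact apply₂_map_right_comm hL _ ((hS _).1 Ω.2).1 (e b) (e a)
  have memJ : ∀ Ω : S, θJ (Ω : F [⋀^Fin 2]→L[ℝ] ℝ) ∈ selfAdjointMatricesSubmodule (1 : Matrix (Fin m) (Fin m) ℝ) := by
    intro Ω
    rw [mem_selfAdjointMatricesSubmodule_one_iff]
    ext a b
    rw [transpose_apply, hθJ, hθJ]
    exact apply₂_map_right_comm hJ _ ((hS _).1 Ω.2).2 (e b) (e a)
  have memK : ∀ Ω : S, θK (Ω : F [⋀^Fin 2]→L[ℝ] ℝ) ∈ selfAdjointMatricesSubmodule (1 : Matrix (Fin m) (Fin m) ℝ) := by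
    intro Ω
    rw [mem_selfAdjointMatricesSubmodule_one_iff]
    ext a b
    rw [transpose_apply, hθK, hθK]
    exact apply₂_map_map_right_comm hL hJ hLJ _ ((hS _).1 Ω.2).1 ((hS _).1 Ω.2).2 (e b) (e a)
  -- the forward map
  obtain ⟨Θ, hΘ⟩ : ∃ Θ : S →ₗ[ℝ] (skewAdjointMatricesSubmodule (1 : Matrix (Fin m) (Fin m) ℝ) ×
      selfAdjointMatricesSubmodule (1 : Matrix (Fin m) (Fin m) ℝ) × selfAdjointMatricesSubmodule (1 : Matrix (Fin m) (Fin m) ℝ) ×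
        selfAdjointMatricesSubmodule (1 : Matrix (Fin m) (Fin m) ℝ)),
      ∀ Ω : S, ((Θ Ω).1 : Matrix (Fin m) (Fin m) ℝ) = θ0 (Ω : F [⋀^Fin 2]→L[ℝ] ℝ) ∧
        ((Θ Ω).2.1 : Matrix (Fin m) (Fin m) ℝ) = θL (Ω : F [⋀^Fin 2]→L[ℝ] ℝ) ∧
        ((Θ Ω).2.2.1 : Matrix (Fin m) (Fin m) ℝ) = θJ (Ω : F [⋀^Fin 2]→L[ℝ] ℝ) ∧
        ((Θ Ω).2.2.2 : Matrix (Fin m) (Fin m) ℝ) = θK (Ω : F [⋀^Fin 2]→L[ℝ] ℝ) :=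
    ⟨LinearMap.prod (LinearMap.codRestrict _ (θ0.comp S.subtype) mem0)
      (LinearMap.prod (LinearMap.codRestrict _ (θL.comp S.subtype) memL)
        (LinearMap.prod (LinearMap.codRestrict _ (θJ.comp S.subtype) memJ)
          (LinearMap.codRestrict _ (θK.comp S.subtype) memK))), fun Ω ↦ ⟨rfl, rfl, rfl, rfl⟩⟩
  -- injectivity: the sixteen blocks of the Gram matrix are `±` the four blocks
  have hker : ∀ Ω : S, Θ Ω = 0 → Ω = 0 := by
    intro Ω hΩ
    obtain ⟨hΩL, hΩJ⟩ := (hS Ω).1 Ω.2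
    obtain ⟨q0, qL, qJ, qK⟩ := hΘ Ω
    rw [hΩ] at q0 qL qJ qK
    have h0 : ∀ a b, (Ω : F [⋀^Fin 2]→L[ℝ] ℝ) ![e a, e b] = 0 := fun a b ↦ by
      rw [← hθ0, ← q0]; rfl
    have h1 : ∀ a b, (Ω : F [⋀^Fin 2]→L[ℝ] ℝ) ![e a, L (e b)] = 0 := fun a b ↦ by
      rw [← hθL (Ω : F [⋀^Fin 2]→L[ℝ] ℝ) a b, ← qL]; rfl
    have h2 : ∀ a b, (Ω : F [⋀^Fin 2]→L[ℝ] ℝ) ![e a, J (e b)] = 0 := fun a b ↦ by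
      rw [← hθJ (Ω : F [⋀^Fin 2]→L[ℝ] ℝ) a b, ← qJ]; rfl
    have h3 : ∀ a b, (Ω : F [⋀^Fin 2]→L[ℝ] ℝ) ![e a, L (J (e b))] = 0 := fun a b ↦ by
      rw [← hθK (Ω : F [⋀^Fin 2]→L[ℝ] ℝ) a b, ← qK]; rfl
    have mvL : ∀ x y, (Ω : F [⋀^Fin 2]→L[ℝ] ℝ) ![L x, y] = -(Ω : F [⋀^Fin 2]→L[ℝ] ℝ) ![x, L y] :=
      apply₂_map_left hL _ hΩL
    have mvJ : ∀ x y, (Ω : F [⋀^Fin 2]→L[ℝ] ℝ) ![J x, y] = -(Ω : F [⋀^Fin 2]→L[ℝ] ℝ) ![x, J y] :=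
      apply₂_map_left hJ _ hΩJ
    apply Subtype.ext
    refine eq_zero_of_apply₂_basis r _ fun s t ↦ ?_
    obtain ⟨⟨s₁, s₂⟩, a⟩ := s
    obtain ⟨⟨t₁, t₂⟩, b⟩ := t
    cases s₁ <;> cases s₂ <;> cases t₁ <;> cases t₂ <;>
      simp [hr, mvL, mvJ, hL, hJ, hLJ, map_neg, apply₂_neg_right, h0, h1, h2, h3]
  have hinj : Function.Injective Θ := by
    intro Ω Ω' h
    have h0 : Θ (Ω - Ω') = 0 := by rw [map_sub Θ Ω Ω', h, sub_self]
    exact sub_eq_zero.mp (hker _ h0)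
  -- surjectivity: Buskin's block matrix
  have hsurj : Function.Surjective Θ := by
    rintro ⟨⟨A0, hA0⟩, ⟨AL, hAL⟩, ⟨AJ, hAJ⟩, ⟨AK, hAK⟩⟩
    have hA0' := hA0
    have hAL' := hAL
    have hAJ' := hAJ
    have hAK' := hAK
    rw [mem_skewAdjointMatricesSubmodule_one_iff'] at hA0'
    rw [mem_selfAdjointMatricesSubmodule_one_iff] at hAL' hAJ' hAK'
    have eA0 : ∀ a b, A0 b a = -A0 a b := fun a b ↦ by
      have := congrFun (congrFun hA0' a) b; simpa using this
    have eAL : ∀ a b, AL b a = AL a b := fun a b ↦ by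
      have := congrFun (congrFun hAL' a) b; simpa using this
    have eAJ : ∀ a b, AJ b a = AJ a b := fun a b ↦ by
      have := congrFun (congrFun hAJ' a) b; simpa using this
    have eAK : ∀ a b, AK b a = AK a b := fun a b ↦ by
      have := congrFun (congrFun hAK' a) b; simpa using this
    -- the Gram matrix: entry `((β, a), (γ, b)) = ε(β, γ) · P_{β⁻¹γ}(a, b)` with `ε(β, γ) q_{β⁻¹γ} = q̄_β q_γ`,
    -- `q_{(b₁, b₂)} = L^{b₁} J^{b₂}`, `P_1 = A0`, `P_L = AL`, `P_J = AJ`, `P_{LJ} = AK`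
    obtain ⟨M, hM⟩ : ∃ M : Matrix ((Bool × Bool) × Fin m) ((Bool × Bool) × Fin m) ℝ, ∀ s t, M s t =
        (bif s.1.1 then (bif s.1.2 then (bif t.1.2 then 1 else -1) else (bif t.1.1 then 1 else -1))
          else (bif s.1.2 then (bif t.1.1 then (bif t.1.2 then -1 else 1) else (bif t.1.2 then 1 else -1)) else 1)) *
        (bif (bif s.1.1 then !t.1.1 else t.1.1) then
            (bif (bif s.1.2 then !t.1.2 else t.1.2) then AK else AL)
          else (bif (bif s.1.2 then !t.1.2 else t.1.2) then AJ else A0)) s.2 t.2 :=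
      ⟨of fun s t ↦ _, fun s t ↦ rfl⟩
    -- `M` is antisymmetric
    have hMskew : ∀ s t, M t s = -M s t := by
      rintro ⟨⟨s₁, s₂⟩, a⟩ ⟨⟨t₁, t₂⟩, b⟩
      cases s₁ <;> cases s₂ <;> cases t₁ <;> cases t₂ <;>
        simp [hM, eA0 a b, eAL a b, eAJ a b, eAK a b]
    -- the bilinear form with Gram matrix `M` and its antisymmetrisation
    set B := Matrix.toBilin r M with hB_def
    have hB : ∀ s t, B (r s) (r t) = M s t := toBilin_apply_basis r M
    have hBskew : ∀ v w, B w v = -B v w := by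
      intro v w
      have h : B.flip = -B := LinearMap.BilinForm.ext_basis r fun i j ↦ by
        rw [LinearMap.BilinForm.flip_apply, hB, hMskew, LinearMap.neg_apply, LinearMap.neg_apply, hB]
      have := LinearMap.congr_fun₂ h v w
      simpa using this
    obtain ⟨Ω, hΩ⟩ := exists_twoCovector_of_bilin B
    have hΩB : ∀ v w, Ω ![v, w] = B v w := fun v w ↦ by rw [hΩ, hBskew v w]; ring
    have hΩr : ∀ s t, Ω ![r s, r t] = M s t := fun s t ↦ by rw [hΩB, hB]
    -- how `L` and `J` permute the adapted basis (up to sign)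
    have hLr : ∀ s : (Bool × Bool) × Fin m,
        L (r s) = bif s.1.1 then -r ((false, s.1.2), s.2) else r ((true, s.1.2), s.2) := by
      rintro ⟨⟨s₁, s₂⟩, a⟩
      cases s₁ <;> cases s₂ <;> simp [hr, hL]
    have hJr : ∀ s : (Bool × Bool) × Fin m,
        J (r s) = bif s.1.2 then (bif s.1.1 then r ((true, false), s.2) else -r ((false, false), s.2))
          else (bif s.1.1 then -r ((true, true), s.2) else r ((false, true), s.2)) := by
      rintro ⟨⟨s₁, s₂⟩, a⟩
      cases s₁ <;> cases s₂ <;> simp [hr, hJ, hLJ]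
    -- invariance under `L` and `J`, checked on the basis
    have hΩL : ∀ v w, Ω ![L v, L w] = Ω ![v, w] := by
      have h : B.comp (L : F →ₗ[ℝ] F) (L : F →ₗ[ℝ] F) = B := LinearMap.BilinForm.ext_basis r fun s t ↦ by
        rw [LinearMap.BilinForm.comp_apply]
        obtain ⟨⟨s₁, s₂⟩, a⟩ := s
        obtain ⟨⟨t₁, t₂⟩, b⟩ := t
        simp only [ContinuousLinearMap.coe_coe, hLr, hB]
        cases s₁ <;> cases s₂ <;> cases t₁ <;> cases t₂ <;> simp [hB, hM]
      intro v w
      have := LinearMap.congr_fun₂ h v w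
      rw [LinearMap.BilinForm.comp_apply] at this
      rw [hΩB, hΩB]
      exact this
    have hΩJ : ∀ v w, Ω ![J v, J w] = Ω ![v, w] := by
      have h : B.comp (J : F →ₗ[ℝ] F) (J : F →ₗ[ℝ] F) = B := LinearMap.BilinForm.ext_basis r fun s t ↦ by
        rw [LinearMap.BilinForm.comp_apply]
        obtain ⟨⟨s₁, s₂⟩, a⟩ := s
        obtain ⟨⟨t₁, t₂⟩, b⟩ := t
        simp only [ContinuousLinearMap.coe_coe, hJr, hB]
        cases s₁ <;> cases s₂ <;> cases t₁ <;> cases t₂ <;> simp [hB, hM]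
      intro v w
      have := LinearMap.congr_fun₂ h v w
      rw [LinearMap.BilinForm.comp_apply] at this
      rw [hΩB, hΩB]
      exact this
    have hΩS : Ω ∈ S := (hS Ω).2 ⟨hΩL, hΩJ⟩
    refine ⟨⟨Ω, hΩS⟩, ?_⟩
    obtain ⟨q0, qL, qJ, qK⟩ := hΘ ⟨Ω, hΩS⟩
    ext a b
    · rw [q0, hθ0, ← r00, ← r00, hΩr, hM]
      simp
    · rw [qL, hθL, ← r00, ← r10, hΩr, hM]
      simp
    · rw [qJ, hθJ, ← r00, ← r01, hΩr, hM]
      simp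
    · rw [qK, hθK, ← r00, ← r11, hΩr, hM]
      simp
  refine ⟨LinearEquiv.ofBijective Θ ⟨hinj, hsurj⟩, fun Ω ↦ ?_⟩
  simp only [LinearEquiv.ofBijective_apply]
  obtain ⟨q0, qL, qJ, qK⟩ := hΘ Ω
  refine ⟨?_, ?_, ?_, ?_⟩
  · rw [q0]; ext a b; rw [hθ0, of_apply]
  · rw [qL]; ext a b; rw [hθL, of_apply]
  · rw [qJ]; ext a b; rw [hθJ, of_apply]
  · rw [qK]; ext a b; rw [hθK, of_apply]

/-! ### §3 The dimension count `dim Hdg_S = n(n−1)/2 + 3·n(n+1)/2 = 2n² + n` -/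

/-- `C(m, 2) + 3·C(m+1, 2) = 2m² + m` ("`n(n−1)/2 + 3·n(n+1)/2 = 2n² + n`").
[cite: Buskin2018GeneralizedTwistorLines, §3 (chunk p0011 L1–4)] -/
theorem choose_two_add_three_mul_choose_two (m : ℕ) : m.choose 2 + 3 * (m + 1).choose 2 = 2 * m ^ 2 + m := by
  induction m with
  | zero => simp
  | succ k ih =>
    rw [Nat.choose_succ_succ' (k + 1) 1, Nat.choose_one_right, Nat.choose_succ_succ' k 1, Nat.choose_one_right] at *
    nlinarith [ih]

open scoped Quaternion in
/-- **"All representations `ℍ(−1) = ℍ → End V_ℝ` are equivalent and are direct sums of the unique irreducible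
4-representations of `ℍ`"** — the adapted block basis, obtained as printed: through `i ↦ L`, `j ↦ J`, `k ↦ LJ`
(a `QuaternionAlgebra.Basis (F →L[ℝ] F) (−1) 0 (−1)`, lifted by Mathlib's `QuaternionAlgebra.Basis.liftHom`) the real
space `V_ℝ` is a module over the skew field `ℍ`, hence FREE; an `ℍ`-basis `(e_a)_{a<m}` multiplied by the real basis
`1, i, j, k` of `ℍ` (`Basis.smulTower`) is the block basis `(e_a, Le_a, Je_a, LJe_a)_{a<m}` of `V_ℝ`, and `dim_ℝ V_ℝ = 4m`.
(Independent of the tree's `ComplexStructure.exists_pairAdapted_basis`, `ComplexStructureAdaptedBasis.lean`, which grows a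
maximal independent block family; the statement here also records `dim_ℝ V_ℝ = 4m`.)
[cite: Buskin2018GeneralizedTwistorLines, §3 "Case of a compact S" (chunk p0010 L43–44)] -/
theorem exists_pairAdapted_basis_finrank {L J : F →L[ℝ] F} (hL : ∀ v, L (L v) = -v) (hJ : ∀ v, J (J v) = -v)
    (hLJ : ∀ v, J (L v) = -L (J v)) :
    ∃ (m : ℕ) (e : Fin m → F) (r : Basis ((Bool × Bool) × Fin m) ℝ F), finrank ℝ F = 4 * m ∧
      ∀ s, r s = bif s.1.1 then L (bif s.1.2 then J (e s.2) else e s.2) else (bif s.1.2 then J (e s.2) else e s.2) := by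
  classical
  -- `V_ℝ` as a left `ℍ`-module: `i ↦ L`, `j ↦ J`, `k ↦ LJ`
  let qb : QuaternionAlgebra.Basis (F →L[ℝ] F) (-1 : ℝ) 0 (-1) :=
    { i := L, j := J, k := L * J,
      i_mul_i := by ext v; simp [hL],
      j_mul_j := by ext v; simp [hJ],
      i_mul_j := rfl,
      j_mul_i := by ext v; simp [hLJ] }
  letI : Module ℍ[ℝ] F := Module.compHom F (qb.liftHom : ℍ[ℝ] →ₐ[ℝ] (F →L[ℝ] F)).toRingHom
  have hsmul : ∀ (q : ℍ[ℝ]) (v : F), q • v = q.re • v + q.imI • L v + q.imJ • J v + q.imK • L (J v) := fun q v ↦ by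
    show qb.liftHom q v = _
    simp [QuaternionAlgebra.Basis.liftHom_apply, QuaternionAlgebra.Basis.lift, qb, Algebra.algebraMap_eq_smul_one]
  haveI : IsScalarTower ℝ ℍ[ℝ] F := by
    refine ⟨fun t q v ↦ ?_⟩
    rw [Algebra.smul_def, mul_smul]
    show qb.liftHom (algebraMap ℝ _ t) (q • v) = t • (q • v)
    rw [AlgHom.commutes]
    rfl
  haveI : Module.Finite ℍ[ℝ] F := Module.Finite.of_restrictScalars_finite ℝ ℍ[ℝ] F
  -- "direct sums of the unique irreducible 4-representation": an `ℍ`-basis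
  let c : Basis (Fin (finrank ℍ[ℝ] F)) ℍ[ℝ] F := Module.finBasis ℍ[ℝ] F
  -- the real basis `1, i, j, k` of `ℍ`, indexed by `Bool × Bool`: `(b₁, b₂) ↦ i^{b₁} j^{b₂}` (`k = ij`)
  let cmp : ℍ[ℝ] → Bool × Bool → ℝ := fun q b ↦
    bif b.1 then (bif b.2 then q.imK else q.imI) else (bif b.2 then q.imJ else q.re)
  let eH : ℍ[ℝ] ≃ₗ[ℝ] (Bool × Bool → ℝ) :=
    { toFun := cmp
      map_add' := fun q q' ↦ by
        funext b; obtain ⟨b₁, b₂⟩ := b; cases b₁ <;> cases b₂ <;> simp [cmp]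
      map_smul' := fun t q ↦ by
        funext b; obtain ⟨b₁, b₂⟩ := b; cases b₁ <;> cases b₂ <;> simp [cmp]
      invFun := fun f ↦ ⟨f (false, false), f (true, false), f (false, true), f (true, true)⟩
      left_inv := fun q ↦ by ext <;> simp [cmp]
      right_inv := fun f ↦ by
        funext b; obtain ⟨b₁, b₂⟩ := b; cases b₁ <;> cases b₂ <;> simp [cmp] }
  let bH : Basis (Bool × Bool) ℝ ℍ[ℝ] := Module.Basis.ofEquivFun eH
  have hbH : ∀ b, bH b = eH.symm (Pi.single b 1) := fun b ↦ by
    simp only [bH, Module.Basis.coe_ofEquivFun]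
  have hre : ∀ f, (eH.symm f).re = f (false, false) := fun f ↦ rfl
  have himI : ∀ f, (eH.symm f).imI = f (true, false) := fun f ↦ rfl
  have himJ : ∀ f, (eH.symm f).imJ = f (false, true) := fun f ↦ rfl
  have himK : ∀ f, (eH.symm f).imK = f (true, true) := fun f ↦ rfl
  refine ⟨finrank ℍ[ℝ] F, fun a ↦ c a, bH.smulTower c, ?_, fun s ↦ ?_⟩
  · have h := Module.finrank_mul_finrank ℝ ℍ[ℝ] F
    rw [Quaternion.finrank_eq_four] at h
    omega
  · rw [Module.Basis.smulTower_apply, hbH, hsmul, hre, himI, himJ, himK]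
    obtain ⟨⟨b₁, b₂⟩, a⟩ := s
    cases b₁ <;> cases b₂ <;> simp

open Literature.LinearAlgebra.Matrix in
/-- **Theorem 1.2 (`ℍ(−1)`), the count in an adapted basis.** With `L, J, e, r` as in `exists_linearEquiv_blocks`
(`4m = dim_ℝ F`), the space of real `2`-covectors of type `(1,1)` for `L` and `J` has dimension
`C(m,2) + 3·C(m+1,2)` = "the sum of the dimensions of spaces of skew-symmetric `n×n`-matrices `A₁`, of symmetric
`n×n`-matrices `A₂, B₁, B₂`". [cite: Buskin2018GeneralizedTwistorLines, Thm. 1.2 (chunk p0005 L24–29), proof §3 (chunk p0011 L1–8)] -/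
theorem finrank_eq_choose_of_pairAdapted_basis {L J : F →L[ℝ] F} (hL : ∀ v, L (L v) = -v) (hJ : ∀ v, J (J v) = -v)
    (hLJ : ∀ v, J (L v) = -L (J v)) {m : ℕ} {e : Fin m → F} (r : Basis ((Bool × Bool) × Fin m) ℝ F)
    (hr : ∀ s, r s = bif s.1.1 then L (bif s.1.2 then J (e s.2) else e s.2) else (bif s.1.2 then J (e s.2) else e s.2))
    (S : Submodule ℝ (F [⋀^Fin 2]→L[ℝ] ℝ))
    (hS : ∀ Ω, Ω ∈ S ↔ (∀ v w, Ω ![L v, L w] = Ω ![v, w]) ∧ ∀ v w, Ω ![J v, J w] = Ω ![v, w]) :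
    finrank ℝ S = m.choose 2 + 3 * (m + 1).choose 2 := by
  classical
  obtain ⟨Φ, -⟩ := exists_linearEquiv_blocks hL hJ hLJ r hr S hS
  rw [LinearEquiv.finrank_eq Φ, Module.finrank_prod, Module.finrank_prod, Module.finrank_prod,
    finrank_skewAdjointMatricesSubmodule_one, finrank_selfAdjointMatricesSubmodule_one, Fintype.card_fin]
  ring

/-- **Theorem 1.2 (`ℍ(−1)`): `dim Hdg_S = 2n² + n`.** For any anticommuting pair of complex structures `L, J` on a real
vector space `V_ℝ` of dimension `4n` (equivalently: any twistor line `S = S(L, J)` of type `ℍ(−1)` in the period domain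
of complex tori of dimension `2n`), the space `Hdg_S` of real alternating `2`-forms of type `(1,1)` for `L` and `J` — i.e.
for every `λ ∈ S` (`forall_sphere_apply₂_eq_iff`) — has dimension `2n² + n`. ("For any twistor line `S` of the type
`ℍ(−1)` we have `dim Hdg_S = 2n² + n`".) The companion clause "and `Hdg_S` does not contain any Kähler classes" is
`not_forall_apply₂_map_pos`; "all representations `ℍ(−1) → End V_ℝ` are equivalent" is the tree's
`ComplexStructure.exists_conj_of_pair`. [cite: Buskin2018GeneralizedTwistorLines, Thm. 1.2 (chunk p0005 L24–29)] -/
theorem finrank_eq_of_forall_mem_iff {n : ℕ} (hF : finrank ℝ F = 4 * n) {L J : F →L[ℝ] F} (hL : ∀ v, L (L v) = -v)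
    (hJ : ∀ v, J (J v) = -v) (hLJ : ∀ v, J (L v) = -L (J v)) (S : Submodule ℝ (F [⋀^Fin 2]→L[ℝ] ℝ))
    (hS : ∀ Ω, Ω ∈ S ↔ (∀ v w, Ω ![L v, L w] = Ω ![v, w]) ∧ ∀ v w, Ω ![J v, J w] = Ω ![v, w]) :
    finrank ℝ S = 2 * n ^ 2 + n := by
  obtain ⟨m, e, r, hm, hr⟩ := exists_pairAdapted_basis_finrank hL hJ hLJ
  have hmn : m = n := by omega
  rw [finrank_eq_choose_of_pairAdapted_basis hL hJ hLJ r hr S hS, choose_two_add_three_mul_choose_two, hmn]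

/-- **Theorem 1.2 (`ℍ(−1)`) with `Hdg_S` as printed**: `Hdg_S = {Ω ∈ Hom(∧²V_ℝ, ℝ) | λᵗΩλ = Ω, λ ∈ S}` for the sphere
`S = {aL + bJ + cLJ | a² + b² + c² = 1}` has dimension `2n² + n` (`dim_ℝ V_ℝ = 4n`).
[cite: Buskin2018GeneralizedTwistorLines, Thm. 1.2 (chunk p0005 L24–29) with the definition of `Hdg_S` (chunk p0005 L1–4)] -/
theorem finrank_eq_of_forall_mem_iff_sphere {n : ℕ} (hF : finrank ℝ F = 4 * n) {L J : F →L[ℝ] F}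
    (hL : ∀ v, L (L v) = -v) (hJ : ∀ v, J (J v) = -v) (hLJ : ∀ v, J (L v) = -L (J v))
    (S : Submodule ℝ (F [⋀^Fin 2]→L[ℝ] ℝ))
    (hS : ∀ Ω, Ω ∈ S ↔ ∀ a b c : ℝ, a ^ 2 + b ^ 2 + c ^ 2 = 1 →
      ∀ v w, Ω ![(a • L + b • J + c • L.comp J) v, (a • L + b • J + c • L.comp J) w] = Ω ![v, w]) :
    finrank ℝ S = 2 * n ^ 2 + n :=
  finrank_eq_of_forall_mem_iff hF hL hJ hLJ S fun Ω ↦ (hS Ω).trans (forall_sphere_apply₂_eq_iff hL hJ hLJ Ω)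

/-- **Theorem 1.2 (`ℍ(−1)`) on the concrete carrier**: `dim_ℝ (ker(L^* − 1) ⊓ ker(J^* − 1)) = 2n² + n` for any
anticommuting pair of complex structures `L, J` on a `4n`-dimensional real space.
[cite: Buskin2018GeneralizedTwistorLines, Thm. 1.2 (chunk p0005 L24–29)] -/
theorem finrank_ker_inf_ker {n : ℕ} (hF : finrank ℝ F = 4 * n) {L J : F →L[ℝ] F} (hL : ∀ v, L (L v) = -v)
    (hJ : ∀ v, J (J v) = -v) (hLJ : ∀ v, J (L v) = -L (J v)) :
    finrank ℝ ↥(LinearMap.ker ((ContinuousAlternatingMap.compContinuousLinearMapₗ L :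
          (F [⋀^Fin 2]→L[ℝ] ℝ) →ₗ[ℝ] (F [⋀^Fin 2]→L[ℝ] ℝ)) - LinearMap.id) ⊓
        LinearMap.ker ((ContinuousAlternatingMap.compContinuousLinearMapₗ J :
          (F [⋀^Fin 2]→L[ℝ] ℝ) →ₗ[ℝ] (F [⋀^Fin 2]→L[ℝ] ℝ)) - LinearMap.id)) = 2 * n ^ 2 + n :=
  finrank_eq_of_forall_mem_iff hF hL hJ hLJ _ (mem_ker_inf_ker_iff L J)

end Count

/-! ### §4 The non-compact lines of type `ℍ(1)`: `dim Hdg_S = 2n² + n` again, and Kähler classes DO survive -/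

section SplitLine

/-- For an involution `R` (`R² = 1`) and a `2`-covector with `Ω(Rx, Ry) = −Ω(x, y)` ("anti-invariant"), `R` moves across
the form with a sign: `Ω(Rx, y) = −Ω(x, Ry)`. [cite: Buskin2018GeneralizedTwistorLines, §1.1 (chunk p0004 L32–35: "`I² = −Id,
R² = Id, IR + RI = 0`") and §3 "Case of S = S(I,R)" (chunk p0011 L114–127)] -/
theorem apply₂_map_left_of_anti {R : F →L[ℝ] F} (hR : ∀ v, R (R v) = v) (Ω : F [⋀^Fin 2]→L[ℝ] W)
    (hΩ : ∀ v w, Ω ![R v, R w] = -Ω ![v, w]) (x y : F) : Ω ![R x, y] = -Ω ![x, R y] := by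
  have h := hΩ x (R y)
  rw [hR] at h
  exact h

/-- **Scaling along a line of type `ℍ(1)`.** For `I² = −1`, `R² = 1`, `RI = −IR` and `Ω` of type `(1,1)` for `I` and
ANTI-invariant under `R`, every `λ = xI + yR + zIR` scales `Ω` by the split-quaternion norm:
`Ω(λv, λw) = (x² − y² − z²)·Ω(v, w)`. [cite: Buskin2018GeneralizedTwistorLines, §1.1 (chunk p0004 L43–49:
"`(xI+yR+zIR)² = (−x²+y²+z²)Id = −Id`, that is, `x² − y² − z² = 1` … `S(I,R) = {xI+yR+zIR | x²−y²−z² = 1}` … is a generalized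
twistor line of the type `ℍ(1)`")] -/
theorem apply₂_splitTwistor_eq_smul {I R : F →L[ℝ] F} (hI : ∀ v, I (I v) = -v) (hR : ∀ v, R (R v) = v)
    (hIR : ∀ v, R (I v) = -I (R v)) (Ω : F [⋀^Fin 2]→L[ℝ] W) (hΩI : ∀ v w, Ω ![I v, I w] = Ω ![v, w])
    (hΩR : ∀ v w, Ω ![R v, R w] = -Ω ![v, w]) (x y z : ℝ) (v w : F) :
    Ω ![(x • I + y • R + z • I.comp R) v, (x • I + y • R + z • I.comp R) w] = (x ^ 2 - y ^ 2 - z ^ 2) • Ω ![v, w] := by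
  have mvI := apply₂_map_left hI Ω hΩI
  have mvR := apply₂_map_left_of_anti hR Ω hΩR
  simp only [_root_.add_apply, _root_.smul_apply, ContinuousLinearMap.coe_comp, Function.comp_apply, apply₂_add_left,
    apply₂_add_right, apply₂_smul_left, apply₂_smul_right, mvI, mvR, hI, hR, hIR, map_neg, apply₂_neg_right, smul_neg,
    neg_neg, smul_smul, smul_add]
  module

/-- **`Hdg_S` for a line of type `ℍ(1)`.** A `2`-covector is of type `(1,1)` for every `λ` in the two-sheeted hyperboloid
`S(I, R) = {xI + yR + zIR | x² − y² − z² = 1}` iff it is of type `(1,1)` for `I` and anti-invariant under `R`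
(`Ω(Rv, Rw) = −Ω(v, w)`). [cite: Buskin2018GeneralizedTwistorLines, Thm. 1.2 (chunk p0005 L31) with §1.2 (p0005 L1–4) and
§3 "Case of S = S(I,R)" (chunks p0011–p0012)] -/
theorem forall_hyperboloid_apply₂_eq_iff {I R : F →L[ℝ] F} (hI : ∀ v, I (I v) = -v) (hR : ∀ v, R (R v) = v)
    (hIR : ∀ v, R (I v) = -I (R v)) (Ω : F [⋀^Fin 2]→L[ℝ] W) :
    (∀ x y z : ℝ, x ^ 2 - y ^ 2 - z ^ 2 = 1 →
        ∀ v w, Ω ![(x • I + y • R + z • I.comp R) v, (x • I + y • R + z • I.comp R) w] = Ω ![v, w]) ↔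
      (∀ v w, Ω ![I v, I w] = Ω ![v, w]) ∧ ∀ v w, Ω ![R v, R w] = -Ω ![v, w] := by
  constructor
  · intro h
    have hΩI : ∀ v w, Ω ![I v, I w] = Ω ![v, w] := fun v w ↦ by simpa using h 1 0 0 (by norm_num) v w
    refine ⟨hΩI, fun v w ↦ ?_⟩
    -- the two rational points `(5/4)·I ± (3/4)·R` of the hyperboloid
    have h₁ := h (5 / 4) (3 / 4) 0 (by norm_num) v w
    have h₂ := h (5 / 4) (-3 / 4) 0 (by norm_num) v w
    simp only [_root_.add_apply, _root_.smul_apply, zero_smul, add_zero, apply₂_add_left, apply₂_add_right,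
      apply₂_smul_left, apply₂_smul_right, smul_add, smul_smul, hΩI] at h₁ h₂
    linear_combination (norm := module) (8 / 9 : ℝ) • h₁ + (8 / 9 : ℝ) • h₂
  · rintro ⟨hΩI, hΩR⟩ x y z hxyz v w
    rw [apply₂_splitTwistor_eq_smul hI hR hIR Ω hΩI hΩR, hxyz, one_smul]

end SplitLine

section SplitCount

/-- **An adapted basis for a line of type `ℍ(1)`.** For `I² = −1`, `R² = 1`, `RI = −IR` on a finite-dimensional real
space: "`I` establishes an isomorphism between the eigenspaces `Ker(R − Id)` and `Ker(R + Id)` … Let `v₁, …, v_{2n}` be a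
basis of `Ker(R − Id)`, then `Iv₁, …, Iv_{2n}` is a basis of `Ker(R + Id)`" — so `(v_i, Iv_i)_i` is a basis of `V_ℝ`.
[cite: Buskin2018GeneralizedTwistorLines, §3 "Case of S = S(I,R)" (chunk p0011 L120–127)] -/
theorem exists_splitAdapted_basis [FiniteDimensional ℝ F] (I R : F →L[ℝ] F) (hI : ∀ v, I (I v) = -v)
    (hR : ∀ v, R (R v) = v) (hIR : ∀ v, R (I v) = -I (R v)) :
    ∃ (k : ℕ) (e : Fin k → F) (r : Basis (Bool × Fin k) ℝ F),
      (∀ i, R (e i) = e i) ∧ ∀ s, r s = bif s.1 then I (e s.2) else e s.2 := by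
  classical
  -- the `+1`-eigenspace of `R` and a basis of it
  let E : Submodule ℝ F := LinearMap.ker ((R : F →ₗ[ℝ] F) - LinearMap.id)
  have hE : ∀ v, v ∈ E ↔ R v = v := fun v ↦ by
    simp only [E, LinearMap.mem_ker, LinearMap.sub_apply, ContinuousLinearMap.coe_coe, LinearMap.id_apply, sub_eq_zero]
  let k := finrank ℝ E
  let b : Basis (Fin k) ℝ E := Module.finBasis ℝ E
  let e : Fin k → F := fun i ↦ (b i : F)
  have he : ∀ i, R (e i) = e i := fun i ↦ (hE _).1 (b i).2
  have hli_e : LinearIndependent ℝ e := b.linearIndependent.map' E.subtype (Submodule.ker_subtype E)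
  -- elements of `E` are combinations of the `e i`
  have hspanE : ∀ v, R v = v → v ∈ Submodule.span ℝ (Set.range e) := by
    intro v hv
    have hv' : (⟨v, (hE v).2 hv⟩ : E) ∈ Submodule.span ℝ (Set.range b) := by rw [b.span_eq]; trivial
    have := Submodule.apply_mem_span_image_of_mem_span E.subtype hv'
    rwa [← Set.range_comp] at this
  let f : Bool × Fin k → F := fun s ↦ bif s.1 then I (e s.2) else e s.2
  -- linear independence of `(e_i, I e_i)`
  have hli : LinearIndependent ℝ f := by
    rw [Fintype.linearIndependent_iff]
    intro g hg
    simp only [f, Fintype.sum_prod_type, Fintype.sum_bool, cond_true, cond_false] at hg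
    -- apply `R`: the `I e_i` change sign
    have hgR := congrArg R hg
    simp only [map_add, map_sum, map_smul, hIR, he, map_zero, smul_neg, Finset.sum_neg_distrib] at hgR
    have h1 : ∑ i, g (false, i) • e i = 0 := by
      have h2 : (2 : ℝ) • ∑ i, g (false, i) • e i = 0 := by
        rw [two_smul]
        have := congrArg₂ (· + ·) hg hgR
        simp only [add_zero] at this
        rw [← this]
        abel
      exact (smul_eq_zero.mp h2).resolve_left two_ne_zero
    have h3 : ∑ i, g (true, i) • I (e i) = 0 := by
      rw [h1, add_zero] at hg
      exact hg
    have h4 : ∑ i, g (true, i) • e i = 0 := by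
      have := congrArg I h3
      simp only [map_sum, map_smul, hI, smul_neg, Finset.sum_neg_distrib, map_zero, neg_eq_zero] at this
      exact this
    have hf := Fintype.linearIndependent_iff.mp hli_e
    rintro ⟨b', i⟩
    cases b'
    · exact hf _ h1 i
    · exact hf _ h4 i
  -- spanning: `w = ½(w + Rw) + I(½ I(Rw − w))` with both halves in `E`
  have hsp : ⊤ ≤ Submodule.span ℝ (Set.range f) := by
    intro w _
    have hsub : Submodule.span ℝ (Set.range e) ≤ Submodule.span ℝ (Set.range f) := by
      rw [Submodule.span_le]
      rintro _ ⟨i, rfl⟩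
      exact Submodule.subset_span ⟨(false, i), by simp [f]⟩
    have hsubI : ∀ y ∈ Submodule.span ℝ (Set.range e), I y ∈ Submodule.span ℝ (Set.range f) := by
      intro y hy
      refine Submodule.span_induction (fun x hx ↦ ?_) (by simp) (fun x y _ _ hx hy ↦ by simpa using add_mem hx hy)
        (fun c x _ hx ↦ by simpa using Submodule.smul_mem _ c hx) hy
      obtain ⟨i, rfl⟩ := hx
      exact Submodule.subset_span ⟨(true, i), by simp [f]⟩
    have hplus : (2⁻¹ : ℝ) • (w + R w) ∈ Submodule.span ℝ (Set.range e) :=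
      hspanE _ (by rw [map_smul, map_add, hR, add_comm])
    have hminus : (2⁻¹ : ℝ) • (I (R w) - I w) ∈ Submodule.span ℝ (Set.range e) :=
      hspanE _ (by rw [map_smul, map_sub, hIR, hR, hIR]; abel_nf)
    have hw : w = (2⁻¹ : ℝ) • (w + R w) + I ((2⁻¹ : ℝ) • (I (R w) - I w)) := by
      rw [map_smul, map_sub, hI, hI]
      module
    rw [hw]
    exact add_mem (hsub hplus) (hsubI _ hminus)
  exact ⟨k, e, Basis.mk hli hsp, he, fun s ↦ by rw [Basis.coe_mk]⟩

/-- `C(2n + 1, 2) = 2n² + n`. [cite: Buskin2018GeneralizedTwistorLines, Thm. 1.2 (chunk p0005 L31)] -/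
theorem choose_two_mul_add_one_two (n : ℕ) : (2 * n + 1).choose 2 = 2 * n ^ 2 + n := by
  induction n with
  | zero => simp
  | succ k ih =>
    have h1 : 2 * (k + 1) + 1 = (2 * k + 1) + 1 + 1 := by ring
    rw [h1, Nat.choose_succ_succ' (2 * k + 1 + 1) 1, Nat.choose_one_right, Nat.choose_succ_succ' (2 * k + 1) 1,
      Nat.choose_one_right, ih]
    ring

variable [FiniteDimensional ℝ F]

open Literature.LinearAlgebra.Matrix in
/-- **Thm. 1.2, `ℍ(1)` clause — the block.** For `I² = −1`, `R² = 1`, `RI = −IR` and an adapted basis `(e_i, Ie_i)_{i<k}`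
with `Re_i = e_i`, the block `Ω ↦ (Ω(e_i, Ie_j))_{ij}` is a LINEAR ISOMORPHISM from the forms of type `(1,1)` for `I` and
anti-invariant under `R` onto the SYMMETRIC `k × k` matrices; the diagonal blocks `Ω(e_i, e_j)`, `Ω(Ie_i, Ie_j)` vanish.
[cite: Buskin2018GeneralizedTwistorLines, Thm. 1.2 (chunk p0005 L31: "For any twistor line `S` of type `ℍ(1)` we have
`dim Hdg_S = 2n² + n`") with §3 "Case of S = S(I,R)" (chunks p0011 L114–p0012)] -/
theorem exists_linearEquiv_symm_of_split {I R : F →L[ℝ] F} (hI : ∀ v, I (I v) = -v)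
    (hIR : ∀ v, R (I v) = -I (R v)) {k : ℕ} {e : Fin k → F} (he : ∀ i, R (e i) = e i)
    (r : Basis (Bool × Fin k) ℝ F) (hr : ∀ s, r s = bif s.1 then I (e s.2) else e s.2)
    (S : Submodule ℝ (F [⋀^Fin 2]→L[ℝ] ℝ))
    (hS : ∀ Ω, Ω ∈ S ↔ (∀ v w, Ω ![I v, I w] = Ω ![v, w]) ∧ ∀ v w, Ω ![R v, R w] = -Ω ![v, w]) :
    ∃ Φ : S ≃ₗ[ℝ] selfAdjointMatricesSubmodule (1 : Matrix (Fin k) (Fin k) ℝ),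
      ∀ Ω : S, ((Φ Ω) : Matrix (Fin k) (Fin k) ℝ) = of (fun i j ↦ (Ω : F [⋀^Fin 2]→L[ℝ] ℝ) ![e i, I (e j)]) := by
  classical
  have r0 : ∀ i, r (false, i) = e i := fun i ↦ by simp [hr]
  have r1 : ∀ i, r (true, i) = I (e i) := fun i ↦ by simp [hr]
  obtain ⟨θ, hθ⟩ := exists_evalMap (F := F) e (fun j ↦ I (e j))
  have memθ : ∀ Ω : S, θ (Ω : F [⋀^Fin 2]→L[ℝ] ℝ) ∈ selfAdjointMatricesSubmodule (1 : Matrix (Fin k) (Fin k) ℝ) := by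
    intro Ω
    rw [mem_selfAdjointMatricesSubmodule_one_iff]
    ext i j
    rw [transpose_apply, hθ, hθ]
    exact apply₂_map_right_comm hI _ ((hS _).1 Ω.2).1 (e j) (e i)
  obtain ⟨Θ, hΘ⟩ : ∃ Θ : S →ₗ[ℝ] selfAdjointMatricesSubmodule (1 : Matrix (Fin k) (Fin k) ℝ),
      ∀ Ω : S, ((Θ Ω) : Matrix (Fin k) (Fin k) ℝ) = θ (Ω : F [⋀^Fin 2]→L[ℝ] ℝ) :=
    ⟨LinearMap.codRestrict _ (θ.comp S.subtype) memθ, fun Ω ↦ rfl⟩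
  -- the diagonal blocks of an anti-invariant form vanish
  have hdiag : ∀ Ω : S, ∀ i j, (Ω : F [⋀^Fin 2]→L[ℝ] ℝ) ![e i, e j] = 0 := by
    intro Ω i j
    have h := ((hS _).1 Ω.2).2 (e i) (e j)
    rw [he, he] at h
    linarith
  have hker : ∀ Ω : S, Θ Ω = 0 → Ω = 0 := by
    intro Ω hΩ
    obtain ⟨hΩI, hΩR⟩ := (hS Ω).1 Ω.2
    have q := hΘ Ω
    rw [hΩ] at q
    have h1 : ∀ i j, (Ω : F [⋀^Fin 2]→L[ℝ] ℝ) ![e i, I (e j)] = 0 := fun i j ↦ by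
      rw [← hθ (Ω : F [⋀^Fin 2]→L[ℝ] ℝ) i j, ← q]; rfl
    have h0 := hdiag Ω
    have mvI : ∀ x y, (Ω : F [⋀^Fin 2]→L[ℝ] ℝ) ![I x, y] = -(Ω : F [⋀^Fin 2]→L[ℝ] ℝ) ![x, I y] :=
      apply₂_map_left hI _ hΩI
    apply Subtype.ext
    refine eq_zero_of_apply₂_basis r _ fun s t ↦ ?_
    obtain ⟨s₁, i⟩ := s
    obtain ⟨t₁, j⟩ := t
    cases s₁ <;> cases t₁ <;> simp [hr, mvI, hI, apply₂_neg_right, h0, h1]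
  have hinj : Function.Injective Θ := by
    intro Ω Ω' h
    have h0 : Θ (Ω - Ω') = 0 := by rw [map_sub Θ Ω Ω', h, sub_self]
    exact sub_eq_zero.mp (hker _ h0)
  have hsurj : Function.Surjective Θ := by
    rintro ⟨B, hB⟩
    have hB' := hB
    rw [mem_selfAdjointMatricesSubmodule_one_iff] at hB'
    have eB : ∀ i j, B j i = B i j := fun i j ↦ by
      have := congrFun (congrFun hB' i) j; simpa using this
    -- Gram matrix: zero diagonal blocks, `B` and `−Bᵀ` off the diagonal
    obtain ⟨M, hM⟩ : ∃ M : Matrix (Bool × Fin k) (Bool × Fin k) ℝ, ∀ s t, M s t =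
        (bif s.1 then (bif t.1 then 0 else -B t.2 s.2) else (bif t.1 then B s.2 t.2 else 0)) :=
      ⟨of fun s t ↦ _, fun s t ↦ rfl⟩
    have hMskew : ∀ s t, M t s = -M s t := by
      rintro ⟨s₁, i⟩ ⟨t₁, j⟩
      cases s₁ <;> cases t₁ <;> simp [hM]
    set Bf := Matrix.toBilin r M with hBf_def
    have hBf : ∀ s t, Bf (r s) (r t) = M s t := toBilin_apply_basis r M
    have hBfskew : ∀ v w, Bf w v = -Bf v w := by
      intro v w
      have h : Bf.flip = -Bf := LinearMap.BilinForm.ext_basis r fun i j ↦ by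
        rw [LinearMap.BilinForm.flip_apply, hBf, hMskew, LinearMap.neg_apply, LinearMap.neg_apply, hBf]
      have := LinearMap.congr_fun₂ h v w
      simpa using this
    obtain ⟨Ω, hΩ⟩ := exists_twoCovector_of_bilin Bf
    have hΩB : ∀ v w, Ω ![v, w] = Bf v w := fun v w ↦ by rw [hΩ, hBfskew v w]; ring
    have hΩr : ∀ s t, Ω ![r s, r t] = M s t := fun s t ↦ by rw [hΩB, hBf]
    have hIr : ∀ s : Bool × Fin k, I (r s) = bif s.1 then -r (false, s.2) else r (true, s.2) := by
      rintro ⟨s₁, i⟩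
      cases s₁ <;> simp [hr, hI]
    have hRr : ∀ s : Bool × Fin k, R (r s) = bif s.1 then -r (true, s.2) else r (false, s.2) := by
      rintro ⟨s₁, i⟩
      cases s₁ <;> simp [hr, hIR, he]
    have hΩI : ∀ v w, Ω ![I v, I w] = Ω ![v, w] := by
      have h : Bf.comp (I : F →ₗ[ℝ] F) (I : F →ₗ[ℝ] F) = Bf := LinearMap.BilinForm.ext_basis r fun s t ↦ by
        rw [LinearMap.BilinForm.comp_apply]
        obtain ⟨s₁, i⟩ := s
        obtain ⟨t₁, j⟩ := t
        simp only [ContinuousLinearMap.coe_coe, hIr, hBf]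
        cases s₁ <;> cases t₁ <;> simp [hBf, hM, eB i j]
      intro v w
      have := LinearMap.congr_fun₂ h v w
      rw [LinearMap.BilinForm.comp_apply] at this
      rw [hΩB, hΩB]
      exact this
    have hΩR : ∀ v w, Ω ![R v, R w] = -Ω ![v, w] := by
      have h : Bf.comp (R : F →ₗ[ℝ] F) (R : F →ₗ[ℝ] F) = -Bf := LinearMap.BilinForm.ext_basis r fun s t ↦ by
        rw [LinearMap.BilinForm.comp_apply, LinearMap.neg_apply, LinearMap.neg_apply]
        obtain ⟨s₁, i⟩ := s
        obtain ⟨t₁, j⟩ := t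
        simp only [ContinuousLinearMap.coe_coe, hRr, hBf]
        cases s₁ <;> cases t₁ <;> simp [hBf, hM]
      intro v w
      have := LinearMap.congr_fun₂ h v w
      rw [LinearMap.BilinForm.comp_apply, LinearMap.neg_apply, LinearMap.neg_apply] at this
      rw [hΩB, hΩB]
      exact this
    have hΩS : Ω ∈ S := (hS Ω).2 ⟨hΩI, hΩR⟩
    refine ⟨⟨Ω, hΩS⟩, ?_⟩
    ext i j
    rw [hΘ, hθ, ← r0, ← r1, hΩr, hM]
    simp
  refine ⟨LinearEquiv.ofBijective Θ ⟨hinj, hsurj⟩, fun Ω ↦ ?_⟩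
  simp only [LinearEquiv.ofBijective_apply]
  rw [hΘ]; ext i j; rw [hθ, of_apply]

open Literature.LinearAlgebra.Matrix in
/-- **Thm. 1.2, `ℍ(1)` clause, the count in an adapted basis**: `dim = C(k + 1, 2)` = the symmetric `k × k` matrices
(`2k = dim_ℝ V_ℝ`). [cite: Buskin2018GeneralizedTwistorLines, Thm. 1.2 (chunk p0005 L31)] -/
theorem finrank_eq_choose_of_splitAdapted_basis {I R : F →L[ℝ] F} (hI : ∀ v, I (I v) = -v)
    (hIR : ∀ v, R (I v) = -I (R v)) {k : ℕ} {e : Fin k → F} (he : ∀ i, R (e i) = e i)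
    (r : Basis (Bool × Fin k) ℝ F) (hr : ∀ s, r s = bif s.1 then I (e s.2) else e s.2)
    (S : Submodule ℝ (F [⋀^Fin 2]→L[ℝ] ℝ))
    (hS : ∀ Ω, Ω ∈ S ↔ (∀ v w, Ω ![I v, I w] = Ω ![v, w]) ∧ ∀ v w, Ω ![R v, R w] = -Ω ![v, w]) :
    finrank ℝ S = (k + 1).choose 2 := by
  classical
  obtain ⟨Φ, -⟩ := exists_linearEquiv_symm_of_split hI hIR he r hr S hS
  rw [LinearEquiv.finrank_eq Φ, finrank_selfAdjointMatricesSubmodule_one, Fintype.card_fin]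

/-- **Theorem 1.2, `ℍ(1)` clause: `dim Hdg_S = 2n² + n`** for every twistor line of type `ℍ(1)` — i.e. for every faithful
representation `I² = −1`, `R² = 1`, `RI = −IR` of the split quaternions on a real space of dimension `4n` — with `Hdg_S`
the forms of type `(1,1)` for `I` and anti-invariant under `R` (equivalently, by `forall_hyperboloid_apply₂_eq_iff`, of type
`(1,1)` for every point of the hyperboloid `S(I, R)`). ("For any twistor line `S` of type `ℍ(1)` we have
`dim Hdg_S = 2n² + n`.") [cite: Buskin2018GeneralizedTwistorLines, Thm. 1.2 (chunk p0005 L31)] -/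
theorem finrank_eq_of_forall_mem_iff_split {n : ℕ} (hF : finrank ℝ F = 4 * n) {I R : F →L[ℝ] F}
    (hI : ∀ v, I (I v) = -v) (hR : ∀ v, R (R v) = v) (hIR : ∀ v, R (I v) = -I (R v))
    (S : Submodule ℝ (F [⋀^Fin 2]→L[ℝ] ℝ))
    (hS : ∀ Ω, Ω ∈ S ↔ (∀ v w, Ω ![I v, I w] = Ω ![v, w]) ∧ ∀ v w, Ω ![R v, R w] = -Ω ![v, w]) :
    finrank ℝ S = 2 * n ^ 2 + n := by
  obtain ⟨k, e, r, he, hr⟩ := exists_splitAdapted_basis I R hI hR hIR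
  have hk : k = 2 * n := by
    have h := finrank_eq_card_basis r
    simp only [Fintype.card_prod, Fintype.card_bool, Fintype.card_fin] at h
    omega
  rw [finrank_eq_choose_of_splitAdapted_basis hI hIR he r hr S hS, hk, choose_two_mul_add_one_two]

/-- **Theorem 1.2, `ℍ(1)` clause, with `Hdg_S` as printed** (invariance under every point `xI + yR + zIR`,
`x² − y² − z² = 1`, of the hyperboloid): `dim Hdg_S = 2n² + n`. [cite: Buskin2018GeneralizedTwistorLines, Thm. 1.2
(chunk p0005 L31) with §1.1 (chunk p0004 L43–49) and §1.2 (chunk p0005 L1–4)] -/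
theorem finrank_eq_of_forall_mem_iff_hyperboloid {n : ℕ} (hF : finrank ℝ F = 4 * n) {I R : F →L[ℝ] F}
    (hI : ∀ v, I (I v) = -v) (hR : ∀ v, R (R v) = v) (hIR : ∀ v, R (I v) = -I (R v))
    (S : Submodule ℝ (F [⋀^Fin 2]→L[ℝ] ℝ))
    (hS : ∀ Ω, Ω ∈ S ↔ ∀ x y z : ℝ, x ^ 2 - y ^ 2 - z ^ 2 = 1 →
      ∀ v w, Ω ![(x • I + y • R + z • I.comp R) v, (x • I + y • R + z • I.comp R) w] = Ω ![v, w]) :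
    finrank ℝ S = 2 * n ^ 2 + n :=
  finrank_eq_of_forall_mem_iff_split hF hI hR hIR S fun Ω ↦
    (hS Ω).trans (forall_hyperboloid_apply₂_eq_iff hI hR hIR Ω)

/-- An inner product on `V_ℝ` invariant under `I` and `R` (average any inner product over the group `{1, I, R, IR}/±`).
[folklore] -/
private theorem exists_invariant_bilin {I R : F →L[ℝ] F} (hI : ∀ v, I (I v) = -v) (hR : ∀ v, R (R v) = v)
    (hIR : ∀ v, R (I v) = -I (R v)) :
    ∃ g : LinearMap.BilinForm ℝ F, (∀ x y, g x y = g y x) ∧ (∀ x, x ≠ 0 → 0 < g x x) ∧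
      (∀ x y, g (I x) (I y) = g x y) ∧ ∀ x y, g (R x) (R y) = g x y := by
  -- an inner product pulled back from the Euclidean model
  let T : F →ₗ[ℝ] EuclideanSpace ℝ (Fin (finrank ℝ F)) := (toEuclidean (E := F)).toLinearEquiv.toLinearMap
  have hT : ∀ x, T x = toEuclidean x := fun x ↦ rfl
  let g₀ : LinearMap.BilinForm ℝ F := LinearMap.mk₂ ℝ (fun x y ↦ inner ℝ (T x) (T y))
    (fun x x' y ↦ by rw [map_add, inner_add_left]) (fun c x y ↦ by rw [map_smul, real_inner_smul_left, smul_eq_mul])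
    (fun x y y' ↦ by rw [map_add, inner_add_right]) (fun c x y ↦ by rw [map_smul, real_inner_smul_right, smul_eq_mul])
  have hg₀ : ∀ x y, g₀ x y = inner ℝ (T x) (T y) := fun x y ↦ rfl
  have hsymm₀ : ∀ x y, g₀ x y = g₀ y x := fun x y ↦ by rw [hg₀, hg₀, real_inner_comm]
  have hnonneg₀ : ∀ x, 0 ≤ g₀ x x := fun x ↦ by rw [hg₀]; exact real_inner_self_nonneg
  have hpos₀ : ∀ x, x ≠ 0 → 0 < g₀ x x := fun x hx ↦ by
    rw [hg₀]
    exact real_inner_self_pos.mpr (by rw [hT]; exact (toEuclidean (E := F)).map_ne_zero_iff.mpr hx)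
  -- average over `{1, I, R, IR}`
  let g : LinearMap.BilinForm ℝ F := g₀ + g₀.comp (I : F →ₗ[ℝ] F) (I : F →ₗ[ℝ] F) +
    g₀.comp (R : F →ₗ[ℝ] F) (R : F →ₗ[ℝ] F) + g₀.comp ((I : F →ₗ[ℝ] F).comp (R : F →ₗ[ℝ] F)) ((I : F →ₗ[ℝ] F).comp (R : F →ₗ[ℝ] F))
  have hg : ∀ x y, g x y = g₀ x y + g₀ (I x) (I y) + g₀ (R x) (R y) + g₀ (I (R x)) (I (R y)) := fun x y ↦ rfl
  have hneg₀ : ∀ x y, g₀ (-x) (-y) = g₀ x y := fun x y ↦ by simp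
  refine ⟨g, fun x y ↦ ?_, fun x hx ↦ ?_, fun x y ↦ ?_, fun x y ↦ ?_⟩
  · rw [hg, hg, hsymm₀ x, hsymm₀ (I x), hsymm₀ (R x), hsymm₀ (I (R x))]
  · rw [hg]
    have := hpos₀ x hx
    have := hnonneg₀ (I x)
    have := hnonneg₀ (R x)
    have := hnonneg₀ (I (R x))
    linarith
  · have h1 : ∀ v, I (R (I v)) = R v := fun v ↦ by rw [hIR, map_neg, hI, neg_neg]
    rw [hg, hg, h1, h1]
    simp only [hI, hIR, map_neg, LinearMap.neg_apply, neg_neg]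
    ring
  · rw [hg, hg]
    simp only [hR]
    ring

/-- **Thm. 1.2, `ℍ(1)` clause: Kähler classes DO survive a non-compact line.** For `I² = −1`, `R² = 1`, `RI = −IR` there is
a real `2`-form of type `(1,1)` for `I` and anti-invariant under `R` — hence (by `forall_hyperboloid_apply₂_eq_iff`) of type
`(1,1)` along the whole hyperboloid `S(I, R)` — which is `I`-POSITIVE: `Ω(v, Iv) > 0` for `v ≠ 0` (a Kähler form of
`(V_ℝ/Γ, I)`; `−Ω` is then `(−I)`-positive, `−I ∈ S(I,R)⁻`): `Ω(v, w) = g(Iv, w)` for an inner product `g` invariant under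
`I` and `R`. ("The subspace `Hdg_S` contains two disjoint open cones of Kähler classes, corresponding to each of the connected
components of `S`"; openness, non-emptiness and disjointness of the two cones: `two_open_kaehlerCones_of_split` below.)
Contrast: on a COMPACT line no Kähler class survives
(`not_forall_apply₂_twistor_pos`). [cite: Buskin2018GeneralizedTwistorLines, Thm. 1.2 (chunk p0005 L31–33)] -/
theorem exists_anti_invariant_pos {I R : F →L[ℝ] F} (hI : ∀ v, I (I v) = -v) (hR : ∀ v, R (R v) = v)
    (hIR : ∀ v, R (I v) = -I (R v)) :
    ∃ Ω : F [⋀^Fin 2]→L[ℝ] ℝ, (∀ v w, Ω ![I v, I w] = Ω ![v, w]) ∧ (∀ v w, Ω ![R v, R w] = -Ω ![v, w]) ∧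
      (∀ v, v ≠ 0 → 0 < Ω ![v, I v]) ∧ ∀ v, v ≠ 0 → 0 < (-Ω) ![v, (-I) v] := by
  obtain ⟨g, hsymm, hpos, hgI, hgR⟩ := exists_invariant_bilin hI hR hIR
  -- `g(Iw, v) = −g(Iv, w)`
  have hflip : ∀ v w, g (I w) v = -g (I v) w := fun v w ↦ by
    rw [hsymm (I w) v, ← hgI v (I w), hI, map_neg]
  obtain ⟨Ω, hΩ⟩ := exists_twoCovector_of_bilin (g.comp (I : F →ₗ[ℝ] F) LinearMap.id)
  have hΩg : ∀ v w, Ω ![v, w] = g (I v) w := fun v w ↦ by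
    rw [hΩ, LinearMap.BilinForm.comp_apply, LinearMap.BilinForm.comp_apply, LinearMap.id_apply, LinearMap.id_apply]
    change 2⁻¹ * (g (I v) w - g (I w) v) = g (I v) w
    rw [hflip v w]
    ring
  have hRI : ∀ v, I (R v) = -R (I v) := fun v ↦ by rw [hIR, neg_neg]
  refine ⟨Ω, fun v w ↦ ?_, fun v w ↦ ?_, fun v hv ↦ ?_, fun v hv ↦ ?_⟩
  · rw [hΩg, hΩg, hI, map_neg, LinearMap.neg_apply, hsymm v (I w), hflip v w, neg_neg]
  · rw [hΩg, hΩg, hRI, map_neg, LinearMap.neg_apply, hgR]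
  · rw [hΩg]
    exact hpos _ fun h ↦ hv (by simpa [h] using (hI v).symm)
  · rw [ContinuousAlternatingMap.neg_apply, _root_.neg_apply, apply₂_neg_right, neg_neg, hΩg]
    exact hpos _ fun h ↦ hv (by simpa [h] using (hI v).symm)

/-- **"All faithful representations `ℍ(1) → End V_ℝ` are equivalent, or, which is the same, the action of `GL(V_ℝ)` on
the set of twistor lines of type `ℍ(1)` in `Compl` is transitive."** For two pairs `(I₁, R₁)`, `(I₂, R₂)` with
`I_i² = −1`, `R_i² = 1`, `R_i I_i = −I_i R_i` on the same finite-dimensional real space there is a linear automorphism `g`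
with `g I₁ = I₂ g` and `g R₁ = R₂ g` — map the adapted basis `(v_i, I₁v_i)`, `R₁v_i = v_i`, of `exists_splitAdapted_basis`
to that of `(I₂, R₂)` (both have `dim_ℝ F / 2` members; in either basis `I` and `R` have the same matrices) — hence
`g S(I₁, R₁) g⁻¹ = S(I₂, R₂)`. [cite: Buskin2018GeneralizedTwistorLines, Thm. 1.2 (chunk p0005 L35–38)] -/
theorem exists_conj_of_splitPair {I₁ R₁ I₂ R₂ : F →L[ℝ] F} (hI₁ : ∀ v, I₁ (I₁ v) = -v) (hR₁ : ∀ v, R₁ (R₁ v) = v)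
    (hIR₁ : ∀ v, R₁ (I₁ v) = -I₁ (R₁ v)) (hI₂ : ∀ v, I₂ (I₂ v) = -v) (hR₂ : ∀ v, R₂ (R₂ v) = v)
    (hIR₂ : ∀ v, R₂ (I₂ v) = -I₂ (R₂ v)) :
    ∃ g : F ≃L[ℝ] F, (∀ v, g (I₁ v) = I₂ (g v)) ∧ ∀ v, g (R₁ v) = R₂ (g v) := by
  classical
  obtain ⟨k, e₁, r₁, he₁, hr₁⟩ := exists_splitAdapted_basis I₁ R₁ hI₁ hR₁ hIR₁
  obtain ⟨k₂, e₂, r₂, he₂, hr₂⟩ := exists_splitAdapted_basis I₂ R₂ hI₂ hR₂ hIR₂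
  have hk : k₂ = k := by
    have h₁ := finrank_eq_card_basis r₁
    have h₂ := finrank_eq_card_basis r₂
    simp only [Fintype.card_prod, Fintype.card_bool, Fintype.card_fin] at h₁ h₂
    omega
  subst hk
  let g : F ≃ₗ[ℝ] F := r₁.equiv r₂ (Equiv.refl _)
  have hg : ∀ s, g (r₁ s) = r₂ s := fun s ↦ by simp [g]
  have hgI : g.toLinearMap ∘ₗ (I₁ : F →ₗ[ℝ] F) = (I₂ : F →ₗ[ℝ] F) ∘ₗ g.toLinearMap := by
    refine r₁.ext fun s ↦ ?_
    obtain ⟨b, a⟩ := s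
    cases b
    · have h1 : I₁ (r₁ (false, a)) = r₁ (true, a) := by rw [hr₁, hr₁]; rfl
      have h2 : I₂ (r₂ (false, a)) = r₂ (true, a) := by rw [hr₂, hr₂]; rfl
      simp only [LinearMap.coe_comp, Function.comp_apply, ContinuousLinearMap.coe_coe, LinearEquiv.coe_coe, h1, hg, h2]
    · have h1 : I₁ (r₁ (true, a)) = -r₁ (false, a) := by rw [hr₁, hr₁]; exact hI₁ _
      have h2 : I₂ (r₂ (true, a)) = -r₂ (false, a) := by rw [hr₂, hr₂]; exact hI₂ _
      simp only [LinearMap.coe_comp, Function.comp_apply, ContinuousLinearMap.coe_coe, LinearEquiv.coe_coe, h1, map_neg,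
        hg, h2]
  have hgR : g.toLinearMap ∘ₗ (R₁ : F →ₗ[ℝ] F) = (R₂ : F →ₗ[ℝ] F) ∘ₗ g.toLinearMap := by
    refine r₁.ext fun s ↦ ?_
    obtain ⟨b, a⟩ := s
    cases b
    · have h1 : R₁ (r₁ (false, a)) = r₁ (false, a) := by rw [hr₁]; exact he₁ a
      have h2 : R₂ (r₂ (false, a)) = r₂ (false, a) := by rw [hr₂]; exact he₂ a
      simp only [LinearMap.coe_comp, Function.comp_apply, ContinuousLinearMap.coe_coe, LinearEquiv.coe_coe, h1, hg, h2]
    · have h1 : R₁ (r₁ (true, a)) = -r₁ (true, a) := by rw [hr₁]; exact (hIR₁ _).trans (by rw [he₁]; rfl)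
      have h2 : R₂ (r₂ (true, a)) = -r₂ (true, a) := by rw [hr₂]; exact (hIR₂ _).trans (by rw [he₂]; rfl)
      simp only [LinearMap.coe_comp, Function.comp_apply, ContinuousLinearMap.coe_coe, LinearEquiv.coe_coe, h1, map_neg,
        hg, h2]
  refine ⟨g.toContinuousLinearEquiv, fun v ↦ ?_, fun v ↦ ?_⟩
  · simpa using LinearMap.congr_fun hgI v
  · simpa using LinearMap.congr_fun hgR v

/-! #### The two Kähler cones along a line of type `ℍ(1)` are open -/

/-- **Positivity is an open condition.** For a fixed operator `Λ` on a finite-dimensional `V_ℝ`, the real `2`-covectors `Ω`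
with `Ω(v, Λv) > 0` for all `v ≠ 0` (for `Λ` a complex structure: the Kähler forms of `(V_ℝ/Γ, Λ)`) form an OPEN set —
minimise `Ω(u, Λu)` over the unit sphere and use `|Ω'(u, Λu) − Ω(u, Λu)| ≤ ‖Ω' − Ω‖·‖Λ‖`. (The ingredient of "two
disjoint OPEN cones of Kähler classes".) [cite: Buskin2018GeneralizedTwistorLines, Thm. 1.2 (chunk p0005 L31–33) with §3 (chunk
p0012 L100–105: "each of which is an open cone in Hdg_{S(I,R)}")] -/
theorem isOpen_setOf_apply₂_pos (Λ : F →L[ℝ] F) :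
    IsOpen {Ω : F [⋀^Fin 2]→L[ℝ] ℝ | ∀ v, v ≠ 0 → 0 < Ω ![v, Λ v]} := by
  rw [Metric.isOpen_iff]
  intro Ω hΩ
  simp only [Set.mem_setOf_eq] at hΩ
  obtain hF | hF := subsingleton_or_nontrivial F
  · exact ⟨1, one_pos, fun Ω' _ v hv ↦ (hv (Subsingleton.elim _ _)).elim⟩
  -- `u ↦ Ω(u, Λu)` is continuous, hence attains a (positive) minimum on the unit sphere
  have hf : Continuous fun u : F ↦ Ω ![u, Λ u] := by
    have h2 : Continuous fun u : F ↦ (![u, Λ u] : Fin 2 → F) := by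
      refine continuous_pi fun i ↦ ?_
      fin_cases i
      · exact continuous_id
      · exact Λ.continuous
    exact Ω.coe_continuous.comp h2
  obtain ⟨u₀, hu₀, hmin⟩ := (isCompact_sphere (0 : F) 1).exists_isMinOn
    ((NormedSpace.sphere_nonempty (E := F)).mpr zero_le_one) hf.continuousOn
  have hu₀' : ‖u₀‖ = 1 := mem_sphere_zero_iff_norm.mp hu₀
  have hm : 0 < Ω ![u₀, Λ u₀] := hΩ u₀ (by rintro rfl; simp at hu₀')
  refine ⟨Ω ![u₀, Λ u₀] / (‖Λ‖ + 1), by positivity, fun Ω' hΩ' v hv ↦ ?_⟩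
  rw [Metric.mem_ball, dist_eq_norm] at hΩ'
  have hvn : 0 < ‖v‖ := norm_pos_iff.mpr hv
  -- the unit vector `u = v / ‖v‖`
  set u : F := ‖v‖⁻¹ • v with hu_def
  have hu : ‖u‖ = 1 := by rw [hu_def, norm_smul, norm_inv, norm_norm, inv_mul_cancel₀ hvn.ne']
  have h1 : Ω ![u₀, Λ u₀] ≤ Ω ![u, Λ u] := isMinOn_iff.mp hmin u (mem_sphere_zero_iff_norm.mpr hu)
  have h2 : |(Ω' - Ω) ![u, Λ u]| ≤ ‖Ω' - Ω‖ * ‖Λ‖ := by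
    calc |(Ω' - Ω) ![u, Λ u]| = ‖(Ω' - Ω) ![u, Λ u]‖ := (Real.norm_eq_abs _).symm
      _ ≤ ‖Ω' - Ω‖ * ∏ i, ‖(![u, Λ u] : Fin 2 → F) i‖ := (Ω' - Ω).le_opNorm _
      _ = ‖Ω' - Ω‖ * ‖Λ u‖ := by simp [Fin.prod_univ_two, hu]
      _ ≤ ‖Ω' - Ω‖ * ‖Λ‖ := by
        refine mul_le_mul_of_nonneg_left ?_ (norm_nonneg _)
        simpa [hu] using Λ.le_opNorm u
  have h3 : ‖Ω' - Ω‖ * ‖Λ‖ < Ω ![u₀, Λ u₀] := by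
    have hΛ : 0 ≤ ‖Λ‖ := norm_nonneg _
    calc ‖Ω' - Ω‖ * ‖Λ‖ ≤ Ω ![u₀, Λ u₀] / (‖Λ‖ + 1) * ‖Λ‖ := mul_le_mul_of_nonneg_right hΩ'.le hΛ
      _ < Ω ![u₀, Λ u₀] := by
        rw [div_mul_eq_mul_div, div_lt_iff₀ (by positivity)]
        nlinarith
  have h4 : 0 < Ω' ![u, Λ u] := by
    have h5 := (abs_le.mp h2).1
    rw [ContinuousAlternatingMap.sub_apply] at h5
    linarith
  -- scale back from `u` to `v`
  have h6 : Ω' ![u, Λ u] = ‖v‖⁻¹ * (‖v‖⁻¹ * Ω' ![v, Λ v]) := by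
    simp only [hu_def, map_smul, apply₂_smul_left, apply₂_smul_right, smul_eq_mul]
  rw [h6] at h4
  have hi : 0 < ‖v‖⁻¹ := inv_pos.mpr hvn
  exact (mul_pos_iff_of_pos_left hi).mp ((mul_pos_iff_of_pos_left hi).mp h4)

/-- The same inside any carrier `S ⊆ Hom(∧²V_ℝ, ℝ)`: the `Λ`-positive members of `S` form an open subset of `S`.
[cite: Buskin2018GeneralizedTwistorLines, Thm. 1.2 (chunk p0005 L31–33)] -/
theorem isOpen_setOf_coe_apply₂_pos (Λ : F →L[ℝ] F) (S : Submodule ℝ (F [⋀^Fin 2]→L[ℝ] ℝ)) :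
    IsOpen {Ω : S | ∀ v, v ≠ 0 → 0 < (Ω : F [⋀^Fin 2]→L[ℝ] ℝ) ![v, Λ v]} :=
  (isOpen_setOf_apply₂_pos Λ).preimage continuous_subtype_val

/-- **Theorem 1.2, `ℍ(1)` clause, last sentence: "The subspace `Hdg_S` contains two disjoint open cones of Kähler classes,
corresponding to each of the connected components of `S`."** For `I² = −1`, `R² = 1`, `RI = −IR` on `V_ℝ ≠ 0` and any
carrier `S` of `Hdg_{S(I,R)}` (`forall_hyperboloid_apply₂_eq_iff`), the `I`-positive members `K⁺` (Kähler forms of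
`(V_ℝ/Γ, I)`, `I ∈ S(I,R)⁺`) and the `(−I)`-positive members `K⁻` (`−I ∈ S(I,R)⁻`) are OPEN subsets of `S`, both NONEMPTY,
and DISJOINT. (That `K^±` are convex cones — closed under sums and positive multiples — is immediate from bilinearity and
is not spelled out.) [cite: Buskin2018GeneralizedTwistorLines, Thm. 1.2 (chunk p0005 L31–33), proof §3 (chunk p0012 L100–105)] -/
theorem two_open_kaehlerCones_of_split [Nontrivial F] {I R : F →L[ℝ] F} (hI : ∀ v, I (I v) = -v)
    (hR : ∀ v, R (R v) = v) (hIR : ∀ v, R (I v) = -I (R v)) (S : Submodule ℝ (F [⋀^Fin 2]→L[ℝ] ℝ))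
    (hS : ∀ Ω, Ω ∈ S ↔ (∀ v w, Ω ![I v, I w] = Ω ![v, w]) ∧ ∀ v w, Ω ![R v, R w] = -Ω ![v, w]) :
    IsOpen {Ω : S | ∀ v, v ≠ 0 → 0 < (Ω : F [⋀^Fin 2]→L[ℝ] ℝ) ![v, I v]} ∧
      IsOpen {Ω : S | ∀ v, v ≠ 0 → 0 < (Ω : F [⋀^Fin 2]→L[ℝ] ℝ) ![v, (-I) v]} ∧
      {Ω : S | ∀ v, v ≠ 0 → 0 < (Ω : F [⋀^Fin 2]→L[ℝ] ℝ) ![v, I v]}.Nonempty ∧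
      {Ω : S | ∀ v, v ≠ 0 → 0 < (Ω : F [⋀^Fin 2]→L[ℝ] ℝ) ![v, (-I) v]}.Nonempty ∧
      Disjoint {Ω : S | ∀ v, v ≠ 0 → 0 < (Ω : F [⋀^Fin 2]→L[ℝ] ℝ) ![v, I v]}
        {Ω : S | ∀ v, v ≠ 0 → 0 < (Ω : F [⋀^Fin 2]→L[ℝ] ℝ) ![v, (-I) v]} := by
  obtain ⟨Ω, hΩI, hΩR, hpos, hneg⟩ := exists_anti_invariant_pos hI hR hIR
  have hΩS : Ω ∈ S := (hS Ω).2 ⟨hΩI, hΩR⟩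
  refine ⟨isOpen_setOf_coe_apply₂_pos I S, isOpen_setOf_coe_apply₂_pos (-I) S, ⟨⟨Ω, hΩS⟩, hpos⟩,
    ⟨⟨-Ω, S.neg_mem hΩS⟩, hneg⟩, Set.disjoint_left.mpr fun Ω' h₁ h₂ ↦ ?_⟩
  obtain ⟨v, hv⟩ := exists_ne (0 : F)
  have h₁ := h₁ v hv
  have h₂ := h₂ v hv
  rw [_root_.neg_apply, apply₂_neg_right] at h₂
  linarith

omit [FiniteDimensional ℝ F] in
/-- **Kähler along the whole sheet.** If `Ω ∈ Hdg_{S(I,R)}` (type `(1,1)` for `I`, anti-invariant under `R`) is a Kähler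
form of `(V_ℝ/Γ, I)` (`Ω(v, Iv) > 0`, `v ≠ 0`), then it is a Kähler form of `(V_ℝ/Γ, λ)` for EVERY point
`λ = xI + yR + zIR`, `x² − y² − z² = 1`, `x > 0`, of the connected component `S(I,R)⁺ ∋ I`: with `a = Ω(v, Iv)`,
`q = Ω(v, λv)` and `w = xv − yIRv + zRv` one has `Ω(w, Iw) = 2x·q − a`, and `Ω(w, Iw) ≥ 0` — so the cone `K⁺` of
`two_open_kaehlerCones_of_split` consists of classes Kähler along all of `S⁺` ("corresponding to each of the connected
components of `S`"; by `v ↦ −Ω`, `λ ↦ −λ` the same for `S⁻`). [cite: Buskin2018GeneralizedTwistorLines, Thm. 1.2 (chunk p0005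
L31–33) with §3 (chunk p0012 L100–105: "The Kähler classes which stay of type (1,1) along one of the components of S(I,R)
correspond to ±B > 0")] -/
theorem apply₂_splitTwistor_pos {I R : F →L[ℝ] F} (hI : ∀ v, I (I v) = -v) (hR : ∀ v, R (R v) = v)
    (hIR : ∀ v, R (I v) = -I (R v)) (Ω : F [⋀^Fin 2]→L[ℝ] ℝ) (hΩI : ∀ v w, Ω ![I v, I w] = Ω ![v, w])
    (hΩR : ∀ v w, Ω ![R v, R w] = -Ω ![v, w]) (hpos : ∀ v, v ≠ 0 → 0 < Ω ![v, I v]) {x y z : ℝ}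
    (hxyz : x ^ 2 - y ^ 2 - z ^ 2 = 1) (hx : 0 < x) (v : F) (hv : v ≠ 0) :
    0 < Ω ![v, (x • I + y • R + z • I.comp R) v] := by
  have mvI := apply₂_map_left hI Ω hΩI
  have mvR := apply₂_map_left_of_anti hR Ω hΩR
  have hB2 : ∀ w, 0 ≤ Ω ![w, I w] := fun w ↦ by
    rcases eq_or_ne w 0 with rfl | hw
    · have h := apply₂_smul_left Ω (0 : ℝ) (0 : F) (I 0)
      rw [zero_smul, zero_smul] at h
      rw [h]
    · exact (hpos w hw).le
  have hvv : Ω ![v, v] = 0 := by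
    have h := apply₂_swap Ω v v
    linarith
  have ha := hpos v hv
  -- `Ω(w, Iw) ≥ 0` for `w = xv − yIRv + zRv`, expanded in the atoms `Ω(v, Iv)`, `Ω(v, Rv)`, `Ω(v, IRv)`
  have h0 := hB2 (x • v + (-y) • I (R v) + z • R v)
  simp only [map_add, map_smul, map_neg, apply₂_add_left, apply₂_add_right, apply₂_smul_left, apply₂_smul_right, mvI, mvR,
    hI, hR, hIR, apply₂_neg_right, smul_neg, neg_neg, smul_eq_mul, hvv, mul_zero, neg_zero, add_zero] at h0
  simp only [_root_.add_apply, _root_.smul_apply, ContinuousLinearMap.coe_comp, Function.comp_apply, apply₂_add_right,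
    apply₂_smul_right, smul_eq_mul]
  nlinarith [h0, ha, hx, hxyz]

end SplitCount

/-! ### §5 The non-compact lines of type `ℍ(0)`: `Hdg_S`, no Kähler classes, the normal form `Im N ⊕ W ⊕ U` and `dim Hdg_S = k(k+1) + (2n−k)²` -/

section NilLine

/-- **Scaling along a line of type `ℍ(0)`.** For `I² = −1`, `N² = 0`, `NI = −IN` and `Ω` of type `(1,1)` for `I` with
`Ω(Nv, w) = −Ω(v, Nw)` ("`NᵗQ + QN = 0`"), every `λ = xI + aN + bIN` satisfies `Ω(λv, λw) = x²·Ω(v, w)` — all the other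
coefficients of the polynomial in `a, b` vanish ("`NᵗQN = 0` … holds automatically").
[cite: Buskin2018GeneralizedTwistorLines, §3 "Case of S(I,N)" (chunk p0013 L43–55)] -/
theorem apply₂_nilTwistor_eq_smul {I N : F →L[ℝ] F} (hI : ∀ v, I (I v) = -v) (hN : ∀ v, N (N v) = 0)
    (hIN : ∀ v, N (I v) = -I (N v)) (Ω : F [⋀^Fin 2]→L[ℝ] W) (hΩI : ∀ v w, Ω ![I v, I w] = Ω ![v, w])
    (hΩN : ∀ v w, Ω ![N v, w] = -Ω ![v, N w]) (x a b : ℝ) (v w : F) :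
    Ω ![(x • I + a • N + b • I.comp N) v, (x • I + a • N + b • I.comp N) w] = x ^ 2 • Ω ![v, w] := by
  have mvI := apply₂_map_left hI Ω hΩI
  have hNI : ∀ v, I (N v) = -N (I v) := fun v ↦ by rw [hIN, neg_neg]
  have hz : ∀ u : F, Ω ![u, (0 : F)] = 0 := fun u ↦ by simpa using apply₂_smul_right Ω 0 u 0
  simp only [_root_.add_apply, _root_.smul_apply, ContinuousLinearMap.coe_comp, Function.comp_apply, apply₂_add_left,
    apply₂_add_right, apply₂_smul_left, apply₂_smul_right, mvI, hΩN, hI, hN, hNI, hz, map_neg, map_zero, apply₂_neg_right,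
    apply₂_neg_left, smul_neg, neg_neg, smul_smul, smul_add, smul_zero, neg_zero]
  module

/-- **`Hdg_S` for a line of type `ℍ(0)`.** "The first bilinear relation for `Q` with respect to the periods in `S(I,N)` can
be written as `(I+aN+bIN)ᵗQ(I+aN+bIN) = Q` for all `a, b ∈ ℝ`" (and the same for the other component `−(I+aN+bIN)`; here
both at once: `λ = xI + aN + bIN`, `x² = 1`): a `2`-covector is of type `(1,1)` along `S(I, N)` iff it is of type `(1,1)`
for `I` and `N` is `Ω`-skew, `Ω(Nv, w) = −Ω(v, Nw)` ("we have `IᵗQI = Q` … that is, `NᵗQ + QN = 0`. Similarly, `b`-coefficient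
gives the same equality, `a²`- and `b²`-coefficients give … `NᵗQN = 0`, and `ab`-coefficient … holds automatically").
[cite: Buskin2018GeneralizedTwistorLines, Thm. 1.2 (chunk p0005 L45–49) with §3 "Case of S(I,N)" (chunk p0013 L43–55)] -/
theorem forall_nilLine_apply₂_eq_iff {I N : F →L[ℝ] F} (hI : ∀ v, I (I v) = -v) (hN : ∀ v, N (N v) = 0)
    (hIN : ∀ v, N (I v) = -I (N v)) (Ω : F [⋀^Fin 2]→L[ℝ] W) :
    (∀ x a b : ℝ, x ^ 2 = 1 →
        ∀ v w, Ω ![(x • I + a • N + b • I.comp N) v, (x • I + a • N + b • I.comp N) w] = Ω ![v, w]) ↔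
      (∀ v w, Ω ![I v, I w] = Ω ![v, w]) ∧ ∀ v w, Ω ![N v, w] = -Ω ![v, N w] := by
  constructor
  · intro h
    have hΩI : ∀ v w, Ω ![I v, I w] = Ω ![v, w] := fun v w ↦ by simpa using h 1 0 0 (by norm_num) v w
    -- the `a`-coefficient: `Ω(Iv, Nw) + Ω(Nv, Iw) = 0`
    have hstar : ∀ v w, Ω ![I v, N w] + Ω ![N v, I w] = 0 := fun v w ↦ by
      have h₁ := h 1 1 0 (by norm_num) v w
      have h₂ := h 1 (-1) 0 (by norm_num) v w
      simp only [_root_.add_apply, _root_.neg_apply, one_smul, zero_smul, add_zero, neg_smul, apply₂_add_left,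
        apply₂_add_right, apply₂_neg_left, apply₂_neg_right, hΩI] at h₁ h₂
      linear_combination (norm := module) (1 / 2 : ℝ) • h₁ - (1 / 2 : ℝ) • h₂
    refine ⟨hΩI, fun v w ↦ ?_⟩
    have h₃ := hstar v (I w)
    rw [hIN, hI, apply₂_neg_right, apply₂_neg_right, hΩI] at h₃
    linear_combination (norm := module) -h₃
  · rintro ⟨hΩI, hΩN⟩ x a b hx v w
    rw [apply₂_nilTwistor_eq_smul hI hN hIN Ω hΩI hΩN, hx, one_smul]

/-- **Theorem 1.2, `ℍ(0)` clause: "`Hdg_S` does not contain any Kähler classes for either of the two connected components of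
`S`."** If `N ≠ 0`, `N² = 0`, `NI = −IN` and `N` is `Ω`-skew, then `Ω` is `λ`-positive for NO `λ = xI + aN + bIN`
(any `x, a, b`; both components): for `v = Nu ≠ 0`, `λv = x·INu` and `Ω(Nu, INu) = −Ω(u, NINu) = Ω(u, IN²u) = 0`.
[cite: Buskin2018GeneralizedTwistorLines, Thm. 1.2 (chunk p0005 L45–49)] -/
theorem not_forall_apply₂_nilTwistor_pos {I N : F →L[ℝ] F} (hN : ∀ v, N (N v) = 0) (hIN : ∀ v, N (I v) = -I (N v))
    (hN0 : N ≠ 0) (Ω : F [⋀^Fin 2]→L[ℝ] ℝ) (hΩN : ∀ v w, Ω ![N v, w] = -Ω ![v, N w]) (x a b : ℝ) :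
    ¬ ∀ v, v ≠ 0 → 0 < Ω ![v, (x • I + a • N + b • I.comp N) v] := by
  obtain ⟨u, hu⟩ := DFunLike.ne_iff.mp hN0
  intro h
  have h1 := h (N u) hu
  have hz : Ω ![u, (0 : F)] = 0 := by simpa using apply₂_smul_right Ω 0 u 0
  have h2 : (x • I + a • N + b • I.comp N) (N u) = x • I (N u) := by simp [hN]
  rw [h2, apply₂_smul_right, hΩN, hIN, hN, map_zero, neg_zero, hz, neg_zero, smul_zero] at h1
  exact lt_irrefl _ h1

end NilLine

section NilCount

variable [FiniteDimensional ℝ F]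

/-- **The normal form of a (faithful) representation of `ℍ(0)`** ("As `IN = −NI`, both the kernel and the image of `N`,
`Im N ⊂ Ker N ⊂ V_ℝ`, are `I`-invariant subspaces. Next, choosing an `I`-invariant complement `U` for `Ker N` … a basis
`u_1, …, u_k, Iu_1, …, Iu_k` of `U`, and an `I`-invariant complement `W` for `Im N` in `Ker N` together with its basis of
the form `w_1, …, w_l, Iw_1, …, Iw_l`, we get the basis `Nu_1, …, NIu_k, w_1, …, Iw_l, u_1, …, Iu_k` of
`V_ℝ = Im N ⊕ W ⊕ U`, where `4k + 2l = dim V_ℝ`"): for `I² = −1`, `N² = 0`, `NI = −IN` on a finite-dimensional real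
space there are `u_i` (`i < k`) and `w_j ∈ Ker N` (`j < l`) such that `(Nu_i, INu_i)_i, (w_j, Iw_j)_j, (u_i, Iu_i)_i` is a
basis, `dim_ℝ V_ℝ = 4k + 2l`, `dim_ℝ Im N = 2k` (the `I`-invariant complements are taken as complex subspaces for the complex structure
`I`; here `INu_i = −NIu_i` replaces the printed `NIu_i`). [cite: Buskin2018GeneralizedTwistorLines, §3 "Case of S(I,N)"
(chunk p0013 L1–7, L37–41: "All non-equivalent 4n-representations are parametrized by … k, l satisfying 4k + 2l = 4n")] -/
theorem exists_nilAdapted_basis (I N : F →L[ℝ] F) (hI : ∀ v, I (I v) = -v) (hN : ∀ v, N (N v) = 0)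
    (hIN : ∀ v, N (I v) = -I (N v)) :
    ∃ (k l : ℕ) (u : Fin k → F) (w : Fin l → F)
      (r : Basis (((Bool × Fin k) ⊕ (Bool × Fin l)) ⊕ (Bool × Fin k)) ℝ F),
      (∀ j, N (w j) = 0) ∧ finrank ℝ F = 4 * k + 2 * l ∧ finrank ℝ (LinearMap.range (N : F →ₗ[ℝ] F)) = 2 * k ∧
      (∀ b i, r (Sum.inl (Sum.inl (b, i))) = bif b then I (N (u i)) else N (u i)) ∧
      (∀ b j, r (Sum.inl (Sum.inr (b, j))) = bif b then I (w j) else w j) ∧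
      ∀ b i, r (Sum.inr (b, i)) = bif b then I (u i) else u i := by
  classical
  -- `K = Ker N` is `I`-stable; `I` makes it a complex vector space
  let K : Submodule ℝ F := LinearMap.ker (N : F →ₗ[ℝ] F)
  have hKmem : ∀ v, v ∈ K ↔ N v = 0 := fun v ↦ by simp [K]
  have hIK : ∀ v ∈ K, (I : F →ₗ[ℝ] F) v ∈ K := fun v hv ↦ by
    rw [hKmem] at hv
    rw [hKmem, ContinuousLinearMap.coe_coe, hIN, hv, map_zero, neg_zero]
  let IK : K →ₗ[ℝ] K := (I : F →ₗ[ℝ] F).restrict hIK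
  have hIKv : ∀ v : K, ((IK v : K) : F) = I v := fun v ↦ rfl
  have hIK2 : IK * IK = -1 := by
    apply LinearMap.ext
    intro v
    apply Subtype.ext
    simp [IK, hI]
  letI : Module ℂ K := Module.compHom K (Complex.liftAux IK hIK2 : ℂ →ₐ[ℝ] Module.End ℝ K).toRingHom
  have hsmulK : ∀ (z : ℂ) (v : K), z • v = z.re • v + z.im • IK v := fun z v ↦ by
    show Complex.liftAux IK hIK2 z v = _
    rw [Complex.liftAux_apply, LinearMap.add_apply, LinearMap.smul_apply, Module.algebraMap_end_apply]
  haveI : IsScalarTower ℝ ℂ K := by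
    refine ⟨fun t z v ↦ ?_⟩
    rw [hsmulK, hsmulK, Complex.smul_re, Complex.smul_im, smul_eq_mul, smul_eq_mul, smul_add, mul_smul, mul_smul]
  haveI : Module.Finite ℂ K := Module.Finite.of_restrictScalars_finite ℝ ℂ K
  -- `R = Im N ⊆ K`, a complex subspace of `K`
  have hRK : ∀ v, N v ∈ K := fun v ↦ (hKmem _).2 (hN v)
  let RK : Submodule ℂ K :=
    { carrier := {x | ∃ y : F, N y = (x : F)}
      add_mem' := by
        rintro x x' ⟨y, hy⟩ ⟨y', hy'⟩
        exact ⟨y + y', by rw [map_add, hy, hy', Submodule.coe_add]⟩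
      zero_mem' := ⟨0, by rw [map_zero, Submodule.coe_zero]⟩
      smul_mem' := by
        rintro z x ⟨y, hy⟩
        refine ⟨z.re • y - z.im • I y, ?_⟩
        rw [hsmulK, Submodule.coe_add, Submodule.coe_smul, Submodule.coe_smul, hIKv, map_sub, map_smul, map_smul, hIN,
          hy, smul_neg, sub_neg_eq_add] }
  have hRKmem : ∀ x : K, x ∈ RK ↔ ∃ y : F, N y = (x : F) := fun x ↦ Iff.rfl
  obtain ⟨W, hW⟩ := RK.exists_isCompl
  -- complex bases of `R` and `W`, the vectors `f_i = N u_i`, `w_j`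
  let k := finrank ℂ RK
  let l := finrank ℂ W
  let bR : Basis (Fin k) ℂ RK := Module.finBasis ℂ RK
  let bW : Basis (Fin l) ℂ W := Module.finBasis ℂ W
  let f : Fin k → F := fun i ↦ ((bR i : K) : F)
  let w : Fin l → F := fun j ↦ ((bW j : K) : F)
  have hfR : ∀ i, ∃ y : F, N y = f i := fun i ↦ (hRKmem _).1 (bR i).2
  choose u hu using hfR
  have hwK : ∀ j, N (w j) = 0 := fun j ↦ (hKmem _).1 (bW j : K).2
  -- the real basis `(x_s, I x_s)` of `K` built from the complex basis `(f_i, w_j)` of `K = R ⊕ W`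
  let bK : Basis (Fin k ⊕ Fin l) ℂ K := (bR.prod bW).map (Submodule.prodEquivOfIsCompl RK W hW)
  have hbK_inl : ∀ i, ((bK (Sum.inl i) : K) : F) = f i := fun i ↦ by
    simp [bK, f]
  have hbK_inr : ∀ j, ((bK (Sum.inr j) : K) : F) = w j := fun j ↦ by
    simp [bK, w]
  let rK : Basis (Fin 2 × (Fin k ⊕ Fin l)) ℝ K := Complex.basisOneI.smulTower bK
  have hrK0 : ∀ s, rK (0, s) = bK s := fun s ↦ by
    rw [Module.Basis.smulTower_apply, Complex.coe_basisOneI, Matrix.cons_val_zero, one_smul]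
  have hrK1 : ∀ s, ((rK (1, s) : K) : F) = I (bK s) := fun s ↦ by
    rw [Module.Basis.smulTower_apply, Complex.coe_basisOneI, Matrix.cons_val_one, Matrix.cons_val_zero, hsmulK,
      Complex.I_re, Complex.I_im, zero_smul, zero_add, one_smul, hIKv]
  -- the `K`-part of the family: `(f_i, If_i)_i, (w_j, Iw_j)_j`, a real basis of `K` read in `F`
  let vK : (Bool × Fin k) ⊕ (Bool × Fin l) → F :=
    Sum.elim (fun p ↦ bif p.1 then I (f p.2) else f p.2) (fun p ↦ bif p.1 then I (w p.2) else w p.2)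
  let ix : (Bool × Fin k) ⊕ (Bool × Fin l) → Fin 2 × (Fin k ⊕ Fin l) :=
    Sum.elim (fun p ↦ (bif p.1 then 1 else 0, Sum.inl p.2)) (fun p ↦ (bif p.1 then 1 else 0, Sum.inr p.2))
  have hix : Function.Injective ix := by
    rintro (⟨b, i⟩ | ⟨b, j⟩) (⟨b', i'⟩ | ⟨b', j'⟩) h
    · simp only [ix, Sum.elim_inl, Prod.mk.injEq, Sum.inl.injEq] at h
      obtain ⟨h1, rfl⟩ := h
      cases b <;> cases b' <;> first | rfl | exact absurd h1 (by decide)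
    · simp only [ix, Sum.elim_inl, Sum.elim_inr, Prod.mk.injEq] at h
      exact absurd h.2 Sum.inl_ne_inr
    · simp only [ix, Sum.elim_inl, Sum.elim_inr, Prod.mk.injEq] at h
      exact absurd h.2 Sum.inr_ne_inl
    · simp only [ix, Sum.elim_inr, Prod.mk.injEq, Sum.inr.injEq] at h
      obtain ⟨h1, rfl⟩ := h
      cases b <;> cases b' <;> first | rfl | exact absurd h1 (by decide)
  have hvK : vK = (K.subtype ∘ rK) ∘ ix := by
    funext s
    rcases s with ⟨b, i⟩ | ⟨b, j⟩ <;> cases b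
    · simp only [vK, ix, Sum.elim_inl, Function.comp_apply, cond_false, Submodule.coe_subtype, hrK0, hbK_inl]
    · simp only [vK, ix, Sum.elim_inl, Function.comp_apply, cond_true, Submodule.coe_subtype, hrK1, hbK_inl]
    · simp only [vK, ix, Sum.elim_inr, Function.comp_apply, cond_false, Submodule.coe_subtype, hrK0, hbK_inr]
    · simp only [vK, ix, Sum.elim_inr, Function.comp_apply, cond_true, Submodule.coe_subtype, hrK1, hbK_inr]
  have hliK : LinearIndependent ℝ vK := by
    rw [hvK]
    exact (rK.linearIndependent.map' K.subtype K.ker_subtype).comp ix hix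
  have hvKmem : ∀ s, vK s ∈ K := fun s ↦ by
    rw [hvK]
    exact (rK (ix s)).2
  have hNvK : ∀ s, N (vK s) = 0 := fun s ↦ (hKmem _).1 (hvKmem s)
  -- the `U`-part `(u_i, Iu_i)_i`; `N` maps it onto `±` the `f`-part
  let vU : Bool × Fin k → F := fun p ↦ bif p.1 then I (u p.2) else u p.2
  have hNvU : ∀ p : Bool × Fin k, N (vU p) = (bif p.1 then (-1 : ℝ) else 1) • vK (Sum.inl p) := by
    rintro ⟨b, i⟩
    cases b
    · simp [vU, vK, hu]
    · simp [vU, vK, hIN, hu]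
  have key : ∀ g : Bool × Fin k → ℝ, N (∑ p, g p • vU p) = 0 → ∀ p, g p = 0 := by
    intro g hg p
    rw [map_sum] at hg
    simp only [map_smul, hNvU, smul_smul] at hg
    have hli := Fintype.linearIndependent_iff.mp (hliK.comp Sum.inl Sum.inl_injective)
      (fun p ↦ g p * bif p.1 then (-1 : ℝ) else 1) hg p
    obtain ⟨b, i⟩ := p
    cases b <;> simpa using hli
  have hliU : LinearIndependent ℝ vU := by
    refine Fintype.linearIndependent_iff.mpr fun g hg ↦ key g ?_
    rw [hg, map_zero]
  have hdisj : Disjoint (Submodule.span ℝ (Set.range vK)) (Submodule.span ℝ (Set.range vU)) := by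
    rw [Submodule.disjoint_def]
    intro x hxK hxU
    have hNx : N x = 0 := by
      have hle : Submodule.span ℝ (Set.range vK) ≤ K := Submodule.span_le.mpr (by rintro _ ⟨s, rfl⟩; exact hvKmem s)
      exact (hKmem x).1 (hle hxK)
    rw [Submodule.mem_span_range_iff_exists_fun] at hxU
    obtain ⟨g, rfl⟩ := hxU
    have hg := key g hNx
    simp [hg]
  have hli : LinearIndependent ℝ (Sum.elim vK vU) :=
    linearIndependent_sum.mpr ⟨hliK, hliU, hdisj⟩
  -- counting: `dim K = 2(k + l)`, `dim Im N = 2k` (the `f`-part spans `Im N`), `dim F = dim K + dim Im N`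
  have hfinK : finrank ℝ K = 2 * (k + l) := by
    rw [finrank_eq_card_basis rK, Fintype.card_prod, Fintype.card_fin, Fintype.card_sum, Fintype.card_fin, Fintype.card_fin]
  have hspanR : Submodule.span ℝ (Set.range (vK ∘ Sum.inl)) = LinearMap.range (N : F →ₗ[ℝ] F) := by
    apply le_antisymm
    · refine Submodule.span_le.mpr ?_
      rintro _ ⟨⟨b, i⟩, rfl⟩
      cases b
      · exact ⟨u i, by simp [vK, hu]⟩
      · exact ⟨-(I (u i)), by simp [vK, hIN, hu]⟩
    · -- a vector of `Im N` is a complex combination of the `f_i`, i.e. a real combination of the `f_i, If_i`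
      have hcomb : ∀ c : Fin k → ℂ, (∑ i, ((c i).re • f i + (c i).im • I (f i))) ∈
          Submodule.span ℝ (Set.range (vK ∘ Sum.inl)) := fun c ↦
        Submodule.sum_mem _ fun i _ ↦ Submodule.add_mem _
          (Submodule.smul_mem _ _ (Submodule.subset_span ⟨(false, i), by simp [vK]⟩))
          (Submodule.smul_mem _ _ (Submodule.subset_span ⟨(true, i), by simp [vK]⟩))
      rintro x ⟨y, hy⟩
      have hxK : x ∈ K := by rw [← hy]; exact hRK y
      have hX : (⟨x, hxK⟩ : K) ∈ RK := ⟨y, hy⟩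
      have hrepr := bR.sum_repr ⟨⟨x, hxK⟩, hX⟩
      have h := congrArg (fun X : RK ↦ ((X : K) : F)) hrepr
      simp only at h
      have hx : (∑ i, (((bR.repr ⟨⟨x, hxK⟩, hX⟩ i).re • f i + (bR.repr ⟨⟨x, hxK⟩, hX⟩ i).im • I (f i)))) = x := by
        refine Eq.trans ?_ h
        rw [Submodule.coe_sum, Submodule.coe_sum]
        refine Finset.sum_congr rfl fun i _ ↦ ?_
        rw [Submodule.coe_smul, hsmulK, Submodule.coe_add, Submodule.coe_smul, Submodule.coe_smul, hIKv]
      exact hx ▸ hcomb _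
  have hfinR : finrank ℝ (LinearMap.range (N : F →ₗ[ℝ] F)) = 2 * k := by
    rw [← hspanR, finrank_span_eq_card (hliK.comp Sum.inl Sum.inl_injective), Fintype.card_prod, Fintype.card_bool,
      Fintype.card_fin]
  have hfinF : finrank ℝ F = 4 * k + 2 * l := by
    have h := LinearMap.finrank_range_add_finrank_ker (N : F →ₗ[ℝ] F)
    rw [hfinR] at h
    change 2 * k + finrank ℝ K = finrank ℝ F at h
    omega
  have hcard : Fintype.card (((Bool × Fin k) ⊕ (Bool × Fin l)) ⊕ (Bool × Fin k)) = finrank ℝ F := by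
    simp only [Fintype.card_sum, Fintype.card_prod, Fintype.card_bool, Fintype.card_fin]
    omega
  refine ⟨k, l, u, w, basisOfLinearIndependentOfCardEqFinrank' _ hli hcard, hwK, hfinF, hfinR, fun b i ↦ ?_,
    fun b j ↦ ?_, fun b i ↦ ?_⟩
  · cases b <;> simp [vK, hu]
  · cases b <;> simp [vK]
  · cases b <;> simp [vU]


/-! #### The blocks of a form of `Hdg_{S(I,N)}` in the normal-form basis -/

omit [FiniteDimensional ℝ F] in
/-- The evaluation map `Ω ↦ (Ω(x_a, y_b))_{ab}` (rectangular) is linear. [folklore] -/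
private theorem exists_evalMap' {m n : ℕ} (x : Fin m → F) (y : Fin n → F) :
    ∃ θ : (F [⋀^Fin 2]→L[ℝ] ℝ) →ₗ[ℝ] Matrix (Fin m) (Fin n) ℝ, ∀ Ω a b, θ Ω a b = Ω ![x a, y b] :=
  ⟨{ toFun := fun Ω ↦ of fun a b ↦ Ω ![x a, y b],
     map_add' := fun Ω Ω' ↦ by ext a b; simp,
     map_smul' := fun c Ω ↦ by ext a b; simp }, fun _ _ _ ↦ rfl⟩

/-- `C(m, 2) + C(m+1, 2) = m²` ("`l²`": one antisymmetric and one symmetric `l × l` block).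
[cite: Buskin2018GeneralizedTwistorLines, §3 (chunk p0013 L143–144)] -/
theorem choose_two_add_choose_two_succ (m : ℕ) : m.choose 2 + (m + 1).choose 2 = m ^ 2 := by
  induction m with
  | zero => simp
  | succ k ih =>
    rw [Nat.choose_succ_succ' (k + 1) 1, Nat.choose_one_right, Nat.choose_succ_succ' k 1, Nat.choose_one_right] at *
    nlinarith [ih]

omit [FiniteDimensional ℝ F] in
/-- `Ω(x, 0) = 0`. [folklore] -/
private theorem apply₂_zero_right' (Ω : F [⋀^Fin 2]→L[ℝ] W) (x : F) : Ω ![x, (0 : F)] = 0 := by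
  simpa using apply₂_smul_right Ω 0 x 0

omit [FiniteDimensional ℝ F] in
/-- `Ω(Nx, y) = 0` for `y ∈ Ker N` ("`A = 0, B = 0`"). [cite: Buskin2018GeneralizedTwistorLines, §3 (chunk p0013 L118)] -/
private theorem apply₂_N_left_eq_zero {N : F →L[ℝ] F} (Ω : F [⋀^Fin 2]→L[ℝ] W)
    (hΩN : ∀ v w, Ω ![N v, w] = -Ω ![v, N w]) (x : F) {y : F} (hy : N y = 0) : Ω ![N x, y] = 0 := by
  rw [hΩN, hy, apply₂_zero_right', neg_zero]

omit [FiniteDimensional ℝ F] in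
/-- `Ω(Nx, Iy) = 0` for `y ∈ Ker N`. [cite: Buskin2018GeneralizedTwistorLines, §3 (chunk p0013 L118)] -/
private theorem apply₂_N_left_I_eq_zero {I N : F →L[ℝ] F} (hIN : ∀ v, N (I v) = -I (N v)) (Ω : F [⋀^Fin 2]→L[ℝ] W)
    (hΩN : ∀ v w, Ω ![N v, w] = -Ω ![v, N w]) (x : F) {y : F} (hy : N y = 0) : Ω ![N x, I y] = 0 := by
  rw [hΩN, hIN, hy, map_zero, neg_zero, apply₂_zero_right', neg_zero]

omit [FiniteDimensional ℝ F] in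
/-- `Ω(Nx, y) = Ω(Ny, x)` ("`C = Cᵗ`"). [cite: Buskin2018GeneralizedTwistorLines, §3 (chunk p0013 L118)] -/
private theorem apply₂_N_left_comm {N : F →L[ℝ] F} (Ω : F [⋀^Fin 2]→L[ℝ] W) (hΩN : ∀ v w, Ω ![N v, w] = -Ω ![v, N w])
    (x y : F) : Ω ![N x, y] = Ω ![N y, x] := by
  rw [hΩN, apply₂_swap Ω (N y) x, neg_neg]

omit [FiniteDimensional ℝ F] in
/-- `Ω(Nx, Iy) = Ω(Ny, Ix)`. [cite: Buskin2018GeneralizedTwistorLines, §3 (chunk p0013 L139: "C is a symmetric 2k×2k-matrix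
anticommuting with I₁")] -/
private theorem apply₂_N_left_I_comm {I N : F →L[ℝ] F} (hI : ∀ v, I (I v) = -v) (hIN : ∀ v, N (I v) = -I (N v))
    (Ω : F [⋀^Fin 2]→L[ℝ] W) (hΩI : ∀ v w, Ω ![I v, I w] = Ω ![v, w]) (hΩN : ∀ v w, Ω ![N v, w] = -Ω ![v, N w])
    (x y : F) : Ω ![N x, I y] = Ω ![N y, I x] := by
  rw [hΩN, hIN, apply₂_neg_right, neg_neg, apply₂_map_right_comm hI Ω hΩI x (N y)]

set_option maxHeartbeats 800000 in
open Literature.LinearAlgebra.Matrix in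
/-- **The count for a line of type `ℍ(0)`, in the normal-form basis** ("Next, let `Q = (A B C; −Bᵗ D E; −Cᵗ −Eᵗ F)` …
`QN = −NᵗQ` holds precisely when `A = 0, B = 0, C = Cᵗ` … so that `C` is a symmetric `2k × 2k`-matrix anticommuting with
`I₁`, `D` is a skew-symmetric `2l × 2l`-matrix commuting with `I₂`, `F` is a skew-symmetric `2k × 2k`-matrix commuting
with `I₁` and `E` is a `2l × 2k`-matrix satisfying `I₂E = −EI₁`. The vector spaces of such `C, D` and `F` have the
respective dimensions `k² + k, l²` and `k²` … the dimension of such `E`'s is equal `2kl`"): in the basis of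
`exists_nilAdapted_basis` the space of `2`-covectors of type `(1,1)` for `I` with `N` `Ω`-skew is linearly isomorphic to
`Sym_k × Sym_k × (so_l × Sym_l) × (so_k × Sym_k) × Mat_{l×k} × Mat_{l×k}` through the blocks `Ω(Nu_a, u_b)`, `Ω(Nu_a, Iu_b)`
(`C`), `Ω(w_a, w_b)`, `Ω(w_a, Iw_b)` (`D`), `Ω(u_a, u_b)`, `Ω(u_a, Iu_b)` (`F`), `Ω(w_a, u_b)`, `Ω(w_a, Iu_b)` (`E`), hence
has dimension `k(k+1) + (k+l)²`. [cite: Buskin2018GeneralizedTwistorLines, Thm. 1.2 (chunk p0005 L45–47) with proof §3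
"Case of S(I,N)" (chunk p0013 L43–159)] -/
theorem finrank_eq_of_nilAdapted_basis {I N : F →L[ℝ] F} (hI : ∀ v, I (I v) = -v) (hN : ∀ v, N (N v) = 0)
    (hIN : ∀ v, N (I v) = -I (N v)) {k l : ℕ} {u : Fin k → F} {w : Fin l → F} (hw : ∀ j, N (w j) = 0)
    (r : Basis (((Bool × Fin k) ⊕ (Bool × Fin l)) ⊕ (Bool × Fin k)) ℝ F)
    (hr₁ : ∀ b i, r (Sum.inl (Sum.inl (b, i))) = bif b then I (N (u i)) else N (u i))
    (hr₂ : ∀ b j, r (Sum.inl (Sum.inr (b, j))) = bif b then I (w j) else w j)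
    (hr₃ : ∀ b i, r (Sum.inr (b, i)) = bif b then I (u i) else u i) (S : Submodule ℝ (F [⋀^Fin 2]→L[ℝ] ℝ))
    (hS : ∀ Ω, Ω ∈ S ↔ (∀ v w, Ω ![I v, I w] = Ω ![v, w]) ∧ ∀ v w, Ω ![N v, w] = -Ω ![v, N w]) :
    finrank ℝ S = k * (k + 1) + (k + l) ^ 2 := by
  classical
  -- the eight evaluation maps
  obtain ⟨θ1, hθ1⟩ := exists_evalMap (F := F) (fun a ↦ N (u a)) u
  obtain ⟨θ2, hθ2⟩ := exists_evalMap (F := F) (fun a ↦ N (u a)) (fun b ↦ I (u b))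
  obtain ⟨θ3, hθ3⟩ := exists_evalMap (F := F) w w
  obtain ⟨θ4, hθ4⟩ := exists_evalMap (F := F) w (fun b ↦ I (w b))
  obtain ⟨θ5, hθ5⟩ := exists_evalMap (F := F) u u
  obtain ⟨θ6, hθ6⟩ := exists_evalMap (F := F) u (fun b ↦ I (u b))
  obtain ⟨θ7, hθ7⟩ := exists_evalMap' (F := F) w u
  obtain ⟨θ8, hθ8⟩ := exists_evalMap' (F := F) w (fun b ↦ I (u b))
  -- memberships
  have mem1 : ∀ Ω : S, θ1 (Ω : F [⋀^Fin 2]→L[ℝ] ℝ) ∈ selfAdjointMatricesSubmodule (1 : Matrix (Fin k) (Fin k) ℝ) := by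
    intro Ω
    rw [mem_selfAdjointMatricesSubmodule_one_iff]
    ext a b
    rw [transpose_apply, hθ1, hθ1]
    exact apply₂_N_left_comm _ ((hS _).1 Ω.2).2 (u b) (u a)
  have mem2 : ∀ Ω : S, θ2 (Ω : F [⋀^Fin 2]→L[ℝ] ℝ) ∈ selfAdjointMatricesSubmodule (1 : Matrix (Fin k) (Fin k) ℝ) := by
    intro Ω
    rw [mem_selfAdjointMatricesSubmodule_one_iff]
    ext a b
    rw [transpose_apply, hθ2, hθ2]
    exact apply₂_N_left_I_comm hI hIN _ ((hS _).1 Ω.2).1 ((hS _).1 Ω.2).2 (u b) (u a)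
  have mem3 : ∀ Ω : S, θ3 (Ω : F [⋀^Fin 2]→L[ℝ] ℝ) ∈ skewAdjointMatricesSubmodule (1 : Matrix (Fin l) (Fin l) ℝ) := by
    intro Ω
    rw [mem_skewAdjointMatricesSubmodule_one_iff']
    ext a b
    rw [transpose_apply, neg_apply, hθ3, hθ3]
    exact apply₂_swap _ _ _
  have mem4 : ∀ Ω : S, θ4 (Ω : F [⋀^Fin 2]→L[ℝ] ℝ) ∈ selfAdjointMatricesSubmodule (1 : Matrix (Fin l) (Fin l) ℝ) := by
    intro Ω
    rw [mem_selfAdjointMatricesSubmodule_one_iff]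
    ext a b
    rw [transpose_apply, hθ4, hθ4]
    exact apply₂_map_right_comm hI _ ((hS _).1 Ω.2).1 (w b) (w a)
  have mem5 : ∀ Ω : S, θ5 (Ω : F [⋀^Fin 2]→L[ℝ] ℝ) ∈ skewAdjointMatricesSubmodule (1 : Matrix (Fin k) (Fin k) ℝ) := by
    intro Ω
    rw [mem_skewAdjointMatricesSubmodule_one_iff']
    ext a b
    rw [transpose_apply, neg_apply, hθ5, hθ5]
    exact apply₂_swap _ _ _
  have mem6 : ∀ Ω : S, θ6 (Ω : F [⋀^Fin 2]→L[ℝ] ℝ) ∈ selfAdjointMatricesSubmodule (1 : Matrix (Fin k) (Fin k) ℝ) := by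
    intro Ω
    rw [mem_selfAdjointMatricesSubmodule_one_iff]
    ext a b
    rw [transpose_apply, hθ6, hθ6]
    exact apply₂_map_right_comm hI _ ((hS _).1 Ω.2).1 (u b) (u a)
  -- the forward map
  obtain ⟨Θ, hΘ⟩ : ∃ Θ : S →ₗ[ℝ] (selfAdjointMatricesSubmodule (1 : Matrix (Fin k) (Fin k) ℝ) ×
      selfAdjointMatricesSubmodule (1 : Matrix (Fin k) (Fin k) ℝ) × skewAdjointMatricesSubmodule (1 : Matrix (Fin l) (Fin l) ℝ) ×
        selfAdjointMatricesSubmodule (1 : Matrix (Fin l) (Fin l) ℝ) × skewAdjointMatricesSubmodule (1 : Matrix (Fin k) (Fin k) ℝ) ×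
          selfAdjointMatricesSubmodule (1 : Matrix (Fin k) (Fin k) ℝ) × Matrix (Fin l) (Fin k) ℝ × Matrix (Fin l) (Fin k) ℝ),
      ∀ Ω : S, ((Θ Ω).1 : Matrix (Fin k) (Fin k) ℝ) = θ1 (Ω : F [⋀^Fin 2]→L[ℝ] ℝ) ∧
        ((Θ Ω).2.1 : Matrix (Fin k) (Fin k) ℝ) = θ2 (Ω : F [⋀^Fin 2]→L[ℝ] ℝ) ∧
        ((Θ Ω).2.2.1 : Matrix (Fin l) (Fin l) ℝ) = θ3 (Ω : F [⋀^Fin 2]→L[ℝ] ℝ) ∧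
        ((Θ Ω).2.2.2.1 : Matrix (Fin l) (Fin l) ℝ) = θ4 (Ω : F [⋀^Fin 2]→L[ℝ] ℝ) ∧
        ((Θ Ω).2.2.2.2.1 : Matrix (Fin k) (Fin k) ℝ) = θ5 (Ω : F [⋀^Fin 2]→L[ℝ] ℝ) ∧
        ((Θ Ω).2.2.2.2.2.1 : Matrix (Fin k) (Fin k) ℝ) = θ6 (Ω : F [⋀^Fin 2]→L[ℝ] ℝ) ∧
        (Θ Ω).2.2.2.2.2.2.1 = θ7 (Ω : F [⋀^Fin 2]→L[ℝ] ℝ) ∧ (Θ Ω).2.2.2.2.2.2.2 = θ8 (Ω : F [⋀^Fin 2]→L[ℝ] ℝ) :=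
    ⟨LinearMap.prod (LinearMap.codRestrict _ (θ1.comp S.subtype) mem1)
      (LinearMap.prod (LinearMap.codRestrict _ (θ2.comp S.subtype) mem2)
        (LinearMap.prod (LinearMap.codRestrict _ (θ3.comp S.subtype) mem3)
          (LinearMap.prod (LinearMap.codRestrict _ (θ4.comp S.subtype) mem4)
            (LinearMap.prod (LinearMap.codRestrict _ (θ5.comp S.subtype) mem5)
              (LinearMap.prod (LinearMap.codRestrict _ (θ6.comp S.subtype) mem6)
                (LinearMap.prod (θ7.comp S.subtype) (θ8.comp S.subtype))))))),
      fun Ω ↦ ⟨rfl, rfl, rfl, rfl, rfl, rfl, rfl, rfl⟩⟩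
  -- the basis vectors spelled out
  have rf0 : ∀ a, r (Sum.inl (Sum.inl (false, a))) = N (u a) := fun a ↦ by rw [hr₁]; rfl
  have rf1 : ∀ a, r (Sum.inl (Sum.inl (true, a))) = I (N (u a)) := fun a ↦ by rw [hr₁]; rfl
  have rw0 : ∀ a, r (Sum.inl (Sum.inr (false, a))) = w a := fun a ↦ by rw [hr₂]; rfl
  have rw1 : ∀ a, r (Sum.inl (Sum.inr (true, a))) = I (w a) := fun a ↦ by rw [hr₂]; rfl
  have ru0 : ∀ a, r (Sum.inr (false, a)) = u a := fun a ↦ by rw [hr₃]; rfl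
  have ru1 : ∀ a, r (Sum.inr (true, a)) = I (u a) := fun a ↦ by rw [hr₃]; rfl
  have hNf : ∀ a, N (N (u a)) = 0 := fun a ↦ hN _
  -- injectivity: every entry of the Gram matrix is `±` an entry of one of the eight blocks, or zero
  have hker : ∀ Ω : S, Θ Ω = 0 → Ω = 0 := by
    intro Ω hΩ
    obtain ⟨hΩI, hΩN⟩ := (hS Ω).1 Ω.2
    obtain ⟨q1, q2, q3, q4, q5, q6, q7, q8⟩ := hΘ Ω
    rw [hΩ] at q1 q2 q3 q4 q5 q6 q7 q8
    have h1 : ∀ a b, (Ω : F [⋀^Fin 2]→L[ℝ] ℝ) ![N (u a), u b] = 0 := fun a b ↦ by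
      rw [← hθ1 (Ω : F [⋀^Fin 2]→L[ℝ] ℝ) a b, ← q1]; rfl
    have h2 : ∀ a b, (Ω : F [⋀^Fin 2]→L[ℝ] ℝ) ![N (u a), I (u b)] = 0 := fun a b ↦ by
      rw [← hθ2 (Ω : F [⋀^Fin 2]→L[ℝ] ℝ) a b, ← q2]; rfl
    have h3 : ∀ a b, (Ω : F [⋀^Fin 2]→L[ℝ] ℝ) ![w a, w b] = 0 := fun a b ↦ by
      rw [← hθ3 (Ω : F [⋀^Fin 2]→L[ℝ] ℝ) a b, ← q3]; rfl
    have h4 : ∀ a b, (Ω : F [⋀^Fin 2]→L[ℝ] ℝ) ![w a, I (w b)] = 0 := fun a b ↦ by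
      rw [← hθ4 (Ω : F [⋀^Fin 2]→L[ℝ] ℝ) a b, ← q4]; rfl
    have h5 : ∀ a b, (Ω : F [⋀^Fin 2]→L[ℝ] ℝ) ![u a, u b] = 0 := fun a b ↦ by
      rw [← hθ5 (Ω : F [⋀^Fin 2]→L[ℝ] ℝ) a b, ← q5]; rfl
    have h6 : ∀ a b, (Ω : F [⋀^Fin 2]→L[ℝ] ℝ) ![u a, I (u b)] = 0 := fun a b ↦ by
      rw [← hθ6 (Ω : F [⋀^Fin 2]→L[ℝ] ℝ) a b, ← q6]; rfl
    have h7 : ∀ a b, (Ω : F [⋀^Fin 2]→L[ℝ] ℝ) ![w a, u b] = 0 := fun a b ↦ by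
      rw [← hθ7 (Ω : F [⋀^Fin 2]→L[ℝ] ℝ) a b, ← q7]; rfl
    have h8 : ∀ a b, (Ω : F [⋀^Fin 2]→L[ℝ] ℝ) ![w a, I (u b)] = 0 := fun a b ↦ by
      rw [← hθ8 (Ω : F [⋀^Fin 2]→L[ℝ] ℝ) a b, ← q8]; rfl
    -- the remaining entries
    have z1 : ∀ a b, (Ω : F [⋀^Fin 2]→L[ℝ] ℝ) ![N (u a), N (u b)] = 0 := fun a b ↦
      apply₂_N_left_eq_zero _ hΩN _ (hNf b)
    have z2 : ∀ a b, (Ω : F [⋀^Fin 2]→L[ℝ] ℝ) ![N (u a), I (N (u b))] = 0 := fun a b ↦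
      apply₂_N_left_I_eq_zero hIN _ hΩN _ (hNf b)
    have z3 : ∀ a b, (Ω : F [⋀^Fin 2]→L[ℝ] ℝ) ![N (u a), w b] = 0 := fun a b ↦ apply₂_N_left_eq_zero _ hΩN _ (hw b)
    have z4 : ∀ a b, (Ω : F [⋀^Fin 2]→L[ℝ] ℝ) ![N (u a), I (w b)] = 0 := fun a b ↦
      apply₂_N_left_I_eq_zero hIN _ hΩN _ (hw b)
    have z5 : ∀ a b, (Ω : F [⋀^Fin 2]→L[ℝ] ℝ) ![w a, N (u b)] = 0 := fun a b ↦ by rw [apply₂_swap, z3, neg_zero]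
    have z6 : ∀ a b, (Ω : F [⋀^Fin 2]→L[ℝ] ℝ) ![w a, I (N (u b))] = 0 := fun a b ↦ by
      rw [apply₂_map_right_comm hI _ hΩI, z4]
    have z7 : ∀ a b, (Ω : F [⋀^Fin 2]→L[ℝ] ℝ) ![u a, N (u b)] = 0 := fun a b ↦ by rw [apply₂_swap, h1, neg_zero]
    have z8 : ∀ a b, (Ω : F [⋀^Fin 2]→L[ℝ] ℝ) ![u a, I (N (u b))] = 0 := fun a b ↦ by
      rw [apply₂_map_right_comm hI _ hΩI, h2]
    have z9 : ∀ a b, (Ω : F [⋀^Fin 2]→L[ℝ] ℝ) ![u a, w b] = 0 := fun a b ↦ by rw [apply₂_swap, h7, neg_zero]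
    have z10 : ∀ a b, (Ω : F [⋀^Fin 2]→L[ℝ] ℝ) ![u a, I (w b)] = 0 := fun a b ↦ by
      rw [apply₂_map_right_comm hI _ hΩI, h8]
    have mvI : ∀ x y, (Ω : F [⋀^Fin 2]→L[ℝ] ℝ) ![I x, y] = -(Ω : F [⋀^Fin 2]→L[ℝ] ℝ) ![x, I y] :=
      apply₂_map_left hI _ hΩI
    apply Subtype.ext
    refine eq_zero_of_apply₂_basis r _ fun s t ↦ ?_
    rcases s with (⟨β, a⟩ | ⟨β, a⟩) | ⟨β, a⟩ <;> rcases t with (⟨γ, b⟩ | ⟨γ, b⟩) | ⟨γ, b⟩ <;> cases β <;> cases γ <;>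
      simp [rf0, rf1, rw0, rw1, ru0, ru1, mvI, hI, apply₂_neg_right, h1, h2, h3, h4, h5, h6, h7, h8, z1, z2, z3, z4,
        z5, z6, z7, z8, z9, z10]
  have hinj : Function.Injective Θ := by
    intro Ω Ω' h
    have h0 : Θ (Ω - Ω') = 0 := by rw [map_sub Θ Ω Ω', h, sub_self]
    exact sub_eq_zero.mp (hker _ h0)
  -- surjectivity: the Gram matrix with prescribed blocks
  have hsurj : Function.Surjective Θ := by
    rintro ⟨⟨C1, hC1⟩, ⟨C2, hC2⟩, ⟨D1, hD1⟩, ⟨D2, hD2⟩, ⟨F1, hF1⟩, ⟨F2, hF2⟩, E1, E2⟩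
    have hC1' := hC1; have hC2' := hC2; have hD1' := hD1; have hD2' := hD2; have hF1' := hF1; have hF2' := hF2
    rw [mem_selfAdjointMatricesSubmodule_one_iff] at hC1' hC2' hD2' hF2'
    rw [mem_skewAdjointMatricesSubmodule_one_iff'] at hD1' hF1'
    have eC1 : ∀ a b, C1 b a = C1 a b := fun a b ↦ by have := congrFun (congrFun hC1' a) b; simpa using this
    have eC2 : ∀ a b, C2 b a = C2 a b := fun a b ↦ by have := congrFun (congrFun hC2' a) b; simpa using this
    have eD1 : ∀ a b, D1 b a = -D1 a b := fun a b ↦ by have := congrFun (congrFun hD1' a) b; simpa using this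
    have eD2 : ∀ a b, D2 b a = D2 a b := fun a b ↦ by have := congrFun (congrFun hD2' a) b; simpa using this
    have eF1 : ∀ a b, F1 b a = -F1 a b := fun a b ↦ by have := congrFun (congrFun hF1' a) b; simpa using this
    have eF2 : ∀ a b, F2 b a = F2 a b := fun a b ↦ by have := congrFun (congrFun hF2' a) b; simpa using this
    -- base tables `P⁰(g_a, h_b) = Ω(g_a, h_b)` and `P¹(g_a, h_b) = Ω(g_a, I h_b)` on the groups `f, w, u`
    let P0 : ((Bool × Fin k) ⊕ (Bool × Fin l)) ⊕ (Bool × Fin k) → ((Bool × Fin k) ⊕ (Bool × Fin l)) ⊕ (Bool × Fin k) → ℝ :=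
      fun s t ↦ match s, t with
        | Sum.inl (Sum.inl _), Sum.inl _ => 0
        | Sum.inl (Sum.inl (_, a)), Sum.inr (_, b) => C1 a b
        | Sum.inl (Sum.inr _), Sum.inl (Sum.inl _) => 0
        | Sum.inl (Sum.inr (_, a)), Sum.inl (Sum.inr (_, b)) => D1 a b
        | Sum.inl (Sum.inr (_, a)), Sum.inr (_, b) => E1 a b
        | Sum.inr (_, a), Sum.inl (Sum.inl (_, b)) => -C1 b a
        | Sum.inr (_, a), Sum.inl (Sum.inr (_, b)) => -E1 b a
        | Sum.inr (_, a), Sum.inr (_, b) => F1 a b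
    let P1 : ((Bool × Fin k) ⊕ (Bool × Fin l)) ⊕ (Bool × Fin k) → ((Bool × Fin k) ⊕ (Bool × Fin l)) ⊕ (Bool × Fin k) → ℝ :=
      fun s t ↦ match s, t with
        | Sum.inl (Sum.inl _), Sum.inl _ => 0
        | Sum.inl (Sum.inl (_, a)), Sum.inr (_, b) => C2 a b
        | Sum.inl (Sum.inr _), Sum.inl (Sum.inl _) => 0
        | Sum.inl (Sum.inr (_, a)), Sum.inl (Sum.inr (_, b)) => D2 a b
        | Sum.inl (Sum.inr (_, a)), Sum.inr (_, b) => E2 a b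
        | Sum.inr (_, a), Sum.inl (Sum.inl (_, b)) => C2 b a
        | Sum.inr (_, a), Sum.inl (Sum.inr (_, b)) => E2 b a
        | Sum.inr (_, a), Sum.inr (_, b) => F2 a b
    -- the `I`-exponent of a basis index
    let deg : ((Bool × Fin k) ⊕ (Bool × Fin l)) ⊕ (Bool × Fin k) → Bool :=
      fun s ↦ match s with
        | Sum.inl (Sum.inl (β, _)) => β
        | Sum.inl (Sum.inr (β, _)) => β
        | Sum.inr (β, _) => β
    obtain ⟨M, hM⟩ : ∃ M : Matrix (((Bool × Fin k) ⊕ (Bool × Fin l)) ⊕ (Bool × Fin k))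
        (((Bool × Fin k) ⊕ (Bool × Fin l)) ⊕ (Bool × Fin k)) ℝ, ∀ s t, M s t =
        (bif deg s then (bif deg t then P0 s t else -P1 s t) else (bif deg t then P1 s t else P0 s t)) :=
      ⟨of fun s t ↦ _, fun s t ↦ rfl⟩
    have hMskew : ∀ s t, M t s = -M s t := by
      rintro ((⟨β, a⟩ | ⟨β, a⟩) | ⟨β, a⟩) ((⟨γ, b⟩ | ⟨γ, b⟩) | ⟨γ, b⟩)
      · cases β <;> cases γ <;> simp [hM, deg, P0, P1]
      · cases β <;> cases γ <;> simp [hM, deg, P0, P1]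
      · cases β <;> cases γ <;> simp [hM, deg, P0, P1]
      · cases β <;> cases γ <;> simp [hM, deg, P0, P1]
      · cases β <;> cases γ <;> simp [hM, deg, P0, P1, eD1 a b, eD2 a b]
      · cases β <;> cases γ <;> simp [hM, deg, P0, P1]
      · cases β <;> cases γ <;> simp [hM, deg, P0, P1]
      · cases β <;> cases γ <;> simp [hM, deg, P0, P1]
      · cases β <;> cases γ <;> simp [hM, deg, P0, P1, eF1 a b, eF2 a b]
    set B := Matrix.toBilin r M with hB_def
    have hB : ∀ s t, B (r s) (r t) = M s t := toBilin_apply_basis r M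
    have hBskew : ∀ v w, B w v = -B v w := by
      intro v w
      have h : B.flip = -B := LinearMap.BilinForm.ext_basis r fun i j ↦ by
        rw [LinearMap.BilinForm.flip_apply, hB, hMskew, LinearMap.neg_apply, LinearMap.neg_apply, hB]
      have := LinearMap.congr_fun₂ h v w
      simpa using this
    obtain ⟨Ω, hΩ⟩ := exists_twoCovector_of_bilin B
    have hΩB : ∀ v w, Ω ![v, w] = B v w := fun v w ↦ by rw [hΩ, hBskew v w]; ring
    have hΩr : ∀ s t, Ω ![r s, r t] = M s t := fun s t ↦ by rw [hΩB, hB]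
    -- how `I` and `N` act on the basis
    have hIr : ∀ s, I (r s) = match s with
        | Sum.inl (Sum.inl (β, a)) => bif β then -r (Sum.inl (Sum.inl (false, a))) else r (Sum.inl (Sum.inl (true, a)))
        | Sum.inl (Sum.inr (β, a)) => bif β then -r (Sum.inl (Sum.inr (false, a))) else r (Sum.inl (Sum.inr (true, a)))
        | Sum.inr (β, a) => bif β then -r (Sum.inr (false, a)) else r (Sum.inr (true, a)) := by
      rintro ((⟨β, a⟩ | ⟨β, a⟩) | ⟨β, a⟩) <;> cases β <;> simp [rf0, rf1, rw0, rw1, ru0, ru1, hI]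
    have hNr : ∀ s, N (r s) = match s with
        | Sum.inl (Sum.inl _) => 0
        | Sum.inl (Sum.inr _) => 0
        | Sum.inr (β, a) => bif β then -r (Sum.inl (Sum.inl (true, a))) else r (Sum.inl (Sum.inl (false, a))) := by
      rintro ((⟨β, a⟩ | ⟨β, a⟩) | ⟨β, a⟩) <;> cases β <;> simp [rf0, rf1, rw0, rw1, ru0, ru1, hNf, hIN, hw]
    have hΩI : ∀ v w, Ω ![I v, I w] = Ω ![v, w] := by
      have h : B.comp (I : F →ₗ[ℝ] F) (I : F →ₗ[ℝ] F) = B := LinearMap.BilinForm.ext_basis r fun s t ↦ by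
        rw [LinearMap.BilinForm.comp_apply]
        simp only [ContinuousLinearMap.coe_coe, hIr]
        rcases s with (⟨β, a⟩ | ⟨β, a⟩) | ⟨β, a⟩ <;> rcases t with (⟨γ, b⟩ | ⟨γ, b⟩) | ⟨γ, b⟩ <;> cases β <;> cases γ <;>
          simp [hB, hM, deg, P0, P1]
      intro v w
      have := LinearMap.congr_fun₂ h v w
      rw [LinearMap.BilinForm.comp_apply] at this
      rw [hΩB, hΩB]
      exact this
    have hΩN : ∀ v w, Ω ![N v, w] = -Ω ![v, N w] := by
      have h : B.compLeft (N : F →ₗ[ℝ] F) = -B.compRight (N : F →ₗ[ℝ] F) := LinearMap.BilinForm.ext_basis r fun s t ↦ by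
        rw [LinearMap.BilinForm.compLeft_apply, LinearMap.neg_apply, LinearMap.neg_apply, LinearMap.BilinForm.compRight_apply]
        simp only [ContinuousLinearMap.coe_coe, hNr]
        rcases s with (⟨β, a⟩ | ⟨β, a⟩) | ⟨β, a⟩ <;> rcases t with (⟨γ, b⟩ | ⟨γ, b⟩) | ⟨γ, b⟩
        · cases β <;> cases γ <;> simp
        · cases β <;> cases γ <;> simp
        · cases β <;> cases γ <;> simp [hB, hM, deg, P0, P1]
        · cases β <;> cases γ <;> simp
        · cases β <;> cases γ <;> simp
        · cases β <;> cases γ <;> simp [hB, hM, deg, P0, P1]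
        · cases β <;> cases γ <;> simp [hB, hM, deg, P0, P1]
        · cases β <;> cases γ <;> simp [hB, hM, deg, P0, P1]
        · cases β <;> cases γ <;> simp [hB, hM, deg, P0, P1, eC1 a b, eC2 a b]
      intro v w
      have := LinearMap.congr_fun₂ h v w
      rw [LinearMap.BilinForm.compLeft_apply, LinearMap.neg_apply, LinearMap.neg_apply,
        LinearMap.BilinForm.compRight_apply] at this
      rw [hΩB, hΩB]
      exact this
    have hΩS : Ω ∈ S := (hS Ω).2 ⟨hΩI, hΩN⟩
    refine ⟨⟨Ω, hΩS⟩, ?_⟩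
    obtain ⟨q1, q2, q3, q4, q5, q6, q7, q8⟩ := hΘ ⟨Ω, hΩS⟩
    ext a b
    · rw [q1, hθ1, ← rf0, ← ru0, hΩr, hM]; simp [deg, P0]
    · rw [q2, hθ2, ← rf0, ← ru1, hΩr, hM]; simp [deg, P1]
    · rw [q3, hθ3, ← rw0, ← rw0, hΩr, hM]; simp [deg, P0]
    · rw [q4, hθ4, ← rw0, ← rw1, hΩr, hM]; simp [deg, P1]
    · rw [q5, hθ5, ← ru0, ← ru0, hΩr, hM]; simp [deg, P0]
    · rw [q6, hθ6, ← ru0, ← ru1, hΩr, hM]; simp [deg, P1]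
    · rw [q7, hθ7, ← rw0, ← ru0, hΩr, hM]; simp [deg, P0]
    · rw [q8, hθ8, ← rw0, ← ru1, hΩr, hM]; simp [deg, P1]
  rw [LinearEquiv.finrank_eq (LinearEquiv.ofBijective Θ ⟨hinj, hsurj⟩)]
  simp only [Module.finrank_prod, finrank_skewAdjointMatricesSubmodule_one, finrank_selfAdjointMatricesSubmodule_one,
    Module.finrank_matrix, Fintype.card_fin, Module.finrank_self, mul_one]
  have hk := choose_two_add_three_mul_choose_two k
  have hl := choose_two_add_choose_two_succ l
  linear_combination hk + hl

/-- **Theorem 1.2 (`ℍ(0)`): `dim Hdg_S = k(k+1) + (2n−k)²`.** For `I² = −1`, `N² = 0`, `NI = −IN` on a real space of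
dimension `4n` with `dim_ℝ Im N = 2k` ("for the respective parameter `k`"), the space of real `2`-covectors of type `(1,1)`
for `I` with `N` `Ω`-skew — i.e. (`forall_nilLine_apply₂_eq_iff`) of type `(1,1)` along the line `S(I, N)` — has dimension
`k(k+1) + (2n−k)²`. ("For any non-compact twistor line `S` of the type `ℍ(0)` we have `dim Hdg_S = k(k+1) + (2n−k)²`, for the
respective parameter `k`".) [cite: Buskin2018GeneralizedTwistorLines, Thm. 1.2 (chunk p0005 L45–47)] -/
theorem finrank_eq_of_forall_mem_iff_nil {n k : ℕ} (hF : finrank ℝ F = 4 * n) {I N : F →L[ℝ] F}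
    (hI : ∀ v, I (I v) = -v) (hN : ∀ v, N (N v) = 0) (hIN : ∀ v, N (I v) = -I (N v))
    (hk : finrank ℝ (LinearMap.range (N : F →ₗ[ℝ] F)) = 2 * k) (S : Submodule ℝ (F [⋀^Fin 2]→L[ℝ] ℝ))
    (hS : ∀ Ω, Ω ∈ S ↔ (∀ v w, Ω ![I v, I w] = Ω ![v, w]) ∧ ∀ v w, Ω ![N v, w] = -Ω ![v, N w]) :
    finrank ℝ S = k * (k + 1) + (2 * n - k) ^ 2 := by
  obtain ⟨k', l, u, w, r, hw, hF', hk', hr₁, hr₂, hr₃⟩ := exists_nilAdapted_basis I N hI hN hIN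
  have hkk : k' = k := by omega
  subst k'
  have hl : k + l = 2 * n - k := by omega
  rw [finrank_eq_of_nilAdapted_basis hI hN hIN hw r hr₁ hr₂ hr₃ S hS, hl]

/-- **Theorem 1.2 (`ℍ(0)`) with `Hdg_S` as printed**: `λᵗΩλ = Ω` for all `λ = ±(I + aN + bIN)`, `a, b ∈ ℝ` — the two
components of `S(I, N)` — cuts out a space of dimension `k(k+1) + (2n−k)²` (`dim_ℝ V_ℝ = 4n`, `dim_ℝ Im N = 2k`).
[cite: Buskin2018GeneralizedTwistorLines, Thm. 1.2 (chunk p0005 L45–47) with the definition of `Hdg_S` (chunk p0005 L1–4)] -/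
theorem finrank_eq_of_forall_mem_iff_nilLine {n k : ℕ} (hF : finrank ℝ F = 4 * n) {I N : F →L[ℝ] F}
    (hI : ∀ v, I (I v) = -v) (hN : ∀ v, N (N v) = 0) (hIN : ∀ v, N (I v) = -I (N v))
    (hk : finrank ℝ (LinearMap.range (N : F →ₗ[ℝ] F)) = 2 * k) (S : Submodule ℝ (F [⋀^Fin 2]→L[ℝ] ℝ))
    (hS : ∀ Ω, Ω ∈ S ↔ ∀ x a b : ℝ, x ^ 2 = 1 →
      ∀ v w, Ω ![(x • I + a • N + b • I.comp N) v, (x • I + a • N + b • I.comp N) w] = Ω ![v, w]) :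
    finrank ℝ S = k * (k + 1) + (2 * n - k) ^ 2 :=
  finrank_eq_of_forall_mem_iff_nil hF hI hN hIN hk S fun Ω ↦ (hS Ω).trans (forall_nilLine_apply₂_eq_iff hI hN hIN Ω)

/-- **"There are `n` non-equivalent faithful representations `ℍ(0) → End V_ℝ` parametrized by integers `1 ≤ k ≤ n`,
equivalently, there are `n` distinct `GL(V_ℝ)`-orbits of lines of the type `ℍ(0)`"** — the uniqueness half: two pairs
`(I₁, N₁)`, `(I₂, N₂)` (`I² = −1`, `N² = 0`, `NI = −IN`) on the same finite-dimensional space with `dim Im N₁ = dim Im N₂`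
are conjugate by a linear automorphism (map one normal-form basis of `exists_nilAdapted_basis` to the other: the
parameters agree, `k₁ = k₂` by hypothesis and then `l₁ = l₂` from `4k + 2l = dim V_ℝ`). (`dim Im N` is obviously an
invariant, so the orbits are classified by `k = dim_ℝ Im N / 2 ∈ {1, …, n}` for `N ≠ 0`.)
[cite: Buskin2018GeneralizedTwistorLines, Thm. 1.2 (chunk p0005 L40–43) with §3 (chunk p0013 L37–41)] -/
theorem exists_conj_of_nilPair {I₁ N₁ I₂ N₂ : F →L[ℝ] F} (hI₁ : ∀ v, I₁ (I₁ v) = -v) (hN₁ : ∀ v, N₁ (N₁ v) = 0)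
    (hIN₁ : ∀ v, N₁ (I₁ v) = -I₁ (N₁ v)) (hI₂ : ∀ v, I₂ (I₂ v) = -v) (hN₂ : ∀ v, N₂ (N₂ v) = 0)
    (hIN₂ : ∀ v, N₂ (I₂ v) = -I₂ (N₂ v))
    (hrk : finrank ℝ (LinearMap.range (N₁ : F →ₗ[ℝ] F)) = finrank ℝ (LinearMap.range (N₂ : F →ₗ[ℝ] F))) :
    ∃ g : F ≃L[ℝ] F, (∀ v, g (I₁ v) = I₂ (g v)) ∧ ∀ v, g (N₁ v) = N₂ (g v) := by
  classical
  obtain ⟨k, l, u₁, w₁, r₁, hw₁, hF₁, hk₁, hf₁, hv₁, hu₁⟩ := exists_nilAdapted_basis I₁ N₁ hI₁ hN₁ hIN₁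
  obtain ⟨k₂, l₂, u₂, w₂, r₂, hw₂, hF₂, hk₂, hf₂, hv₂, hu₂⟩ := exists_nilAdapted_basis I₂ N₂ hI₂ hN₂ hIN₂
  have hk : k₂ = k := by omega
  subst k₂
  have hl : l₂ = l := by omega
  subst l₂
  let g : F ≃ₗ[ℝ] F := r₁.equiv r₂ (Equiv.refl _)
  have hg : ∀ s, g (r₁ s) = r₂ s := fun s ↦ by simp [g]
  -- how `I_i` and `N_i` act on the two bases (same tables)
  have hIr : ∀ (I N : F →L[ℝ] F) (hI : ∀ v, I (I v) = -v) (u : Fin k → F) (w : Fin l → F)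
      (r : Basis (((Bool × Fin k) ⊕ (Bool × Fin l)) ⊕ (Bool × Fin k)) ℝ F)
      (hf : ∀ b i, r (Sum.inl (Sum.inl (b, i))) = bif b then I (N (u i)) else N (u i))
      (hv : ∀ b j, r (Sum.inl (Sum.inr (b, j))) = bif b then I (w j) else w j)
      (hu : ∀ b i, r (Sum.inr (b, i)) = bif b then I (u i) else u i) (s), I (r s) = match s with
        | Sum.inl (Sum.inl (β, a)) => bif β then -r (Sum.inl (Sum.inl (false, a))) else r (Sum.inl (Sum.inl (true, a)))
        | Sum.inl (Sum.inr (β, a)) => bif β then -r (Sum.inl (Sum.inr (false, a))) else r (Sum.inl (Sum.inr (true, a)))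
        | Sum.inr (β, a) => bif β then -r (Sum.inr (false, a)) else r (Sum.inr (true, a)) := by
    intro I N hI u w r hf hv hu
    rintro ((⟨β, a⟩ | ⟨β, a⟩) | ⟨β, a⟩) <;> cases β <;> simp [hf, hv, hu, hI]
  have hNr : ∀ (I N : F →L[ℝ] F) (hN : ∀ v, N (N v) = 0) (hIN : ∀ v, N (I v) = -I (N v)) (u : Fin k → F)
      (w : Fin l → F) (hw : ∀ j, N (w j) = 0) (r : Basis (((Bool × Fin k) ⊕ (Bool × Fin l)) ⊕ (Bool × Fin k)) ℝ F)
      (hf : ∀ b i, r (Sum.inl (Sum.inl (b, i))) = bif b then I (N (u i)) else N (u i))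
      (hv : ∀ b j, r (Sum.inl (Sum.inr (b, j))) = bif b then I (w j) else w j)
      (hu : ∀ b i, r (Sum.inr (b, i)) = bif b then I (u i) else u i) (s), N (r s) = match s with
        | Sum.inl (Sum.inl _) => 0
        | Sum.inl (Sum.inr _) => 0
        | Sum.inr (β, a) => bif β then -r (Sum.inl (Sum.inl (true, a))) else r (Sum.inl (Sum.inl (false, a))) := by
    intro I N hN hIN u w hw r hf hv hu
    rintro ((⟨β, a⟩ | ⟨β, a⟩) | ⟨β, a⟩) <;> cases β <;> simp [hf, hv, hu, hN, hIN, hw]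
  have hgI : g.toLinearMap ∘ₗ (I₁ : F →ₗ[ℝ] F) = (I₂ : F →ₗ[ℝ] F) ∘ₗ g.toLinearMap := by
    refine r₁.ext fun s ↦ ?_
    simp only [LinearMap.coe_comp, Function.comp_apply, ContinuousLinearMap.coe_coe, LinearEquiv.coe_coe,
      hIr I₁ N₁ hI₁ u₁ w₁ r₁ hf₁ hv₁ hu₁, hg, hIr I₂ N₂ hI₂ u₂ w₂ r₂ hf₂ hv₂ hu₂]
    rcases s with (⟨β, a⟩ | ⟨β, a⟩) | ⟨β, a⟩ <;> cases β <;> simp [hg]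
  have hgN : g.toLinearMap ∘ₗ (N₁ : F →ₗ[ℝ] F) = (N₂ : F →ₗ[ℝ] F) ∘ₗ g.toLinearMap := by
    refine r₁.ext fun s ↦ ?_
    simp only [LinearMap.coe_comp, Function.comp_apply, ContinuousLinearMap.coe_coe, LinearEquiv.coe_coe,
      hNr I₁ N₁ hN₁ hIN₁ u₁ w₁ hw₁ r₁ hf₁ hv₁ hu₁, hg, hNr I₂ N₂ hN₂ hIN₂ u₂ w₂ hw₂ r₂ hf₂ hv₂ hu₂]
    rcases s with (⟨β, a⟩ | ⟨β, a⟩) | ⟨β, a⟩ <;> cases β <;> simp [hg]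
  refine ⟨g.toContinuousLinearEquiv, fun v ↦ ?_, fun v ↦ ?_⟩
  · simpa using LinearMap.congr_fun hgI v
  · simpa using LinearMap.congr_fun hgN v

end NilCount

/-! ### §6 The hyperkähler carrier of the tree: `dim_ℝ (Λ²V_ℝ^*)^{SU(2)} = 2n² + n` on `ℂ^{2n}` -/

section HyperkaehlerCarrier

open Literature.Geometry.Kaehler
open Complex (I)

variable {E : Type*} [NormedAddCommGroup E] [NormedSpace ℂ E] [FiniteDimensional ℂ E]
  {g₀ : E →L[ℝ] E →L[ℝ] ℝ} {J : E →L[ℝ] E}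

/-- **`dim_ℝ = 2n² + n` for the real `2`-forms of type `(1,1)` for `I` and `J` of a linear hyperkähler structure on
`ℂ^{2n}`** (Theorem 1.2, `ℍ(−1)`, for the pair `(I = i•, J)` of the tree's `IsLinearHyperkaehler g₀ J`,
`ComplexTorusHyperkaehler.lean`; `dim_ℝ E = 2·dim_ℂ E = 4n`). [cite: Buskin2018GeneralizedTwistorLines, Thm. 1.2 (chunk p0005 L24–29)] -/
theorem _root_.Literature.Geometry.Hyperkaehler.IsLinearHyperkaehler.finrank_eq_of_forall_mem_iff_apply₂
    (hk : IsLinearHyperkaehler g₀ J) {n : ℕ} (hE : finrank ℂ E = 2 * n) (S : Submodule ℝ (E [⋀^Fin 2]→L[ℝ] ℝ))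
    (hS : ∀ Ω, Ω ∈ S ↔ (∀ v w : E, Ω ![I • v, I • w] = Ω ![v, w]) ∧ ∀ v w, Ω ![J v, J w] = Ω ![v, w]) :
    finrank ℝ S = 2 * n ^ 2 + n := by
  have hI : ∀ v : E, opI E (opI E v) = -v := fun v ↦ by
    rw [opI_apply, opI_apply, smul_smul, Complex.I_mul_I, neg_one_smul]
  have hJI : ∀ v : E, J (opI E v) = -opI E (J v) := fun v ↦ by rw [opI_apply, opI_apply, hk.J_I]
  have hF : finrank ℝ E = 4 * n := by rw [finrank_real_of_complex, hE]; ring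
  exact finrank_eq_of_forall_mem_iff hF hI hk.J_J hJI S fun Ω ↦ by simpa only [opI_apply] using hS Ω

/-- **`dim_ℝ (Λ²V_ℝ^*)^{SU(2)} = 2n² + n`**: the same with `Hdg_S` written as the real `2`-forms invariant under every unit
quaternion `a + bI + cJ + dK` (`a² + b² + c² + d² = 1`) of the hyperkähler structure — Verbitsky's `G_M = SU(2)`-invariance,
which is type `(1,1)` for `I` and for `J` by the tree's `IsLinearHyperkaehler.forall_compContinuousLinearMap_quaternion_iff`
and `adAlt_opI_J_eq_zero_iff_apply₂_invariant` (`IsotropyGroupInvariance.lean`: "The form `ω` is `G_M`-invariant if and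
only if it is of Hodge type `(p,p)` with respect to all induced complex structures").
[cite: Buskin2018GeneralizedTwistorLines, Thm. 1.2 (chunk p0005 L24–29)] [cite: Verbitsky1996Hyperholomorphic, §1 Prop. 1.2] -/
theorem _root_.Literature.Geometry.Hyperkaehler.IsLinearHyperkaehler.finrank_eq_of_forall_mem_iff_quaternion
    (hk : IsLinearHyperkaehler g₀ J) {n : ℕ} (hE : finrank ℂ E = 2 * n) (S : Submodule ℝ (E [⋀^Fin 2]→L[ℝ] ℝ))
    (hS : ∀ Ω, Ω ∈ S ↔ ∀ a b c d : ℝ, a ^ 2 + b ^ 2 + c ^ 2 + d ^ 2 = 1 →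
      Ω.compContinuousLinearMap (a • ContinuousLinearMap.id ℝ E + b • opI E + c • J + d • opK J) = Ω) :
    finrank ℝ S = 2 * n ^ 2 + n :=
  hk.finrank_eq_of_forall_mem_iff_apply₂ hE S fun Ω ↦
    (hS Ω).trans (hk.forall_compContinuousLinearMap_quaternion_iff.trans hk.adAlt_opI_J_eq_zero_iff_apply₂_invariant)

end HyperkaehlerCarrier

/-! ### §7 The Kähler locus along a line of type `ℍ(1)` is exactly the two cones, one per sheet; convexity; `dim Im N` is an invariant of a line of type `ℍ(0)` -/

section KaehlerLocus

/-- The square of a point of the real span of a line of type `ℍ(1)`: `(aI + bR + cIR)² = (−a² + b² + c²)·Id` for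
`I² = −1`, `R² = 1`, `RI = −IR` ("`(xI+yR+zIR)² = (−x²+y²+z²)Id`"). [cite: Buskin2018GeneralizedTwistorLines, §1.1 (chunk
p0004 L43–46)] -/
theorem splitTwistor_apply_apply {I R : F →L[ℝ] F} (hI : ∀ v, I (I v) = -v) (hR : ∀ v, R (R v) = v)
    (hIR : ∀ v, R (I v) = -I (R v)) (a b c : ℝ) (v : F) :
    (a • I + b • R + c • I.comp R) ((a • I + b • R + c • I.comp R) v) = (-a ^ 2 + b ^ 2 + c ^ 2) • v := by
  simp only [_root_.add_apply, _root_.smul_apply, ContinuousLinearMap.coe_comp, Function.comp_apply, map_add, map_smul,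
    map_neg, hI, hR, hIR, smul_add, smul_neg, neg_neg, smul_smul]
  module

/-- **A split partner through any point of the line, and `I` in the new frame.** For `I² = −1`, `R² = 1`, `RI = −IR` and
`λ = xI + yR + zIR` with `x² − y² − z² = 1`, put `s = √(1 + z²)`, `p = y/s`, `q = x/s` and `μ = pI + qR`: then
`p² − q² = −1` (so `μ² = Id` by `splitTwistor_apply_apply`), `μλ = −λμ` — `(λ, μ)` is again a faithful representation of
`ℍ(1)`, spanning the same line — and `I = x·λ + y'·μ + z'·λμ` with `y' = −y/s`, `z' = −xz/s`, `x² − y'² − z'² = 1`: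
`I` lies on the line of the pair `(λ, μ)` with the SAME first coordinate `x`. (The linear algebra behind "corresponding to
each of the connected components of `S`": on one sheet the roles of `I` and `λ` are interchangeable.)
[cite: Buskin2018GeneralizedTwistorLines, §1.1 (chunk p0004 L32–49) with Thm. 1.2 (chunk p0005 L31–33)] -/
theorem exists_splitPartner {I R : F →L[ℝ] F} (hI : ∀ v, I (I v) = -v) (hR : ∀ v, R (R v) = v)
    (hIR : ∀ v, R (I v) = -I (R v)) {x y z : ℝ} (hxyz : x ^ 2 - y ^ 2 - z ^ 2 = 1) :
    ∃ p q y' z' : ℝ, p ^ 2 - q ^ 2 = -1 ∧ x ^ 2 - y' ^ 2 - z' ^ 2 = 1 ∧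
      (∀ v, (p • I + q • R) ((x • I + y • R + z • I.comp R) v) =
        -(x • I + y • R + z • I.comp R) ((p • I + q • R) v)) ∧
      I = x • (x • I + y • R + z • I.comp R) + y' • (p • I + q • R) +
        z' • (x • I + y • R + z • I.comp R).comp (p • I + q • R) := by
  obtain ⟨s, hs0, hs2⟩ : ∃ s : ℝ, 0 < s ∧ s ^ 2 = 1 + z ^ 2 :=
    ⟨Real.sqrt (1 + z ^ 2), Real.sqrt_pos.mpr (by positivity), Real.sq_sqrt (by positivity)⟩
  have hsi : s⁻¹ * s⁻¹ * (1 + z ^ 2) = 1 := by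
    rw [← hs2]; field_simp
  have hB : x ^ 2 - (-(s⁻¹ * y)) ^ 2 - (-(s⁻¹ * (x * z))) ^ 2 = 1 := by
    linear_combination s⁻¹ * s⁻¹ * hxyz - (x ^ 2 - 1) * hsi
  refine ⟨s⁻¹ * y, s⁻¹ * x, -(s⁻¹ * y), -(s⁻¹ * (x * z)), ?_, hB, fun v ↦ ?_, ?_⟩
  · linear_combination -hsi - s⁻¹ * s⁻¹ * hxyz
  · -- the anticommutator of two points of the span of the line is the scalar `2(−aa' + bb' + cc')` (the tree's
    -- `TwistorLine.anticommutator_splitTwistor`, `TwistorLineAlgebraicCharacterization.lean`; recomputed inline here so that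
    -- this file keeps its imports), which vanishes for `(p, q, 0)` against `(x, y, z)` with `p = y/s`, `q = x/s`
    have h : ((s⁻¹ * y) • I + (s⁻¹ * x) • R) ((x • I + y • R + z • I.comp R) v) +
        (x • I + y • R + z • I.comp R) (((s⁻¹ * y) • I + (s⁻¹ * x) • R) v) = 0 := by
      simp only [_root_.add_apply, _root_.smul_apply, ContinuousLinearMap.coe_comp, Function.comp_apply, map_add,
        map_smul, map_neg, hI, hR, hIR, smul_add, smul_neg, neg_neg, smul_smul]
      module
    exact eq_neg_of_add_eq_zero_left h
  · ext v
    have e₂ : x * y + -(s⁻¹ * y) * (s⁻¹ * x) + -(s⁻¹ * (x * z)) * (z * (s⁻¹ * y)) = 0 := by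
      linear_combination (-(x * y)) * hsi
    have e₃ : x * z + -(s⁻¹ * (x * z)) * (x * (s⁻¹ * x) - y * (s⁻¹ * y)) = 0 := by
      linear_combination (-(x * z)) * hsi - s⁻¹ * s⁻¹ * (x * z) * hxyz
    have e₁ : x * x + -(s⁻¹ * y) * (s⁻¹ * y) + -(s⁻¹ * (x * z)) * (z * (s⁻¹ * x)) = 1 := by
      linear_combination hB
    symm
    simp only [_root_.add_apply, _root_.smul_apply, ContinuousLinearMap.coe_comp, Function.comp_apply, map_add, map_smul,
      map_neg, hI, hR, hIR, smul_add, smul_neg, neg_neg, smul_smul]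
    linear_combination (norm := module) e₁ • I v + e₂ • R v + e₃ • I (R v)

/-- **Kähler at one point of the upper sheet ⟺ Kähler at `I`.** For `Ω ∈ Hdg_{S(I,R)}` (type `(1,1)` for `I`,
anti-invariant under `R`) and a point `λ = xI + yR + zIR`, `x² − y² − z² = 1`, `x > 0`, of the sheet `S(I,R)⁺ ∋ I`:
`Ω(v, λv) > 0` for all `v ≠ 0` iff `Ω(v, Iv) > 0` for all `v ≠ 0`. (`⇐` is `apply₂_splitTwistor_pos`; `⇒` is the same
statement for the pair `(λ, μ)` of `exists_splitPartner`, on whose upper sheet `I` lies.) Hence being a Kähler class is a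
property of the SHEET, not of the point: "two disjoint open cones of Kähler classes, corresponding to each of the connected
components of `S`". [cite: Buskin2018GeneralizedTwistorLines, Thm. 1.2 (chunk p0005 L31–33) with §3 (chunk p0012 L100–105)] -/
theorem apply₂_splitTwistor_pos_iff {I R : F →L[ℝ] F} (hI : ∀ v, I (I v) = -v) (hR : ∀ v, R (R v) = v)
    (hIR : ∀ v, R (I v) = -I (R v)) (Ω : F [⋀^Fin 2]→L[ℝ] ℝ) (hΩI : ∀ v w, Ω ![I v, I w] = Ω ![v, w])
    (hΩR : ∀ v w, Ω ![R v, R w] = -Ω ![v, w]) {x y z : ℝ} (hxyz : x ^ 2 - y ^ 2 - z ^ 2 = 1) (hx : 0 < x) :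
    (∀ v, v ≠ 0 → 0 < Ω ![v, (x • I + y • R + z • I.comp R) v]) ↔ ∀ v, v ≠ 0 → 0 < Ω ![v, I v] := by
  refine ⟨fun hpos v hv ↦ ?_, fun hpos v hv ↦ apply₂_splitTwistor_pos hI hR hIR Ω hΩI hΩR hpos hxyz hx v hv⟩
  obtain ⟨p, q, y', z', hpq, hxyz', hanti, hIeq⟩ := exists_splitPartner hI hR hIR (y := y) hxyz
  have hL : ∀ v, (x • I + y • R + z • I.comp R) ((x • I + y • R + z • I.comp R) v) = -v := fun v ↦ by
    rw [splitTwistor_apply_apply hI hR hIR, show -x ^ 2 + y ^ 2 + z ^ 2 = -1 by linear_combination -hxyz, neg_one_smul]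
  have hM : ∀ v, (p • I + q • R) ((p • I + q • R) v) = v := fun v ↦ by
    have h := splitTwistor_apply_apply hI hR hIR p q 0 v
    rw [show -p ^ 2 + q ^ 2 + (0 : ℝ) ^ 2 = 1 by linear_combination -hpq, one_smul] at h
    simpa only [zero_smul, add_zero] using h
  have hΩL : ∀ v w, Ω ![(x • I + y • R + z • I.comp R) v, (x • I + y • R + z • I.comp R) w] = Ω ![v, w] :=
    fun v w ↦ by rw [apply₂_splitTwistor_eq_smul hI hR hIR Ω hΩI hΩR, hxyz, one_smul]
  have hΩM : ∀ v w, Ω ![(p • I + q • R) v, (p • I + q • R) w] = -Ω ![v, w] := fun v w ↦ by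
    have h := apply₂_splitTwistor_eq_smul hI hR hIR Ω hΩI hΩR p q 0 v w
    rw [show p ^ 2 - q ^ 2 - (0 : ℝ) ^ 2 = -1 by linear_combination hpq, neg_one_smul] at h
    simpa only [zero_smul, add_zero] using h
  have key := apply₂_splitTwistor_pos hL hM hanti Ω hΩL hΩM hpos hxyz' hx v hv
  rwa [← hIeq] at key

/-- The same on the lower sheet: for `x < 0` (`λ ∈ S(I,R)⁻ ∋ −I`), `Ω(v, λv) > 0` for all `v ≠ 0` iff `Ω` is a Kähler form
of `(V_ℝ/Γ, −I)` — `apply₂_splitTwistor_pos_iff` for the pair `(−I, R)`, since `λ = (−x)(−I) + yR + (−z)(−I)R`.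
[cite: Buskin2018GeneralizedTwistorLines, Thm. 1.2 (chunk p0005 L31–33) with §3 (chunk p0012 L100–105: "correspond to ±B > 0")] -/
theorem apply₂_splitTwistor_pos_iff_of_neg {I R : F →L[ℝ] F} (hI : ∀ v, I (I v) = -v) (hR : ∀ v, R (R v) = v)
    (hIR : ∀ v, R (I v) = -I (R v)) (Ω : F [⋀^Fin 2]→L[ℝ] ℝ) (hΩI : ∀ v w, Ω ![I v, I w] = Ω ![v, w])
    (hΩR : ∀ v w, Ω ![R v, R w] = -Ω ![v, w]) {x y z : ℝ} (hxyz : x ^ 2 - y ^ 2 - z ^ 2 = 1) (hx : x < 0) :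
    (∀ v, v ≠ 0 → 0 < Ω ![v, (x • I + y • R + z • I.comp R) v]) ↔ ∀ v, v ≠ 0 → 0 < Ω ![v, (-I) v] := by
  have hI' : ∀ v, (-I) ((-I) v) = -v := fun v ↦ by simp [map_neg, hI]
  have hIR' : ∀ v, R ((-I) v) = -(-I) (R v) := fun v ↦ by simp [map_neg, hIR]
  have hΩI' : ∀ v w, Ω ![(-I) v, (-I) w] = Ω ![v, w] := fun v w ↦ by
    simp [apply₂_neg_left, apply₂_neg_right, hΩI]
  have h := apply₂_splitTwistor_pos_iff hI' hR hIR' Ω hΩI' hΩR (x := -x) (y := y) (z := -z)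
    (by linear_combination hxyz) (by linarith)
  have hop : (-x) • (-I) + y • R + (-z) • (-I).comp R = x • I + y • R + z • I.comp R := by
    ext v
    simp only [_root_.add_apply, _root_.smul_apply, _root_.neg_apply, ContinuousLinearMap.coe_comp, Function.comp_apply,
      smul_neg, neg_smul, neg_neg]
  rwa [hop] at h

/-- **Kähler somewhere on the line ⟺ in one of the two cones.** For `Ω ∈ Hdg_{S(I,R)}` and any point `λ = xI + yR + zIR`
of the line (`x² − y² − z² = 1`, so `x ≠ 0`): `Ω` is a Kähler form of `(V_ℝ/Γ, λ)` iff EITHER `x > 0` and `Ω` is a Kähler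
form of `(V_ℝ/Γ, I)`, OR `x < 0` and `Ω` is a Kähler form of `(V_ℝ/Γ, −I)`.
[cite: Buskin2018GeneralizedTwistorLines, Thm. 1.2 (chunk p0005 L31–33) with §3 (chunk p0012 L100–105)] -/
theorem apply₂_splitTwistor_pos_iff_sheets {I R : F →L[ℝ] F} (hI : ∀ v, I (I v) = -v) (hR : ∀ v, R (R v) = v)
    (hIR : ∀ v, R (I v) = -I (R v)) (Ω : F [⋀^Fin 2]→L[ℝ] ℝ) (hΩI : ∀ v w, Ω ![I v, I w] = Ω ![v, w])
    (hΩR : ∀ v w, Ω ![R v, R w] = -Ω ![v, w]) {x y z : ℝ} (hxyz : x ^ 2 - y ^ 2 - z ^ 2 = 1) :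
    (∀ v, v ≠ 0 → 0 < Ω ![v, (x • I + y • R + z • I.comp R) v]) ↔
      (0 < x ∧ ∀ v, v ≠ 0 → 0 < Ω ![v, I v]) ∨ (x < 0 ∧ ∀ v, v ≠ 0 → 0 < Ω ![v, (-I) v]) := by
  have hx0 : x ≠ 0 := by
    rintro rfl
    nlinarith [sq_nonneg y, sq_nonneg z]
  rcases lt_or_gt_of_ne hx0 with hneg | hpos
  · rw [apply₂_splitTwistor_pos_iff_of_neg hI hR hIR Ω hΩI hΩR hxyz hneg]
    constructor
    · exact fun h ↦ Or.inr ⟨hneg, h⟩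
    · rintro (⟨h, -⟩ | ⟨-, h⟩)
      · exact absurd h (not_lt.mpr hneg.le)
      · exact h
  · rw [apply₂_splitTwistor_pos_iff hI hR hIR Ω hΩI hΩR hxyz hpos]
    constructor
    · exact fun h ↦ Or.inl ⟨hpos, h⟩
    · rintro (⟨-, h⟩ | ⟨h, -⟩)
      · exact h
      · exact absurd h (not_lt.mpr hpos.le)

/-- **Kähler along a whole sheet from one of its points.** If `Ω ∈ Hdg_{S(I,R)}` is a Kähler form at ONE point of a sheet
of `S(I,R)` (`x` and `x'` of the same sign), it is a Kähler form at EVERY point of that sheet.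
[cite: Buskin2018GeneralizedTwistorLines, Thm. 1.2 (chunk p0005 L31–33) with §3 (chunk p0012 L100–105: "The Kähler classes which
stay of type (1,1) along one of the components of S(I,R)")] -/
theorem apply₂_splitTwistor_pos_of_sameSheet {I R : F →L[ℝ] F} (hI : ∀ v, I (I v) = -v) (hR : ∀ v, R (R v) = v)
    (hIR : ∀ v, R (I v) = -I (R v)) (Ω : F [⋀^Fin 2]→L[ℝ] ℝ) (hΩI : ∀ v w, Ω ![I v, I w] = Ω ![v, w])
    (hΩR : ∀ v w, Ω ![R v, R w] = -Ω ![v, w]) {x y z x' y' z' : ℝ} (hxyz : x ^ 2 - y ^ 2 - z ^ 2 = 1)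
    (hxyz' : x' ^ 2 - y' ^ 2 - z' ^ 2 = 1) (hxx' : 0 < x * x')
    (hpos : ∀ v, v ≠ 0 → 0 < Ω ![v, (x • I + y • R + z • I.comp R) v]) (v : F) (hv : v ≠ 0) :
    0 < Ω ![v, (x' • I + y' • R + z' • I.comp R) v] := by
  rcases (apply₂_splitTwistor_pos_iff_sheets hI hR hIR Ω hΩI hΩR hxyz).1 hpos with ⟨hx, h⟩ | ⟨hx, h⟩
  · have hx' : 0 < x' := pos_of_mul_pos_right hxx' hx.le
    exact (apply₂_splitTwistor_pos_iff hI hR hIR Ω hΩI hΩR hxyz' hx').2 h v hv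
  · have hx' : x' < 0 := by nlinarith
    exact (apply₂_splitTwistor_pos_iff_of_neg hI hR hIR Ω hΩI hΩR hxyz' hx').2 h v hv

/-- **The Kähler locus of `Hdg_S` is the union of the two cones.** Inside any carrier `S` of `Hdg_{S(I,R)}` the members
that are Kähler for SOME point `λ = xI + yR + zIR` of the line are exactly `K⁺ ∪ K⁻`, the `I`-positive and the
`(−I)`-positive members (`two_open_kaehlerCones_of_split`: both open, non-empty, and disjoint when `V_ℝ ≠ 0`) — "The subspace
`Hdg_S` contains two disjoint open cones of Kähler classes, corresponding to each of the connected components of `S`", with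
nothing else Kähler anywhere on `S`. [cite: Buskin2018GeneralizedTwistorLines, Thm. 1.2 (chunk p0005 L31–33) with §3 (chunk p0012
L100–105)] -/
theorem kaehlerLocus_eq_union_of_split {I R : F →L[ℝ] F} (hI : ∀ v, I (I v) = -v) (hR : ∀ v, R (R v) = v)
    (hIR : ∀ v, R (I v) = -I (R v)) (S : Submodule ℝ (F [⋀^Fin 2]→L[ℝ] ℝ))
    (hS : ∀ Ω, Ω ∈ S ↔ (∀ v w, Ω ![I v, I w] = Ω ![v, w]) ∧ ∀ v w, Ω ![R v, R w] = -Ω ![v, w]) :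
    {Ω : S | ∃ x y z : ℝ, x ^ 2 - y ^ 2 - z ^ 2 = 1 ∧
        ∀ v, v ≠ 0 → 0 < (Ω : F [⋀^Fin 2]→L[ℝ] ℝ) ![v, (x • I + y • R + z • I.comp R) v]} =
      {Ω : S | ∀ v, v ≠ 0 → 0 < (Ω : F [⋀^Fin 2]→L[ℝ] ℝ) ![v, I v]} ∪
        {Ω : S | ∀ v, v ≠ 0 → 0 < (Ω : F [⋀^Fin 2]→L[ℝ] ℝ) ![v, (-I) v]} := by
  ext Ω
  obtain ⟨hΩI, hΩR⟩ := (hS Ω).1 Ω.2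
  simp only [Set.mem_setOf_eq, Set.mem_union]
  constructor
  · rintro ⟨x, y, z, hxyz, h⟩
    rcases (apply₂_splitTwistor_pos_iff_sheets hI hR hIR _ hΩI hΩR hxyz).1 h with ⟨-, h⟩ | ⟨-, h⟩
    · exact Or.inl h
    · exact Or.inr h
  · rintro (h | h)
    · exact ⟨1, 0, 0, by norm_num, fun v hv ↦ by simpa using h v hv⟩
    · exact ⟨-1, 0, 0, by norm_num, fun v hv ↦ by simpa using h v hv⟩

/-! #### The cones are convex -/

/-- **Positivity is a convex condition**: for a fixed operator `Λ` the real `2`-covectors with `Ω(v, Λv) > 0` for all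
`v ≠ 0` form a CONVEX set, closed under sums and under positive multiples (an open convex cone once `Λ` is fixed; for the
two cones `K^±` of Thm. 1.2 take `Λ = ±I`). [cite: Buskin2018GeneralizedTwistorLines, Thm. 1.2 (chunk p0005 L31–33: "two disjoint
open cones of Kähler classes") with §3 (chunk p0012 L100–105: "each of which is an open cone in Hdg_{S(I,R)}")] -/
theorem convex_setOf_apply₂_pos (Λ : F →L[ℝ] F) :
    Convex ℝ {Ω : F [⋀^Fin 2]→L[ℝ] ℝ | ∀ v, v ≠ 0 → 0 < Ω ![v, Λ v]} ∧
      (∀ Ω₁ ∈ {Ω : F [⋀^Fin 2]→L[ℝ] ℝ | ∀ v, v ≠ 0 → 0 < Ω ![v, Λ v]},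
        ∀ Ω₂ ∈ {Ω : F [⋀^Fin 2]→L[ℝ] ℝ | ∀ v, v ≠ 0 → 0 < Ω ![v, Λ v]},
          Ω₁ + Ω₂ ∈ {Ω : F [⋀^Fin 2]→L[ℝ] ℝ | ∀ v, v ≠ 0 → 0 < Ω ![v, Λ v]}) ∧
      ∀ c : ℝ, 0 < c → ∀ Ω₁ ∈ {Ω : F [⋀^Fin 2]→L[ℝ] ℝ | ∀ v, v ≠ 0 → 0 < Ω ![v, Λ v]},
        c • Ω₁ ∈ {Ω : F [⋀^Fin 2]→L[ℝ] ℝ | ∀ v, v ≠ 0 → 0 < Ω ![v, Λ v]} := by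
  refine ⟨fun Ω₁ h₁ Ω₂ h₂ a b ha hb hab v hv ↦ ?_, fun Ω₁ h₁ Ω₂ h₂ v hv ↦ ?_, fun c hc Ω₁ h₁ v hv ↦ ?_⟩
  · simp only [Set.mem_setOf_eq] at h₁ h₂
    rw [ContinuousAlternatingMap.add_apply, ContinuousAlternatingMap.smul_apply, ContinuousAlternatingMap.smul_apply,
      smul_eq_mul, smul_eq_mul]
    have p₁ := h₁ v hv
    have p₂ := h₂ v hv
    rcases ha.eq_or_lt with rfl | ha'
    · rw [zero_add] at hab
      rw [hab, zero_mul, one_mul, zero_add]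
      exact p₂
    · nlinarith [mul_pos ha' p₁, mul_nonneg hb p₂.le]
  · simp only [Set.mem_setOf_eq] at h₁ h₂
    rw [ContinuousAlternatingMap.add_apply]
    exact add_pos (h₁ v hv) (h₂ v hv)
  · simp only [Set.mem_setOf_eq] at h₁
    rw [ContinuousAlternatingMap.smul_apply, smul_eq_mul]
    exact mul_pos hc (h₁ v hv)

/-- The same inside any carrier `S ⊆ Hom(∧²V_ℝ, ℝ)` (a real subspace): the `Λ`-positive members of `S` form a convex subset
of `S`, closed under sums and positive multiples — so the two cones `K^±` of `two_open_kaehlerCones_of_split` are open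
CONVEX cones. [cite: Buskin2018GeneralizedTwistorLines, Thm. 1.2 (chunk p0005 L31–33) with §3 (chunk p0012 L100–105)] -/
theorem convex_setOf_coe_apply₂_pos (Λ : F →L[ℝ] F) (S : Submodule ℝ (F [⋀^Fin 2]→L[ℝ] ℝ)) :
    Convex ℝ {Ω : S | ∀ v, v ≠ 0 → 0 < (Ω : F [⋀^Fin 2]→L[ℝ] ℝ) ![v, Λ v]} ∧
      (∀ Ω₁ ∈ {Ω : S | ∀ v, v ≠ 0 → 0 < (Ω : F [⋀^Fin 2]→L[ℝ] ℝ) ![v, Λ v]},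
        ∀ Ω₂ ∈ {Ω : S | ∀ v, v ≠ 0 → 0 < (Ω : F [⋀^Fin 2]→L[ℝ] ℝ) ![v, Λ v]},
          Ω₁ + Ω₂ ∈ {Ω : S | ∀ v, v ≠ 0 → 0 < (Ω : F [⋀^Fin 2]→L[ℝ] ℝ) ![v, Λ v]}) ∧
      ∀ c : ℝ, 0 < c → ∀ Ω₁ ∈ {Ω : S | ∀ v, v ≠ 0 → 0 < (Ω : F [⋀^Fin 2]→L[ℝ] ℝ) ![v, Λ v]},
        c • Ω₁ ∈ {Ω : S | ∀ v, v ≠ 0 → 0 < (Ω : F [⋀^Fin 2]→L[ℝ] ℝ) ![v, Λ v]} := by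
  obtain ⟨hc, hadd, hsmul⟩ := convex_setOf_apply₂_pos Λ
  refine ⟨fun Ω₁ h₁ Ω₂ h₂ a b ha hb hab ↦ ?_, fun Ω₁ h₁ Ω₂ h₂ ↦ ?_, fun c hc' Ω₁ h₁ ↦ ?_⟩
  · have h := hc h₁ h₂ ha hb hab
    simpa only [Set.mem_setOf_eq, Submodule.coe_add, Submodule.coe_smul] using h
  · simpa only [Set.mem_setOf_eq, Submodule.coe_add] using hadd _ h₁ _ h₂
  · simpa only [Set.mem_setOf_eq, Submodule.coe_smul] using hsmul c hc' _ h₁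

/-! #### `dim Im N` is an invariant of the `GL(V_ℝ)`-orbit of a line of type `ℍ(0)` -/

/-- **Conjugate pairs have the same `dim Im N`** (the immediate converse of `exists_conj_of_nilPair`): if a linear
automorphism `g` intertwines `N₁` and `N₂` (`gN₁ = N₂g`), then `dim_ℝ Im N₁ = dim_ℝ Im N₂` (`Im N₂ = g(Im N₁)`). So the
`GL(V_ℝ)`-orbits of lines of type `ℍ(0)` are classified by the one integer `k = dim_ℝ Im N / 2`.
[cite: Buskin2018GeneralizedTwistorLines, Thm. 1.2 (chunk p0005 L40–43: "`n` non-equivalent faithful representations `ℍ(0) → End V_ℝ`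
parametrized by integers `1 ≤ k ≤ n`, equivalently, … `n` distinct `GL(V_ℝ)`-orbits of lines of the type `ℍ(0)`")] -/
theorem finrank_range_eq_of_conj {N₁ N₂ : F →L[ℝ] F} (g : F ≃L[ℝ] F) (hg : ∀ v, g (N₁ v) = N₂ (g v)) :
    finrank ℝ (LinearMap.range (N₁ : F →ₗ[ℝ] F)) = finrank ℝ (LinearMap.range (N₂ : F →ₗ[ℝ] F)) := by
  have hcomp : (g.toLinearEquiv : F →ₗ[ℝ] F) ∘ₗ (N₁ : F →ₗ[ℝ] F) = (N₂ : F →ₗ[ℝ] F) ∘ₗ (g.toLinearEquiv : F →ₗ[ℝ] F) := by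
    ext v
    simpa using hg v
  have hmap : (LinearMap.range (N₁ : F →ₗ[ℝ] F)).map (g.toLinearEquiv : F →ₗ[ℝ] F) =
      LinearMap.range (N₂ : F →ₗ[ℝ] F) := by
    rw [LinearMap.range_eq_map, ← Submodule.map_comp, hcomp, Submodule.map_comp, Submodule.map_top, LinearEquiv.range,
      ← LinearMap.range_eq_map]
  rw [← hmap, LinearEquiv.finrank_map_eq]

/-- **The `GL(V_ℝ)`-orbits of faithful representations `ℍ(0) → End V_ℝ` are classified by `dim Im N`**: two pairs
`(I₁, N₁)`, `(I₂, N₂)` (`I² = −1`, `N² = 0`, `NI = −IN`) on the same finite-dimensional real space are conjugate by a linear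
automorphism IF AND ONLY IF `dim_ℝ Im N₁ = dim_ℝ Im N₂` (`exists_conj_of_nilPair` and `finrank_range_eq_of_conj`).
[cite: Buskin2018GeneralizedTwistorLines, Thm. 1.2 (chunk p0005 L40–43) with §3 (chunk p0013 L37–41: "All non-equivalent
4n-representations are parametrized by … k, l satisfying 4k + 2l = 4n")] -/
theorem exists_conj_iff_finrank_range_eq [FiniteDimensional ℝ F] {I₁ N₁ I₂ N₂ : F →L[ℝ] F}
    (hI₁ : ∀ v, I₁ (I₁ v) = -v) (hN₁ : ∀ v, N₁ (N₁ v) = 0) (hIN₁ : ∀ v, N₁ (I₁ v) = -I₁ (N₁ v))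
    (hI₂ : ∀ v, I₂ (I₂ v) = -v) (hN₂ : ∀ v, N₂ (N₂ v) = 0) (hIN₂ : ∀ v, N₂ (I₂ v) = -I₂ (N₂ v)) :
    (∃ g : F ≃L[ℝ] F, (∀ v, g (I₁ v) = I₂ (g v)) ∧ ∀ v, g (N₁ v) = N₂ (g v)) ↔
      finrank ℝ (LinearMap.range (N₁ : F →ₗ[ℝ] F)) = finrank ℝ (LinearMap.range (N₂ : F →ₗ[ℝ] F)) :=
  ⟨fun ⟨g, _, hg⟩ ↦ finrank_range_eq_of_conj g hg, exists_conj_of_nilPair hI₁ hN₁ hIN₁ hI₂ hN₂ hIN₂⟩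

/-- **The parameter: `dim_ℝ Im N = 2k` with `1 ≤ k ≤ n`.** For a FAITHFUL representation `ℍ(0) → End V_ℝ` (`I² = −1`,
`N² = 0`, `NI = −IN`, `N ≠ 0`) on a real space of dimension `4n`, the image of `N` has even dimension `2k` with
`1 ≤ k ≤ n` (the normal form `V_ℝ = Im N ⊕ W ⊕ U` of `exists_nilAdapted_basis` has `dim Im N = 2k`, `4k + 2l = 4n`, and
`Im N ≠ 0`). ("parametrized by integers `1 ≤ k ≤ n`". The proof in §3 speaks of "nonnegative integers `k, l` satisfying
`4k + 2l = 4n`" and then counts "`n` such `4n`-representations": the value `k = 0` is the non-faithful `N = 0`, which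
Thm. 1.2's "faithful … `1 ≤ k ≤ n`" excludes — here the hypothesis `N ≠ 0`.) [cite: Buskin2018GeneralizedTwistorLines, Thm. 1.2
(chunk p0005 L40–43 = arXiv v2 PDF p.5) with §3 (chunk p0013 L37–41 = PDF p.16 bottom; the text's "As `IN = −IN`" [sic] means
`IN = −NI`)] -/
theorem exists_finrank_range_eq_two_mul [FiniteDimensional ℝ F] {n : ℕ} (hF : finrank ℝ F = 4 * n) {I N : F →L[ℝ] F}
    (hI : ∀ v, I (I v) = -v) (hN : ∀ v, N (N v) = 0) (hIN : ∀ v, N (I v) = -I (N v)) (hN0 : N ≠ 0) :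
    ∃ k : ℕ, 1 ≤ k ∧ k ≤ n ∧ finrank ℝ (LinearMap.range (N : F →ₗ[ℝ] F)) = 2 * k := by
  obtain ⟨k, l, u, w, r, -, hF', hk, -, -, -⟩ := exists_nilAdapted_basis I N hI hN hIN
  refine ⟨k, ?_, by omega, hk⟩
  by_contra hk1
  have hk0 : k = 0 := by omega
  rw [hk0, mul_zero, Submodule.finrank_eq_zero, LinearMap.range_eq_bot] at hk
  exact hN0 (by ext v; simpa using LinearMap.congr_fun hk v)

/-- **Every parameter `1 ≤ k ≤ n` occurs** (the existence half of "there are `n` non-equivalent faithful representations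
`ℍ(0) → End V_ℝ` parametrized by integers `1 ≤ k ≤ n`"): on a real space of dimension `4n` there is, for each such `k`, a
pair `I² = −1`, `N² = 0`, `NI = −IN` with `N ≠ 0` and `dim_ℝ Im N = 2k` — take a basis indexed as in the normal form
`Im N ⊕ W ⊕ U` (`exists_nilAdapted_basis`, `l = 2(n − k)`) and let `I`, `N` act by the printed tables (`N : u_i ↦ Nu_i`,
`Iu_i ↦ −INu_i`, zero on `Im N ⊕ W`). With `exists_conj_iff_finrank_range_eq` and `exists_finrank_range_eq_two_mul`: EXACTLY `n`
orbits. [cite: Buskin2018GeneralizedTwistorLines, Thm. 1.2 (chunk p0005 L40–43) with §3 (chunk p0013 L1–7, L37–41)] -/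
theorem exists_nilPair_finrank_range_eq [FiniteDimensional ℝ F] {n k : ℕ} (hF : finrank ℝ F = 4 * n) (hk1 : 1 ≤ k)
    (hkn : k ≤ n) :
    ∃ I N : F →L[ℝ] F, (∀ v, I (I v) = -v) ∧ (∀ v, N (N v) = 0) ∧ (∀ v, N (I v) = -I (N v)) ∧ N ≠ 0 ∧
      finrank ℝ (LinearMap.range (N : F →ₗ[ℝ] F)) = 2 * k := by
  classical
  obtain ⟨l, hl⟩ : ∃ l : ℕ, 4 * k + 2 * l = 4 * n := ⟨2 * (n - k), by omega⟩
  -- a basis indexed by the normal-form pattern `(Nu_i, INu_i)_i, (w_j, Iw_j)_j, (u_i, Iu_i)_i`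
  have hcard : finrank ℝ F = Fintype.card (((Bool × Fin k) ⊕ (Bool × Fin l)) ⊕ (Bool × Fin k)) := by
    simp only [Fintype.card_sum, Fintype.card_prod, Fintype.card_bool, Fintype.card_fin]
    omega
  let r : Basis (((Bool × Fin k) ⊕ (Bool × Fin l)) ⊕ (Bool × Fin k)) ℝ F :=
    (Module.finBasisOfFinrankEq ℝ F hcard).reindex (Fintype.equivFin _).symm
  -- the printed tables
  let fI : (((Bool × Fin k) ⊕ (Bool × Fin l)) ⊕ (Bool × Fin k)) → F := fun s ↦ match s with
    | Sum.inl (Sum.inl (β, a)) => bif β then -r (Sum.inl (Sum.inl (false, a))) else r (Sum.inl (Sum.inl (true, a)))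
    | Sum.inl (Sum.inr (β, a)) => bif β then -r (Sum.inl (Sum.inr (false, a))) else r (Sum.inl (Sum.inr (true, a)))
    | Sum.inr (β, a) => bif β then -r (Sum.inr (false, a)) else r (Sum.inr (true, a))
  let fN : (((Bool × Fin k) ⊕ (Bool × Fin l)) ⊕ (Bool × Fin k)) → F := fun s ↦ match s with
    | Sum.inl _ => 0
    | Sum.inr (β, a) => bif β then -r (Sum.inl (Sum.inl (true, a))) else r (Sum.inl (Sum.inl (false, a)))
  let I₀ : F →ₗ[ℝ] F := r.constr ℝ fI
  let N₀ : F →ₗ[ℝ] F := r.constr ℝ fN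
  have hI₀ : ∀ s, I₀ (r s) = fI s := fun s ↦ by simp [I₀]
  have hN₀ : ∀ s, N₀ (r s) = fN s := fun s ↦ by simp [N₀]
  -- the three relations, checked on the basis
  have hII : I₀ ∘ₗ I₀ = -LinearMap.id := by
    refine r.ext fun s ↦ ?_
    rcases s with (⟨β, a⟩ | ⟨β, a⟩) | ⟨β, a⟩ <;> cases β <;> simp [hI₀, fI]
  have hNN : N₀ ∘ₗ N₀ = 0 := by
    refine r.ext fun s ↦ ?_
    rcases s with (⟨β, a⟩ | ⟨β, a⟩) | ⟨β, a⟩ <;> cases β <;> simp [hN₀, fN]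
  have hNI : N₀ ∘ₗ I₀ = -(I₀ ∘ₗ N₀) := by
    refine r.ext fun s ↦ ?_
    rcases s with (⟨β, a⟩ | ⟨β, a⟩) | ⟨β, a⟩ <;> cases β <;> simp [hI₀, hN₀, fI, fN]
  -- `Im N = span (Nu_i, INu_i)_i`
  have hrange : LinearMap.range N₀ = Submodule.span ℝ (Set.range fun s : Bool × Fin k ↦ r (Sum.inl (Sum.inl s))) := by
    apply le_antisymm
    · rw [LinearMap.range_eq_map, ← r.span_eq, Submodule.map_span, Submodule.span_le]
      rintro _ ⟨_, ⟨s, rfl⟩, rfl⟩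
      rcases s with (⟨β, a⟩ | ⟨β, a⟩) | ⟨β, a⟩ <;> cases β <;>
        simp only [hN₀, fN, SetLike.mem_coe, Submodule.zero_mem, cond_true, cond_false]
      · exact Submodule.subset_span ⟨(false, a), rfl⟩
      · exact Submodule.neg_mem _ (Submodule.subset_span ⟨(true, a), rfl⟩)
    · rw [Submodule.span_le]
      rintro _ ⟨⟨β, a⟩, rfl⟩
      cases β
      · exact ⟨r (Sum.inr (false, a)), by simp [hN₀, fN]⟩
      · exact ⟨-r (Sum.inr (true, a)), by simp [hN₀, fN]⟩
  have hli : LinearIndependent ℝ fun s : Bool × Fin k ↦ r (Sum.inl (Sum.inl s)) :=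
    r.linearIndependent.comp _ (Sum.inl_injective.comp Sum.inl_injective)
  refine ⟨LinearMap.toContinuousLinearMap I₀, LinearMap.toContinuousLinearMap N₀, fun v ↦ ?_, fun v ↦ ?_, fun v ↦ ?_,
    ?_, ?_⟩
  · simpa using LinearMap.congr_fun hII v
  · simpa using LinearMap.congr_fun hNN v
  · simpa using LinearMap.congr_fun hNI v
  · -- `N u_1 = Nu_1 ≠ 0`
    intro h0
    have h := congrArg (fun T : F →L[ℝ] F ↦ T (r (Sum.inr (false, ⟨0, hk1⟩)))) h0
    simp only [LinearMap.coe_toContinuousLinearMap', hN₀, fN, cond_false, _root_.zero_apply] at h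
    exact r.ne_zero _ h
  · rw [LinearMap.coe_toContinuousLinearMap, hrange, finrank_span_eq_card hli]
    simp

end KaehlerLocus

end Literature.Geometry.Hyperkaehler.TwistorLine
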